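import Literature.Topology.FourManifolds.HostTrack
import Literature.Topology.FourManifolds.PlanarBandFamily
import HarnessLib

/-!
# The crossing retraction: pushing the excursion of the host knot into the band

Topic `Literature/Topology/FourManifolds` (trunk T-4MAN). Fact seat
`provefact-Literature.Topology.FourManifolds.Knot.IsConnectedSum.isIsotopic` (Schubert's theorem),
geometric heart for rail knots, closure step. For the instance host knot (`HostTrack.lean`) the
excursion near the crossing (bridges, blend zones, stubs, the lower line, the window segment, the
bent upper ray) is replaced by a planar path **on the true band**: in blow-up coordinates the
family is the convex combination

  `mix u s = (1 - u) trk s + u Npl (hh s)`,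

where `Npl q = blowUp (Fband (κ q))` is the true band read in blow-up units (an `ε₁`-flat
perturbation of the plane `Y₂ = 0` by a second flatness package) and `hh` the target planar curve
(rail lines near the bridges, the level-parametrised hairpin `tgt ∘ mu` in the middle). The family
of sphere points `fam u s = host + χ (ψ⁻¹ (blowDown (mix u s)) - host)` with a cutoff `χ` in the
blown-up parameters is a family of modifications of the host knot (`Knot.IsModification`):
injectivity and regularity zone by zone from a strictly monotone coordinate (`Y₀` near the two
bridges, the level functional `lev` of `CrossingLevels.lean` along the excursion, up to
`O(ε₁)`-perturbations), separation of the zones by `Y₁` (and `Y₀`), separation from the rest of the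
host by `Y₀` near the cores and by the far-set argument elsewhere. The end knot agrees with the
host off the crossing region and is the true band point `ψ⁻¹ (Fband (κ hh s))` on it.

Main results (for `P : b.HostHyp …`, a second flatness package `hf₁ : b.IsFlat hcross ε₁ r₁`
with `ε₁ ≤ epsU` (a universal constant) and `4κ < r₁`): `isModification` (the family of
modifications on `[s₀, s₀'] = [paramLo (1/16), paramHi (1/16)]`), `outKnot` and
`isIsotopic_host_outKnot : P.host.IsIsotopic (P.outKnot hf₁ hε₁ hr₁)`, with the description
`outKnot_circlePt_of_mem : outKnot (circlePt s) = band ((1/2, 1/2) + κ hh s)` on `[s₀, s₀']` and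
`outKnot_circlePt_of_not_mem : outKnot (circlePt t) = host (circlePt t)` off it.

Everything is proved; no named facts are introduced.

## References

* M. W. Hirsch, *Differential Topology*, GTM 33, Springer (1976), Ch. 8 §1, Thm. 1.3.
  [HirschDT1976]
-/

open scoped Manifold ContDiff Topology Real
open Function Set Metric Filter

noncomputable section

namespace Literature.Topology.FourManifolds

/-- Local notation: `𝔼 n` is the model Euclidean space `EuclideanSpace ℝ (Fin n)`. -/
local notation "𝔼 " n:arg => EuclideanSpace ℝ (Fin n)

/-- Local notation: `𝕊 n` is the unit sphere in `EuclideanSpace ℝ (Fin (n + 1))`. -/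
local notation "𝕊 " n:arg => (Metric.sphere (0 : EuclideanSpace ℝ (Fin (n + 1))) 1)

attribute [local instance] fact_finrank_euclideanSpace_succ

open KnotsInBall ExitBend

namespace ExitBend

/-- The planar lift of a planar point: `(q₀, q₁, z)`. [folklore] -/
def lift (q : 𝔼 2) (z : ℝ) : 𝔼 3 := pt3 (q 0) (q 1) z

/-- Coordinates of the lift. [folklore] -/
@[simp] theorem lift_apply_zero (q : 𝔼 2) (z : ℝ) : lift q z 0 = q 0 := rfl

/-- Coordinates of the lift. [folklore] -/
@[simp] theorem lift_apply_one (q : 𝔼 2) (z : ℝ) : lift q z 1 = q 1 := rfl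

/-- Coordinates of the lift. [folklore] -/
@[simp] theorem lift_apply_two (q : 𝔼 2) (z : ℝ) : lift q z 2 = z := rfl

/-- **The level of the lifted target is the level parameter**: `lev (tgt m, z) = m`. [folklore] -/
theorem lev_lift_tgt (m z : ℝ) : lev (lift (tgt m) z) = m := by
  rw [lev_eq, lift_apply_zero, lift_apply_one, tgt_apply_zero, tgt_apply_one]
  have hε := epsP_pos.ne'
  field_simp
  ring

/-- The planar lift as the toLp vector of the flatness statements. [folklore] -/
theorem lift_eq_toLp (q : 𝔼 2) : lift q 0 = WithLp.toLp 2 ![q 0 - (0 : 𝔼 2) 0, q 1 - (0 : 𝔼 2) 1, 0] := by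
  ext i; fin_cases i <;> simp [lift]

/-- Differences of lifts. [folklore] -/
theorem lift_sub_lift (q q' : 𝔼 2) : lift q 0 - lift q' 0 = WithLp.toLp 2 ![q 0 - q' 0, q 1 - q' 1, 0] := by
  ext i; fin_cases i <;> simp [lift]

/-- The norm of a lift with `z = 0` is the planar norm. [folklore] -/
theorem norm_lift_zero (q : 𝔼 2) : ‖lift q 0‖ = ‖q‖ := by
  rw [EuclideanSpace.norm_eq, EuclideanSpace.norm_eq]
  congr 1
  simp [Fin.sum_univ_three, Fin.sum_univ_two, lift]

end ExitBend

namespace BandData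

variable {A B K : Knot} {avoid : Set (𝕊 3)} {b : BandData A B K avoid}
  {hcross : b.band ⁻¹' sphereEquator 2 ∩ squareNhd b.δ = {x ∈ squareNhd b.δ | x 0 = 2⁻¹}}
  {ε r A' κ lam₀ rA : ℝ} (P : b.HostHyp hcross ε r A' κ lam₀ rA)

namespace HostHyp

/-! ### The true band in blow-up units -/

/-- **The true band in blow-up units**: `Npl q = blowUp κ (Fband (κ q))`. [folklore] -/
def Npl (_ : b.HostHyp hcross ε r A' κ lam₀ rA) (q : 𝔼 2) : 𝔼 3 := b.blowUp hcross κ (b.Fband (κ • q))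

include P

/-- The true band point below a planar point read back: `ψ⁻¹ (blowDown (Npl q)) = ψ⁻¹ (Fband (κ q))`,
the band point `band ((1/2, 1/2) + κ q)`. [folklore] -/
theorem blowDown_Npl (q : 𝔼 2) : b.blowDown hcross κ (P.Npl q) = b.Fband (κ • q) := by
  rw [Npl, b.blowDown_blowUp hcross P.HU.cone.spike.κ_pos.ne']

omit P in
/-- The true band below a planar point with `‖κ q‖ < poleRad`: `ψ⁻¹ (Fband (κ q)) = band ((1/2,1/2) + κ q)`.
[folklore] -/
theorem psiN_symm_Fband {q : 𝔼 2} (hq : ‖κ • q‖ < b.poleRad hcross) : psiN.symm (b.Fband (κ • q)) = b.band (pt2 2⁻¹ 2⁻¹ + κ • q) := by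
  rw [Fband, psiN_symm_apply_psiN (b.band_ne_northPole_of_norm_lt hcross hq)]

section Flat

variable {ε₁ r₁ : ℝ} (hf₁ : b.IsFlat hcross ε₁ r₁)
include hf₁

/-- **Flatness of the true band in blow-up units**: `‖Npl q - (q, 0)‖ ≤ ε₁ ‖q‖` for `‖κ q‖ < r₁`.
[folklore] -/
theorem norm_Npl_sub_lift_le {q : 𝔼 2} (hq : ‖κ • q‖ < r₁) : ‖P.Npl q - lift q 0‖ ≤ ε₁ * ‖q‖ := by
  have hκ := P.HU.cone.spike.κ_pos
  have key := hf₁.flat (κ • q) 0 hq (by simpa using hf₁.r_pos)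
  have hF0 : b.Fband 0 = b.pZero := rfl
  rw [hF0, sub_zero] at key
  have e : P.Npl q - lift q 0 = κ⁻¹ • ((b.frame hcross).symm (b.Fband (κ • q) - b.pZero) -
      WithLp.toLp 2 ![(κ • q : 𝔼 2) 0 - (0 : 𝔼 2) 0, (κ • q : 𝔼 2) 1 - (0 : 𝔼 2) 1, 0]) := by
    rw [smul_sub, Npl, blowUp]
    congr 1
    ext i; fin_cases i <;> simp [lift, hκ.ne']
  rw [e, norm_smul, norm_inv, Real.norm_eq_abs, abs_of_pos hκ]
  calc κ⁻¹ * _ ≤ κ⁻¹ * (ε₁ * ‖κ • q‖) := by gcongr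
    _ = ε₁ * ‖q‖ := by rw [norm_smul, Real.norm_eq_abs, abs_of_pos hκ]; field_simp

/-- **Two-point flatness**: `‖(Npl q - Npl q') - (q - q', 0)‖ ≤ ε₁ ‖q - q'‖`. [folklore] -/
theorem norm_Npl_sub_Npl_sub_le {q q' : 𝔼 2} (hq : ‖κ • q‖ < r₁) (hq' : ‖κ • q'‖ < r₁) :
    ‖(P.Npl q - P.Npl q') - (lift q 0 - lift q' 0)‖ ≤ ε₁ * ‖q - q'‖ := by
  have hκ := P.HU.cone.spike.κ_pos
  have key := hf₁.flat (κ • q) (κ • q') hq hq'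
  have e : (P.Npl q - P.Npl q') - (lift q 0 - lift q' 0) = κ⁻¹ • ((b.frame hcross).symm (b.Fband (κ • q) - b.Fband (κ • q')) -
      WithLp.toLp 2 ![(κ • q : 𝔼 2) 0 - (κ • q' : 𝔼 2) 0, (κ • q : 𝔼 2) 1 - (κ • q' : 𝔼 2) 1, 0]) := by
    rw [smul_sub, Npl, Npl, blowUp, blowUp]
    have : (b.frame hcross).symm (b.Fband (κ • q) - b.pZero) - (b.frame hcross).symm (b.Fband (κ • q') - b.pZero) =
        (b.frame hcross).symm (b.Fband (κ • q) - b.Fband (κ • q')) := by rw [← map_sub]; congr 1; abel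
    rw [← smul_sub, this]
    congr 1
    ext i; fin_cases i <;> simp [lift] <;> field_simp
  rw [e, norm_smul, norm_inv, Real.norm_eq_abs, abs_of_pos hκ]
  calc κ⁻¹ * _ ≤ κ⁻¹ * (ε₁ * ‖κ • q - κ • q'‖) := by gcongr
    _ = ε₁ * ‖q - q'‖ := by rw [← smul_sub, norm_smul, Real.norm_eq_abs, abs_of_pos hκ]; field_simp

/-- **The derivative of the true band in blow-up units** at `q` (`‖κ q‖ < r₁`): it is
`w ↦ frame⁻¹ (D Fband (κ q) w)`, within `ε₁ ‖w‖` of the lift `(w, 0)`. [folklore] -/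
theorem hasFDerivAt_Npl {q : 𝔼 2} (hq : ‖κ • q‖ < r₁) :
    HasFDerivAt P.Npl ((((b.frame hcross).symm : (𝔼 3) ≃L[ℝ] 𝔼 3) : (𝔼 3) →L[ℝ] 𝔼 3).comp (fderiv ℝ b.Fband (κ • q))) q ∧
      ∀ w : 𝔼 2, ‖(((b.frame hcross).symm : (𝔼 3) ≃L[ℝ] 𝔼 3) : (𝔼 3) →L[ℝ] 𝔼 3) (fderiv ℝ b.Fband (κ • q) w) - lift w 0‖ ≤ ε₁ * ‖w‖ := by
  have hκ := P.HU.cone.spike.κ_pos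
  have hq' : ‖κ • q‖ < b.poleRad hcross := hq.trans_le hf₁.r_le
  have hF : HasFDerivAt b.Fband (fderiv ℝ b.Fband (κ • q)) (κ • q) := (b.differentiableAt_Fband hcross hq').hasFDerivAt
  have hs : HasFDerivAt (fun q : 𝔼 2 ↦ κ • q) (κ • ContinuousLinearMap.id ℝ (𝔼 2)) q := (hasFDerivAt_id q).const_smul κ
  have h1 := hF.comp q hs
  have h2 : HasFDerivAt (fun q ↦ b.Fband (κ • q) - b.pZero) ((fderiv ℝ b.Fband (κ • q)).comp (κ • ContinuousLinearMap.id ℝ (𝔼 2))) q :=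
    h1.sub_const _
  have h3 := ((((b.frame hcross).symm : (𝔼 3) ≃L[ℝ] 𝔼 3) : (𝔼 3) →L[ℝ] 𝔼 3).hasFDerivAt.comp q h2).const_smul κ⁻¹
  refine ⟨?_, fun w ↦ ?_⟩
  · have e : P.Npl = fun q ↦ κ⁻¹ • (((b.frame hcross).symm : (𝔼 3) ≃L[ℝ] 𝔼 3) : (𝔼 3) →L[ℝ] 𝔼 3) (b.Fband (κ • q) - b.pZero) := by
      funext q; rfl
    rw [e]
    refine h3.congr_fderiv ?_
    ext w
    simp [smul_smul, inv_mul_cancel₀ hκ.ne']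
  · exact hf₁.flat_fderiv (κ • q) hq w

end Flat

/-! ### The family -/

/-- **The blow-up family**: `mix u s = (1 - u) trk s + u Npl (hh s)`. [folklore] -/
def mix (u s : ℝ) : 𝔼 3 := (1 - u) • P.trk s + u • P.Npl (P.hh s)

/-- The transition cut `smoothStep (1/16) (1/8)`. [folklore] -/
def tcut (α : ℝ) : ℝ := smoothStep (1 / 16) (1 / 8) α

omit P in
/-- The transition cut is `C^∞`. [folklore] -/
theorem contDiff_tcut : ContDiff ℝ ∞ tcut := contDiff_smoothStep _ _

omit P in
/-- The transition cut vanishes left of `1/16`. [folklore] -/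
theorem tcut_of_le {α : ℝ} (h : α ≤ 1 / 16) : tcut α = 0 := smoothStep_of_le (by norm_num) h

omit P in
/-- The transition cut is `1` right of `1/8`. [folklore] -/
theorem tcut_of_ge {α : ℝ} (h : 1 / 8 ≤ α) : tcut α = 1 := smoothStep_of_ge (by norm_num) h

omit P in
/-- The transition cut takes values in `[0, 1]`. [folklore] -/
theorem tcut_mem (α : ℝ) : tcut α ∈ Icc (0 : ℝ) 1 := smoothStep_mem_Icc _ _ _

/-- **The cutoff** `χ s = tcut (αLo s) tcut (αHi s)`. [folklore] -/
def chi (_ : b.HostHyp hcross ε r A' κ lam₀ rA) (s : ℝ) : ℝ := tcut (b.alphaLo κ s) * tcut (b.alphaHi κ s)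

/-- The cutoff is `C^∞`. [folklore] -/
theorem contDiff_chi : ContDiff ℝ ∞ P.chi :=
  (contDiff_tcut.comp (b.contDiff_alphaLo κ)).mul (contDiff_tcut.comp (b.contDiff_alphaHi κ))

/-- The cutoff vanishes where `αLo ≤ 1/16`. [folklore] -/
theorem chi_of_alphaLo_le {s : ℝ} (h : b.alphaLo κ s ≤ 1 / 16) : P.chi s = 0 := by rw [chi, tcut_of_le h, zero_mul]

/-- The cutoff vanishes where `αHi ≤ 1/16`. [folklore] -/
theorem chi_of_alphaHi_le {s : ℝ} (h : b.alphaHi κ s ≤ 1 / 16) : P.chi s = 0 := by rw [chi, tcut_of_le h, mul_zero]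

/-- The cutoff is `1` where both blown-up parameters are `≥ 1/8`. [folklore] -/
theorem chi_of_ge {s : ℝ} (h1 : 1 / 8 ≤ b.alphaLo κ s) (h2 : 1 / 8 ≤ b.alphaHi κ s) : P.chi s = 1 := by
  rw [chi, tcut_of_ge h1, tcut_of_ge h2, mul_one]

/-- **The family of piece functions**: the host, moved by `χ` towards `ψ⁻¹ (blowDown (mix u s))`.
[folklore] -/
def fam (u s : ℝ) : 𝔼 4 :=
  Knot.curve P.host s + P.chi s • (((psiN.symm (b.blowDown hcross κ (P.mix u s)) : 𝕊 3) : 𝔼 4) - Knot.curve P.host s)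

/-- The curve of the host is the host point. [folklore] -/
theorem curve_host (s : ℝ) : Knot.curve P.host s = ((P.hostPt s : 𝕊 3) : 𝔼 4) := Knot.curve_apply _ _

/-! ### The moving interval and the transition zones -/

/-- The lower end `s₀` of the moving interval: `αLo = 1/16`. [folklore] -/
def sLo : ℝ := P.paramLo sixteenth_mem07

/-- The upper end `s₀'` of the moving interval: `αHi = 1/16`. [folklore] -/
def sHi : ℝ := P.paramHi sixteenth_mem07

/-- `αLo (s₀) = 1/16`, `s₀` in the lower core. [folklore] -/
theorem sLo_spec : b.alphaLo κ P.sLo = 1 / 16 ∧ P.sLo ∈ Icc b.tcLo (b.tcLo + b.epsLo / 8) :=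
  ⟨(P.paramLo_spec sixteenth_mem07).2, (P.paramLo_spec sixteenth_mem07).1⟩

/-- `αHi (s₀') = 1/16`, `s₀'` in the upper core. [folklore] -/
theorem sHi_spec : b.alphaHi κ P.sHi = 1 / 16 ∧ P.sHi ∈ Icc (b.tcHi - b.epsHi / 8) b.tcHi :=
  ⟨(P.paramHi_spec sixteenth_mem07).2, (P.paramHi_spec sixteenth_mem07).1⟩

/-- The moving interval lies in the region `[paramLo 0, paramHi 0]`. [folklore] -/
theorem Icc_sLo_sHi_subset : Icc P.sLo P.sHi ⊆ Icc (P.paramLo zero_mem07) (P.paramHi zero_mem07) := by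
  have h1 : P.paramLo zero_mem07 ≤ P.sLo := by
    rw [sLo, ← P.alphaLo_le_iff sixteenth_mem07 (P.paramLo_mem_core zero_mem07), (P.paramLo_spec zero_mem07).2]; norm_num
  have h2 : P.sHi ≤ P.paramHi zero_mem07 := by
    rw [sHi, ← P.alphaHi_le_iff sixteenth_mem07 (P.paramHi_mem_core zero_mem07), (P.paramHi_spec zero_mem07).2]; norm_num
  exact Icc_subset_Icc h1 h2

/-- **Off the moving interval the cutoff vanishes.** [folklore] -/
theorem chi_eq_zero_of_not_mem {t : ℝ} (ht : t ∉ Ioo P.sLo P.sHi) : P.chi t = 0 := by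
  have hκ := P.HU.cone.spike.κ_pos
  have hsl := P.sLo_spec; have hsh := P.sHi_spec
  rw [mem_Ioo, not_and_or, not_lt, not_lt] at ht
  rcases ht with ht | ht
  · -- left of `s₀`: either before the lower core (`χ₁` small) or in it with `αLo ≤ 1/16`
    apply P.chi_of_alphaLo_le
    by_cases hc : b.tcLo - b.epsLo / 8 ≤ t
    · have htc : t ∈ Icc (b.tcLo - b.epsLo / 8) (b.tcLo + b.epsLo / 8) := ⟨hc, ht.trans hsl.2.2⟩
      rw [← hsl.1]; exact (b.strictMonoOn_alphaLo (κ := κ) hκ).monotoneOn htc (P.paramLo_mem_core _) ht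
    · push Not at hc
      -- `chiLo t ≤ chiLo (tcLo - ε/8) ≤ 1/2 - gapLo < 1/2`
      have hmono : Monotone b.chiLo := monotone_smoothStep (by linarith [b.cLo_hyp.1, b.cLo_hyp.2.1])
      have h1 : b.chiLo t ≤ b.chiLo (b.tcLo - b.epsLo / 8) := hmono hc.le
      have h2 : b.gapLo ≤ 1 / 2 - b.chiLo (b.tcLo - b.epsLo / 8) := min_le_right _ _
      rw [alphaLo, div_le_iff₀ hκ]; linarith [b.gapLo_pos]
  · apply P.chi_of_alphaHi_le
    by_cases hc : t ≤ b.tcHi + b.epsHi / 8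
    · have htc : t ∈ Icc (b.tcHi - b.epsHi / 8) (b.tcHi + b.epsHi / 8) := ⟨hsh.2.1.trans ht, hc⟩
      rw [← hsh.1]; exact (b.strictAntiOn_alphaHi (κ := κ) hκ).antitoneOn (P.paramHi_mem_core _) htc ht
    · push Not at hc
      have hmono : Monotone (smoothStep (-b.ahi + b.epsHi) (-b.thi - b.epsHi)) := monotone_smoothStep (by linarith [b.cUp_hyp.1, b.cUp_hyp.2.1])
      have h1 : b.chiHi t ≤ b.chiHi (b.tcHi + b.epsHi / 8) := by
        simp only [chiHi]; exact hmono (by linarith)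
      have h2 : b.gapHi ≤ 1 / 2 - b.chiHi (b.tcHi + b.epsHi / 8) := min_le_right _ _
      rw [alphaHi, div_le_iff₀ hκ]; linarith [b.gapHi_pos]

/-- **In the lower transition zone the family is stationary**: for a lower-core parameter with
`αLo ≤ 1/8` (and `αLo ≥ 0`) the target `Npl (hh s)` is the track. [folklore] -/
theorem Npl_hh_eq_trk_of_alphaLo_le {s : ℝ} (hs : s ∈ Icc (b.tcLo - b.epsLo / 8) (b.tcLo + b.epsLo / 8))
    (h0 : 0 ≤ b.alphaLo κ s) (hα : b.alphaLo κ s ≤ 1 / 8) : P.Npl (P.hh s) = P.trk s := by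
  have hb : spikeBump (b.alphaLo κ s) = 0 := spikeBump_eq_zero_of_le hα
  rw [P.hh_of_alphaLo_le hs.2 (by linarith), P.trk_coreLo_of_lt hs (by linarith) (by linarith), hb, Npl, railLoPsi]
  simp only [sub_zero, one_smul, zero_smul, add_zero]
  congr 2
  ext i; fin_cases i <;> simp

/-- **In the upper transition zone the family is stationary.** [folklore] -/
theorem Npl_hh_eq_trk_of_alphaHi_le {s : ℝ} (hs : s ∈ Icc (b.tcHi - b.epsHi / 8) (b.tcHi + b.epsHi / 8))
    (h0 : 0 ≤ b.alphaHi κ s) (hα : b.alphaHi κ s ≤ 1 / 8) : P.Npl (P.hh s) = P.trk s := by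
  have hb : spikeBump (b.alphaHi κ s) = 0 := spikeBump_eq_zero_of_le hα
  rw [P.hh_of_alphaHi_le hs.1 (by linarith), P.trk_coreHi_of_lt hs (by linarith) (by linarith), hb, Npl, railHiPsi]
  simp only [sub_zero, one_smul, zero_smul, add_zero]
  congr 2
  ext i; fin_cases i <;> simp

/-! ### Where the blown-up parameters are small -/

/-- A parameter `≥ tcLo` with `αLo < 7` lies in the closed lower core. [folklore] -/
theorem mem_coreLo_of_alphaLo_lt {s : ℝ} (hs : b.tcLo ≤ s) (hα : b.alphaLo κ s < 7) :
    s ∈ Icc (b.tcLo - b.epsLo / 8) (b.tcLo + b.epsLo / 8) := by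
  have hκ := P.HU.cone.spike.κ_pos
  refine ⟨by linarith [b.epsLo_bounds.1], ?_⟩
  by_contra hc; push Not at hc
  have hmono : Monotone b.chiLo := monotone_smoothStep (by linarith [b.cLo_hyp.1, b.cLo_hyp.2.1])
  have h1 : b.chiLo (b.tcLo + b.epsLo / 8) ≤ b.chiLo s := hmono hc.le
  have h2 : b.gapLo ≤ b.chiLo (b.tcLo + b.epsLo / 8) - 1 / 2 := min_le_left _ _
  have h3 : 7 * κ ≤ b.gapLo := P.HU.cone.spike.seven_le_gapLo
  have : 7 ≤ b.alphaLo κ s := by rw [alphaLo, le_div_iff₀ hκ]; linarith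
  linarith

/-- A parameter `≤ tcHi` with `αHi < 7` lies in the closed upper core. [folklore] -/
theorem mem_coreHi_of_alphaHi_lt {s : ℝ} (hs : s ≤ b.tcHi) (hα : b.alphaHi κ s < 7) :
    s ∈ Icc (b.tcHi - b.epsHi / 8) (b.tcHi + b.epsHi / 8) := by
  have hκ := P.HU.cone.spike.κ_pos
  refine ⟨?_, by linarith [b.epsHi_bounds.1]⟩
  by_contra hc; push Not at hc
  have hmono : Monotone (smoothStep (-b.ahi + b.epsHi) (-b.thi - b.epsHi)) := monotone_smoothStep (by linarith [b.cUp_hyp.1, b.cUp_hyp.2.1])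
  have h1 : b.chiHi (b.tcHi - b.epsHi / 8) ≤ b.chiHi s := by simp only [chiHi]; exact hmono (by linarith)
  have h2 : b.gapHi ≤ b.chiHi (b.tcHi - b.epsHi / 8) - 1 / 2 := min_le_left _ _
  have h3 : 7 * κ ≤ b.gapHi := P.HU.cone.spike.seven_le_gapHi
  have : 7 ≤ b.alphaHi κ s := by rw [alphaHi, le_div_iff₀ hκ]; linarith
  linarith

/-- On the moving interval `αLo ≥ 1/16`. [folklore] -/
theorem alphaLo_ge_of_mem {s : ℝ} (hs : s ∈ Icc P.sLo P.sHi) : 1 / 16 ≤ b.alphaLo κ s := by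
  by_contra hc; push Not at hc
  have hsc := P.mem_coreLo_of_alphaLo_lt (P.sLo_spec.2.1.trans hs.1) (by linarith)
  have := (P.alphaLo_lt_iff sixteenth_mem07 hsc).1 hc
  exact absurd hs.1 (not_le.2 this)

/-- On the moving interval `αHi ≥ 1/16`. [folklore] -/
theorem alphaHi_ge_of_mem {s : ℝ} (hs : s ∈ Icc P.sLo P.sHi) : 1 / 16 ≤ b.alphaHi κ s := by
  by_contra hc; push Not at hc
  have hsc := P.mem_coreHi_of_alphaHi_lt (hs.2.trans P.sHi_spec.2.2) (by linarith)
  have := (P.alphaHi_lt_iff sixteenth_mem07 hsc).1 hc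
  exact absurd hs.2 (not_le.2 this)

/-- **On the moving interval the blow-up family agrees with the track wherever the cutoff is not
`1`.** [folklore] -/
theorem mix_eq_trk_of_chi_ne_one {u s : ℝ} (hs : s ∈ Icc P.sLo P.sHi) (hc : P.chi s ≠ 1) : P.mix u s = P.trk s := by
  have h1 := P.alphaLo_ge_of_mem hs; have h2 := P.alphaHi_ge_of_mem hs
  have key : P.Npl (P.hh s) = P.trk s := by
    by_cases hα : b.alphaLo κ s < 1 / 8
    · exact P.Npl_hh_eq_trk_of_alphaLo_le (P.mem_coreLo_of_alphaLo_lt (P.sLo_spec.2.1.trans hs.1) (by linarith)) (by linarith) hα.le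
    · by_cases hα' : b.alphaHi κ s < 1 / 8
      · exact P.Npl_hh_eq_trk_of_alphaHi_le (P.mem_coreHi_of_alphaHi_lt (hs.2.trans P.sHi_spec.2.2) (by linarith)) (by linarith) hα'.le
      · push Not at hα hα'
        exact absurd (P.chi_of_ge hα hα') hc
  rw [mix, key, ← add_smul]; simp

/-- **The family on the moving interval**: `fam u s = ψ⁻¹ (blowDown (mix u s))`. [folklore] -/
theorem fam_of_mem {u s : ℝ} (hs : s ∈ Icc P.sLo P.sHi) :
    P.fam u s = ((psiN.symm (b.blowDown hcross κ (P.mix u s)) : 𝕊 3) : 𝔼 4) := by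
  by_cases hc : P.chi s = 1
  · rw [fam, hc, one_smul]; abel
  · rw [fam, P.mix_eq_trk_of_chi_ne_one hs hc, P.curve_host, ← P.coe_hostPt_eq (P.Icc_sLo_sHi_subset hs)]
    simp

/-- **The family off the open moving interval** is the host. [folklore] -/
theorem fam_of_not_mem (u : ℝ) {t : ℝ} (ht : t ∉ Ioo P.sLo P.sHi) : P.fam u t = Knot.curve P.host t := by
  rw [fam, P.chi_eq_zero_of_not_mem ht, zero_smul, add_zero]

/-- At `u = 0` the blow-up family is the track. [folklore] -/
@[simp] theorem mix_zero (s : ℝ) : P.mix 0 s = P.trk s := by simp [mix]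

/-- At `u = 1` the blow-up family is the true band below the target. [folklore] -/
@[simp] theorem mix_one (s : ℝ) : P.mix 1 s = P.Npl (P.hh s) := by simp [mix]

/-- **At `u = 0` the family is the host.** [folklore] -/
theorem fam_zero (t : ℝ) : P.fam 0 t = Knot.curve P.host t := by
  by_cases ht : t ∈ Ioo P.sLo P.sHi
  · rw [P.fam_of_mem (Ioo_subset_Icc_self ht), mix_zero, P.curve_host, P.coe_hostPt_eq (P.Icc_sLo_sHi_subset (Ioo_subset_Icc_self ht))]
  · exact P.fam_of_not_mem 0 ht

/-- `s₀ < s₀'`, indeed `paramLo 0 < s₀` and `s₀' < paramHi 0`. [folklore] -/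
theorem marks : P.paramLo zero_mem07 < P.sLo ∧ P.sLo < P.sHi ∧ P.sHi < P.paramHi zero_mem07 := by
  have h1 : P.paramLo zero_mem07 < P.sLo := by
    rw [sLo, ← P.alphaLo_lt_iff sixteenth_mem07 (P.paramLo_mem_core zero_mem07), (P.paramLo_spec zero_mem07).2]; norm_num
  have h3 : P.sHi < P.paramHi zero_mem07 := by
    rw [sHi, ← P.alphaHi_lt_iff sixteenth_mem07 (P.paramHi_mem_core zero_mem07), (P.paramHi_spec zero_mem07).2]; norm_num
  have h2 : P.sLo < P.sHi := by
    have := P.sLo_spec.2.2; have := P.sHi_spec.2.1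
    obtain ⟨-, hb, hc, -⟩ := b.neckSet_bounds
    have := b.marks_lt; have := b.epsLo_bounds.1; have := b.epsHi_bounds.1
    linarith
  exact ⟨h1, h2, h3⟩

/-! ### The size of the target -/

/-- **The level on the excursion lies in `[-ε_P, 1]`.** [folklore] -/
theorem mu_mem {s : ℝ} (hs : s ∈ Icc (P.paramLo quarter_mem07) (P.paramHi quarter_mem07)) : P.mu s ∈ Icc (-epsP) 1 := by
  have hq := P.paramLo_spec quarter_mem07; have hq' := P.paramHi_spec quarter_mem07
  have hlo : P.mu (P.paramLo quarter_mem07) = -epsP := by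
    rw [P.mu_stubLo (P.paramLo_mem_core quarter_mem07) (by rw [hq.2]; norm_num), hq.2]; ring
  have hhi : P.mu (P.paramHi quarter_mem07) = 1 := by
    rw [P.mu_stubHi (P.paramHi_mem_core quarter_mem07) (by rw [hq'.2]; norm_num), hq'.2]; ring
  have hm := P.strictMonoOn_mu.monotoneOn
  have hle : P.paramLo quarter_mem07 ≤ P.paramHi quarter_mem07 := hs.1.trans hs.2
  exact ⟨hlo ▸ hm ⟨le_rfl, hle⟩ hs hs.1, hhi ▸ hm hs ⟨hle, le_rfl⟩ hs.2⟩

/-- **The target planar curve is bounded**: `‖hh s‖ ≤ 3` on `[paramLo 0, paramHi 0]`. [folklore] -/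
theorem norm_hh_le {s : ℝ} (hs : s ∈ Icc (P.paramLo zero_mem07) (P.paramHi zero_mem07)) : ‖P.hh s‖ ≤ 3 := by
  have hκ := P.HU.cone.spike.κ_pos
  have h0 := P.paramLo_spec zero_mem07; have h0c := P.paramLo_mem_core zero_mem07
  have h0' := P.paramHi_spec zero_mem07; have h0c' := P.paramHi_mem_core zero_mem07
  have hq := P.paramLo_spec quarter_mem07; have hqc := P.paramLo_mem_core quarter_mem07
  have hq' := P.paramHi_spec quarter_mem07; have hqc' := P.paramHi_mem_core quarter_mem07
  -- three cases: lower side with `αLo ≤ 3/8`, upper side with `αHi ≤ 3/8`, or both `> 3/8`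
  by_cases h1 : b.alphaLo κ s ≤ 3 / 8
  · have hsc := P.mem_coreLo_of_alphaLo_lt (h0.1.1.trans hs.1) (by linarith)
    have hα0 : 0 ≤ b.alphaLo κ s := by rw [← h0.2]; exact (b.strictMonoOn_alphaLo (κ := κ) hκ).monotoneOn h0c hsc hs.1
    by_cases h2 : b.alphaLo κ s ≤ 1 / 4
    · rw [P.hh_of_alphaLo_le hsc.2 (by linarith)]
      refine (BandData.norm_pt2_le _ _).trans ?_
      rw [abs_of_nonneg hα0]; norm_num; linarith
    · push Not at h2
      rw [P.hh_stubLo hsc ⟨h2.le, h1⟩]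
      refine (BandData.norm_pt2_le _ _).trans ?_
      have hw := wCut_mem (b.alphaLo κ s)
      have hy : |-1 + wCut (b.alphaLo κ s) * (4 / 3 * (b.alphaLo κ s - 1 / 4))| ≤ 1 :=
        abs_le.2 ⟨by nlinarith [hw.1, hw.2], by nlinarith [hw.1, hw.2]⟩
      rw [abs_of_nonneg hα0]; linarith
  by_cases h1' : b.alphaHi κ s ≤ 3 / 8
  · have hsc := P.mem_coreHi_of_alphaHi_lt (hs.2.trans h0'.1.2) (by linarith)
    have hα0 : 0 ≤ b.alphaHi κ s := by rw [← h0'.2]; exact (b.strictAntiOn_alphaHi (κ := κ) hκ).antitoneOn hsc h0c' hs.2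
    by_cases h2 : b.alphaHi κ s ≤ 1 / 4
    · rw [P.hh_of_alphaHi_le hsc.1 (by linarith)]
      refine (BandData.norm_pt2_le _ _).trans ?_
      rw [abs_of_nonneg hα0]; norm_num; linarith
    · push Not at h2
      rw [P.hh_stubHi hsc ⟨h2.le, h1'⟩]
      refine (BandData.norm_pt2_le _ _).trans ?_
      have hw := wCut_mem (b.alphaHi κ s)
      have hy : |1 - wCut (b.alphaHi κ s) * (4 / 3 * (b.alphaHi κ s - 1 / 4))| ≤ 1 :=
        abs_le.2 ⟨by nlinarith [hw.1, hw.2], by nlinarith [hw.1, hw.2]⟩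
      rw [abs_of_nonneg hα0]; linarith
  push Not at h1 h1'
  rw [P.hh_of_ge (by linarith) (by linarith)]
  -- `s` lies between `paramLo (1/4)` and `paramHi (1/4)`
  have hsq : s ∈ Icc (P.paramLo quarter_mem07) (P.paramHi quarter_mem07) := by
    constructor
    · by_contra hc; push Not at hc
      have hsc : s ∈ Icc (b.tcLo - b.epsLo / 8) (b.tcLo + b.epsLo / 8) := ⟨by linarith [hs.1, h0c.1], by linarith [hqc.2]⟩
      have := (P.alphaLo_lt_iff quarter_mem07 hsc).2 hc; linarith
    · by_contra hc; push Not at hc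
      have hsc : s ∈ Icc (b.tcHi - b.epsHi / 8) (b.tcHi + b.epsHi / 8) := ⟨by linarith [hqc'.1], by linarith [hs.2, h0c'.2]⟩
      have := (P.alphaHi_lt_iff quarter_mem07 hsc).2 hc; linarith
  obtain ⟨ht0, ht1⟩ := tgt_mem (P.mu_mem hsq)
  have e : tgt (P.mu s) = pt2 (tgt (P.mu s) 0) (tgt (P.mu s) 1) := by ext i; fin_cases i <;> rfl
  rw [e]
  refine (BandData.norm_pt2_le _ _).trans ?_
  have hy : |tgt (P.mu s) 1| ≤ 1 := abs_le.2 ⟨ht1.1, ht1.2⟩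
  rw [abs_of_nonneg (by linarith [ht0.1])]; linarith [ht0.2]

/-- On `[paramLo 0, paramHi 0]` the scaled target lies in the flat ball of the scale and below
the pole-free radius: `‖κ hh s‖ < 8κ ≤ poleRad`, and `< r`. [folklore] -/
theorem norm_smul_hh_lt {s : ℝ} (hs : s ∈ Icc (P.paramLo zero_mem07) (P.paramHi zero_mem07)) :
    ‖κ • P.hh s‖ < b.poleRad hcross ∧ ‖κ • P.hh s‖ < r := by
  have h := P.HU.cone.spike
  have hκ := h.κ_pos
  have hn : ‖κ • P.hh s‖ ≤ κ * 3 := by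
    rw [norm_smul, Real.norm_eq_abs, abs_of_pos hκ]; exact mul_le_mul_of_nonneg_left (P.norm_hh_le hs) hκ.le
  have h8 := h.eight_le_poleRad
  have h8r := h.eight_lt_r
  exact ⟨by linarith, by linarith⟩

/-! ### Smoothness of the family -/

/-- `Npl` is `C^∞` at planar points below the pole-free radius. [folklore] -/
theorem contDiffAt_Npl {q : 𝔼 2} (hq : ‖κ • q‖ < b.poleRad hcross) : ContDiffAt ℝ ∞ P.Npl q :=
  (b.contDiff_blowUp hcross κ).contDiffAt.comp q ((b.contDiffAt_Fband hcross hq).comp q (contDiff_const_smul κ).contDiffAt)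

/-- **The blow-up family is jointly `C^∞`** over the region `[paramLo 0, paramHi 0]`. [folklore] -/
theorem contDiffAt_mix {u s : ℝ} (hs : s ∈ Icc (P.paramLo zero_mem07) (P.paramHi zero_mem07)) :
    ContDiffAt ℝ ∞ (uncurry P.mix) (u, s) := by
  have hT : ContDiffAt ℝ ∞ (P.trk ∘ Prod.snd) (u, s) := ContDiffAt.comp (g := P.trk) (f := Prod.snd) (u, s) (P.contDiffAt_trk hs) contDiffAt_snd
  have hH : ContDiffAt ℝ ∞ (P.hh ∘ Prod.snd) (u, s) := ContDiffAt.comp (g := P.hh) (f := Prod.snd) (u, s) (P.contDiffAt_hh hs) contDiffAt_snd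
  have hN : ContDiffAt ℝ ∞ (fun p : ℝ × ℝ ↦ P.Npl (P.hh p.2)) (u, s) :=
    ContDiffAt.comp (g := P.Npl) (f := P.hh ∘ Prod.snd) (u, s) (P.contDiffAt_Npl (P.norm_smul_hh_lt hs).1) hH
  have h1 : ContDiffAt ℝ ∞ (fun p : ℝ × ℝ ↦ (1 - p.1 : ℝ)) (u, s) := contDiffAt_const.sub contDiffAt_fst
  exact (h1.smul hT).add (contDiffAt_fst.smul hN)

/-- **The family is jointly `C^∞`.** [folklore] -/
theorem contDiff_fam : ContDiff ℝ ∞ (uncurry P.fam) := by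
  have hm := P.marks
  rw [contDiff_iff_contDiffAt]
  rintro ⟨u, s⟩
  have hcurve : ContDiffAt ℝ ∞ (fun p : ℝ × ℝ ↦ Knot.curve P.host p.2) (u, s) :=
    (P.host.contDiff_curve.comp contDiff_snd).contDiffAt
  by_cases hs : s ∈ Ioo (P.paramLo zero_mem07) (P.paramHi zero_mem07)
  · -- inside the region everything is smooth
    have hχ : ContDiffAt ℝ ∞ (fun p : ℝ × ℝ ↦ P.chi p.2) (u, s) := (P.contDiff_chi.comp contDiff_snd).contDiffAt
    have hX : ContDiffAt ℝ ∞ (fun p : ℝ × ℝ ↦ ((psiN.symm (b.blowDown hcross κ (P.mix p.1 p.2)) : 𝕊 3) : 𝔼 4)) (u, s) :=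
      contDiff_coe_psiN_symm.contDiffAt.comp (u, s) ((b.contDiff_blowDown hcross κ).contDiffAt.comp (u, s)
        (P.contDiffAt_mix (Ioo_subset_Icc_self hs)))
    exact hcurve.add (hχ.smul (hX.sub hcurve))
  · -- outside the closed moving interval the family is the host
    have hs' : s ∉ Icc P.sLo P.sHi := fun h ↦ hs ⟨hm.1.trans_le h.1, h.2.trans_lt hm.2.2⟩
    have hopen : IsOpen {p : ℝ × ℝ | p.2 ∉ Icc P.sLo P.sHi} := isClosed_Icc.isOpen_compl.preimage continuous_snd
    have hev : uncurry P.fam =ᶠ[𝓝 (u, s)] fun p : ℝ × ℝ ↦ Knot.curve P.host p.2 := by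
      filter_upwards [hopen.mem_nhds (show (u, s) ∈ {p : ℝ × ℝ | p.2 ∉ Icc P.sLo P.sHi} from hs')] with p hp
      exact P.fam_of_not_mem p.1 (fun h ↦ hp (Ioo_subset_Icc_self h))
    exact hcurve.congr_of_eventuallyEq hev

/-! ### The universal smallness of the second flatness package -/

/-- **The universal flatness tolerance** for the crossing retraction. [folklore] -/
def epsU : ℝ := 1 / (64 * (4 + bumpBound + 8 * smoothTransitionDerivBound + tgtLip))

omit P in
/-- The tolerance is positive. [folklore] -/
theorem epsU_pos : 0 < epsU := by
  unfold epsU; have := bumpBound_spec.1; have := smoothTransitionDerivBound_pos; have := tgtLip_pos; positivity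

omit P in
/-- Consequences of `ε₁ ≤ epsU`. [folklore] -/
theorem epsU_small {ε₁ : ℝ} (h : ε₁ ≤ epsU) :
    64 * ε₁ * (4 + bumpBound + 8 * smoothTransitionDerivBound + tgtLip) ≤ 1 ∧ ε₁ ≤ 1 / 256 := by
  have hB := bumpBound_spec.1; have hC := smoothTransitionDerivBound_pos; have hT := tgtLip_pos
  set D := 4 + bumpBound + 8 * smoothTransitionDerivBound + tgtLip with hD
  have hD0 : 0 < D := by positivity
  have h1 : 64 * ε₁ * D ≤ 1 := by
    have := mul_le_mul_of_nonneg_left h (by positivity : (0:ℝ) ≤ 64 * D)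
    unfold epsU at this
    rw [← hD, mul_one_div_cancel (by positivity)] at this
    linarith
  refine ⟨h1, h.trans ?_⟩
  unfold epsU; rw [← hD]
  exact one_div_le_one_div_of_le (by norm_num) (by nlinarith)

/-! ### Zone formulas as functions of the blown-up parameter -/

/-- The lower height profile of the target: `G (α) = -1 + wCut (α) (4/3)(α - 1/4)`. [folklore] -/
def gLoT (α : ℝ) : ℝ := -1 + wCut α * (4 / 3 * (α - 1 / 4))

/-- The upper height profile of the target: `1 - wCut (α) (4/3)(α - 1/4)`. [folklore] -/
def gHiT (α : ℝ) : ℝ := 1 - wCut α * (4 / 3 * (α - 1 / 4))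

omit P in
/-- Derivative of the lower height profile, with a universal bound on `[0, 3/8]`. [folklore] -/
theorem hasDerivAt_gLoT (α : ℝ) (hα : α ∈ Icc (0 : ℝ) (3 / 8)) :
    HasDerivAt gLoT (deriv gLoT α) α ∧ |deriv gLoT α| ≤ 4 / 3 + 16 * smoothTransitionDerivBound := by
  have hw : HasDerivAt wCut (deriv Real.smoothTransition ((α - (1 / 4 + 1 / 48)) / (1 / 4 + 1 / 24 - (1 / 4 + 1 / 48))) *
      (1 / 4 + 1 / 24 - (1 / 4 + 1 / 48))⁻¹) α := hasDerivAt_smoothStep (1 / 4 + 1 / 48) (1 / 4 + 1 / 24) α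
  set D := deriv Real.smoothTransition ((α - (1 / 4 + 1 / 48)) / (1 / 4 + 1 / 24 - (1 / 4 + 1 / 48))) with hD
  have h48 : (1 / 4 + 1 / 24 - (1 / 4 + 1 / 48) : ℝ)⁻¹ = 48 := by norm_num
  rw [h48] at hw
  have h : HasDerivAt gLoT (D * 48 * (4 / 3 * (α - 1 / 4)) + wCut α * (4 / 3 * 1)) α := by
    have e : gLoT = fun x ↦ -1 + wCut x * (4 / 3 * (x - 1 / 4)) := rfl
    rw [e]
    exact (hw.mul (((hasDerivAt_id α).sub_const (1 / 4 : ℝ)).const_mul (4 / 3 : ℝ))).const_add (-1 : ℝ)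
  refine ⟨h.differentiableAt.hasDerivAt, ?_⟩
  rw [h.deriv]
  have hC := norm_deriv_smoothTransition_le ((α - (1 / 4 + 1 / 48)) / (1 / 4 + 1 / 24 - (1 / 4 + 1 / 48)))
  rw [Real.norm_eq_abs, ← hD] at hC
  have hwm := wCut_mem α
  have h1 : |D * 48 * (4 / 3 * (α - 1 / 4))| ≤ smoothTransitionDerivBound * 16 := by
    rw [abs_mul]
    have ha : |4 / 3 * (α - 1 / 4)| ≤ 1 / 3 := by rw [abs_le]; constructor <;> linarith [hα.1, hα.2]
    have hb : |D * 48| ≤ smoothTransitionDerivBound * 48 := by rw [abs_mul, abs_of_pos (by norm_num : (0:ℝ) < 48)]; gcongr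
    calc |D * 48| * |4 / 3 * (α - 1 / 4)| ≤ (smoothTransitionDerivBound * 48) * (1 / 3) :=
          mul_le_mul hb ha (abs_nonneg _) (by have := smoothTransitionDerivBound_pos; positivity)
      _ = smoothTransitionDerivBound * 16 := by ring
  have h2 : |wCut α * (4 / 3 * 1)| ≤ 4 / 3 := by
    rw [abs_mul, abs_of_nonneg hwm.1]; norm_num; linarith [hwm.2]
  calc |D * 48 * (4 / 3 * (α - 1 / 4)) + wCut α * (4 / 3 * 1)|
      ≤ |D * 48 * (4 / 3 * (α - 1 / 4))| + |wCut α * (4 / 3 * 1)| := abs_add_le _ _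
    _ ≤ smoothTransitionDerivBound * 16 + 4 / 3 := add_le_add h1 h2
    _ = 4 / 3 + 16 * smoothTransitionDerivBound := by ring

omit P in
/-- Derivative of the upper height profile, with the same bound. [folklore] -/
theorem hasDerivAt_gHiT (α : ℝ) (hα : α ∈ Icc (0 : ℝ) (3 / 8)) :
    HasDerivAt gHiT (deriv gHiT α) α ∧ |deriv gHiT α| ≤ 4 / 3 + 16 * smoothTransitionDerivBound := by
  obtain ⟨hg, hb⟩ := hasDerivAt_gLoT α hα
  have e : gHiT = fun α ↦ -gLoT α := by funext α; simp [gHiT, gLoT]; ring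
  have h : HasDerivAt gHiT (-deriv gLoT α) α := by rw [e]; exact hg.neg
  refine ⟨h.differentiableAt.hasDerivAt, ?_⟩
  rw [h.deriv, abs_neg]; exact hb

/-- **The target on the lower zone** (`αLo ≤ 3/8`, lower core): `(αLo, G (αLo))`. [folklore] -/
theorem hh_zoneLo {s : ℝ} (hs : s ∈ Icc (b.tcLo - b.epsLo / 8) (b.tcLo + b.epsLo / 8)) (hα : b.alphaLo κ s ≤ 3 / 8) :
    P.hh s = pt2 (b.alphaLo κ s) (gLoT (b.alphaLo κ s)) := by
  by_cases h : b.alphaLo κ s ≤ 1 / 4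
  · rw [P.hh_of_alphaLo_le hs.2 (by linarith), gLoT, wCut_of_le (by linarith)]; simp
  · push Not at h; rw [P.hh_stubLo hs ⟨h.le, hα⟩]; rfl

/-- **The target on the upper zone**: `(αHi, 1 - wCut (4/3)(αHi - 1/4))`. [folklore] -/
theorem hh_zoneHi {s : ℝ} (hs : s ∈ Icc (b.tcHi - b.epsHi / 8) (b.tcHi + b.epsHi / 8)) (hα : b.alphaHi κ s ≤ 3 / 8) :
    P.hh s = pt2 (b.alphaHi κ s) (gHiT (b.alphaHi κ s)) := by
  by_cases h : b.alphaHi κ s ≤ 1 / 4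
  · rw [P.hh_of_alphaHi_le hs.1 (by linarith), gHiT, wCut_of_le (by linarith)]; simp
  · push Not at h; rw [P.hh_stubHi hs ⟨h.le, hα⟩]; rfl

/-- The track on the lower zone is the blow-up of the spiked lower piece (compact form). [folklore] -/
theorem trk_zoneLo {s : ℝ} (hs : s ∈ Icc (b.tcLo - b.epsLo / 8) (b.tcLo + b.epsLo / 8)) (hα : b.alphaLo κ s < 3 / 8)
    (hq : κ * (|b.alphaLo κ s| + 1) < r) :
    P.trk s = b.blowUp hcross κ (b.pieceLo hcross κ b.depthSign 1 (b.alphaLo κ s)) := by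
  rw [P.trk_coreLo_flat hs hα hq, b.blowUp_pieceLo hcross P.HU.cone.spike.κ_pos.ne']; simp

/-- The track on the upper zone (compact form). [folklore] -/
theorem trk_zoneHi {s : ℝ} (hs : s ∈ Icc (b.tcHi - b.epsHi / 8) (b.tcHi + b.epsHi / 8)) (hα : b.alphaHi κ s < 3 / 8)
    (hq : κ * (|b.alphaHi κ s| + 1) < r) :
    P.trk s = b.blowUp hcross κ (b.pieceHi hcross κ b.depthSign 1 (b.alphaHi κ s)) := by
  rw [P.trk_coreHi_flat hs hα hq, b.blowUp_pieceHi hcross P.HU.cone.spike.κ_pos.ne']; simp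

/-! ### The zones -/

omit P in
/-- `11/32 ∈ [0, 7]`. [folklore] -/
theorem el32_mem07 : (11 / 32 : ℝ) ∈ Icc (0 : ℝ) 7 := by norm_num

omit P in
/-- `3/10 ∈ [0, 7]`. [folklore] -/
theorem three10_mem07 : (3 / 10 : ℝ) ∈ Icc (0 : ℝ) 7 := by norm_num

/-- The right end of the lower zone. [folklore] -/
def zL : ℝ := P.paramLo el32_mem07

/-- The left end of the upper zone. [folklore] -/
def zU : ℝ := P.paramHi el32_mem07

/-- The left end of the middle zone. [folklore] -/
def eL : ℝ := P.paramLo three10_mem07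

/-- The right end of the middle zone. [folklore] -/
def eU : ℝ := P.paramHi three10_mem07

/-- **Order of the zone marks**: `paramLo 0 < s₀ < eL < zL < zU < eU < s₀' < paramHi 0`, the
lower marks in the open lower core, the upper ones in the open upper core. [folklore] -/
theorem zone_marks : P.sLo < P.eL ∧ P.eL < P.zL ∧ P.zL < b.tcLo + b.epsLo / 8 ∧
    b.tcHi - b.epsHi / 8 < P.zU ∧ P.zU < P.eU ∧ P.eU < P.sHi := by
  have hκ := P.HU.cone.spike.κ_pos
  have hsL := P.paramLo_spec sixteenth_mem07; have heL := P.paramLo_spec three10_mem07; have hzL := P.paramLo_spec el32_mem07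
  have hsU := P.paramHi_spec sixteenth_mem07; have heU := P.paramHi_spec three10_mem07; have hzU := P.paramHi_spec el32_mem07
  have hm := b.strictMonoOn_alphaLo (κ := κ) hκ; have hm' := b.strictAntiOn_alphaHi (κ := κ) hκ
  refine ⟨?_, ?_, ?_, ?_, ?_, ?_⟩
  · rw [sLo, eL, ← P.alphaLo_lt_iff three10_mem07 (P.paramLo_mem_core sixteenth_mem07), hsL.2]; norm_num
  · rw [eL, zL, ← P.alphaLo_lt_iff el32_mem07 (P.paramLo_mem_core three10_mem07), heL.2]; norm_num
  · by_contra hc; push Not at hc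
    have h7 : 7 ≤ b.alphaLo κ (b.tcLo + b.epsLo / 8) := by
      rw [alphaLo, le_div_iff₀ hκ]
      have : b.gapLo ≤ b.chiLo (b.tcLo + b.epsLo / 8) - 1 / 2 := min_le_left _ _
      linarith [P.HU.cone.spike.seven_le_gapLo]
    have hcore : b.tcLo + b.epsLo / 8 ∈ Icc (b.tcLo - b.epsLo / 8) (b.tcLo + b.epsLo / 8) := ⟨by linarith [b.epsLo_bounds.1], le_rfl⟩
    have := hm.monotoneOn hcore (P.paramLo_mem_core el32_mem07) hc
    rw [show P.paramLo el32_mem07 = P.zL from rfl] at this; rw [zL] at this; rw [hzL.2] at this; linarith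
  · by_contra hc; push Not at hc
    have h7 : 7 ≤ b.alphaHi κ (b.tcHi - b.epsHi / 8) := by
      rw [alphaHi, le_div_iff₀ hκ]
      have : b.gapHi ≤ b.chiHi (b.tcHi - b.epsHi / 8) - 1 / 2 := min_le_left _ _
      linarith [P.HU.cone.spike.seven_le_gapHi]
    have hcore : b.tcHi - b.epsHi / 8 ∈ Icc (b.tcHi - b.epsHi / 8) (b.tcHi + b.epsHi / 8) := ⟨le_rfl, by linarith [b.epsHi_bounds.1]⟩
    have := hm'.antitoneOn (P.paramHi_mem_core el32_mem07) hcore hc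
    rw [show P.paramHi el32_mem07 = P.zU from rfl] at this; rw [zU] at this; rw [hzU.2] at this; linarith
  · rw [zU, eU, ← P.alphaHi_lt_iff el32_mem07 (P.paramHi_mem_core three10_mem07), heU.2]; norm_num
  · rw [eU, sHi, ← P.alphaHi_lt_iff three10_mem07 (P.paramHi_mem_core sixteenth_mem07), hsU.2]; norm_num

/-- On the lower zone `[s₀, zL]`: the parameter is in the open lower core with `1/16 ≤ αLo ≤ 11/32`.
[folklore] -/
theorem zoneLo_facts {s : ℝ} (hs : s ∈ Icc P.sLo P.zL) :
    s ∈ Ioo (b.tcLo - b.epsLo / 8) (b.tcLo + b.epsLo / 8) ∧ b.alphaLo κ s ∈ Icc (1 / 16 : ℝ) (11 / 32) := by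
  have hκ := P.HU.cone.spike.κ_pos
  have hzm := P.zone_marks; have hsl := P.sLo_spec; have hzl := P.paramLo_spec el32_mem07
  have hso : s ∈ Ioo (b.tcLo - b.epsLo / 8) (b.tcLo + b.epsLo / 8) :=
    ⟨by linarith [hs.1, hsl.2.1, b.epsLo_bounds.1], lt_of_le_of_lt hs.2 hzm.2.2.1⟩
  have hsc := Ioo_subset_Icc_self hso
  have hm := b.strictMonoOn_alphaLo (κ := κ) hκ
  refine ⟨hso, ?_, ?_⟩
  · rw [← hsl.1]; exact hm.monotoneOn (P.paramLo_mem_core _) hsc hs.1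
  · rw [← hzl.2]; exact hm.monotoneOn hsc (P.paramLo_mem_core _) hs.2

/-- On the upper zone `[zU, s₀']`: the parameter is in the open upper core with `1/16 ≤ αHi ≤ 11/32`.
[folklore] -/
theorem zoneHi_facts {s : ℝ} (hs : s ∈ Icc P.zU P.sHi) :
    s ∈ Ioo (b.tcHi - b.epsHi / 8) (b.tcHi + b.epsHi / 8) ∧ b.alphaHi κ s ∈ Icc (1 / 16 : ℝ) (11 / 32) := by
  have hκ := P.HU.cone.spike.κ_pos
  have hzm := P.zone_marks; have hsh := P.sHi_spec; have hzu := P.paramHi_spec el32_mem07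
  have hso : s ∈ Ioo (b.tcHi - b.epsHi / 8) (b.tcHi + b.epsHi / 8) :=
    ⟨lt_of_lt_of_le hzm.2.2.2.1 hs.1, by linarith [hs.2, hsh.2.2, b.epsHi_bounds.1]⟩
  have hsc := Ioo_subset_Icc_self hso
  have hm := b.strictAntiOn_alphaHi (κ := κ) hκ
  refine ⟨hso, ?_, ?_⟩
  · rw [← hsh.1]; exact hm.antitoneOn hsc (P.paramHi_mem_core _) hs.2
  · rw [← hzu.2]; exact hm.antitoneOn (P.paramHi_mem_core _) hsc hs.1

/-- On the middle zone `[eL, eU]`: `αLo, αHi ≥ 3/10`, and the parameter lies in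
`[paramLo (1/4), paramHi (1/4)]`. [folklore] -/
theorem zoneMid_facts {s : ℝ} (hs : s ∈ Icc P.eL P.eU) :
    3 / 10 ≤ b.alphaLo κ s ∧ 3 / 10 ≤ b.alphaHi κ s ∧ s ∈ Ioo (P.paramLo quarter_mem07) (P.paramHi quarter_mem07) := by
  have hκ := P.HU.cone.spike.κ_pos
  have heL := P.paramLo_spec three10_mem07; have heU := P.paramHi_spec three10_mem07
  have hq := P.paramLo_spec quarter_mem07; have hq' := P.paramHi_spec quarter_mem07
  have hb1 : b.tcLo ≤ P.eL := heL.1.1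
  have hb2 : P.eU ≤ b.tcHi := heU.1.2
  have hm := b.strictMonoOn_alphaLo (κ := κ) hκ; have hm' := b.strictAntiOn_alphaHi (κ := κ) hκ
  refine ⟨?_, ?_, ?_, ?_⟩
  · by_cases hc : s ≤ b.tcLo + b.epsLo / 8
    · have hsc : s ∈ Icc (b.tcLo - b.epsLo / 8) (b.tcLo + b.epsLo / 8) := ⟨by linarith [hs.1, b.epsLo_bounds.1], hc⟩
      have : b.alphaLo κ P.eL ≤ b.alphaLo κ s := hm.monotoneOn (P.paramLo_mem_core _) hsc hs.1
      rw [show b.alphaLo κ P.eL = 3 / 10 from heL.2] at this; exact this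
    · push Not at hc
      by_contra hlt; push Not at hlt
      have := P.mem_coreLo_of_alphaLo_lt (s := s) (by linarith [hs.1]) (by linarith)
      linarith [this.2]
  · by_cases hc : b.tcHi - b.epsHi / 8 ≤ s
    · have hsc : s ∈ Icc (b.tcHi - b.epsHi / 8) (b.tcHi + b.epsHi / 8) := ⟨hc, by linarith [hs.2, b.epsHi_bounds.1]⟩
      have : b.alphaHi κ P.eU ≤ b.alphaHi κ s := hm'.antitoneOn hsc (P.paramHi_mem_core _) hs.2
      rw [show b.alphaHi κ P.eU = 3 / 10 from heU.2] at this; exact this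
    · push Not at hc
      by_contra hlt; push Not at hlt
      have := P.mem_coreHi_of_alphaHi_lt (s := s) (by linarith [hs.2]) (by linarith)
      linarith [this.1]
  · have : P.paramLo quarter_mem07 < P.eL := by
      rw [eL, ← P.alphaLo_lt_iff three10_mem07 (P.paramLo_mem_core quarter_mem07), hq.2]; norm_num
    linarith [hs.1]
  · have : P.eU < P.paramHi quarter_mem07 := by
      rw [eU, ← P.alphaHi_lt_iff three10_mem07 (P.paramHi_mem_core quarter_mem07), hq'.2]; norm_num
    linarith [hs.2]

/-! ### The level as an affine function -/

omit P in
/-- The level functional is `C^∞`. [folklore] -/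
theorem contDiff_lev : ContDiff ℝ ∞ lev := by
  have e : lev = fun Y : 𝔼 3 ↦ (1 + epsP) / 2 * Y 1 - 2 / 3 * (1 - epsP) * (Y 0 - 1) := funext lev_eq
  rw [e]
  exact (contDiff_const.mul (contDiff_euclidean.1 contDiff_id 1)).sub
    (contDiff_const.mul ((contDiff_euclidean.1 contDiff_id 0).sub contDiff_const))

omit P in
/-- **The linear part of the level.** [folklore] -/
def levL : 𝔼 3 →L[ℝ] ℝ :=
  ((1 + epsP) / 2) • (EuclideanSpace.proj (1 : Fin 3) : 𝔼 3 →L[ℝ] ℝ) - (2 / 3 * (1 - epsP)) • (EuclideanSpace.proj (0 : Fin 3) : 𝔼 3 →L[ℝ] ℝ)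

omit P in
/-- Formula for the linear part. [folklore] -/
theorem levL_apply (Y : 𝔼 3) : levL Y = (1 + epsP) / 2 * Y 1 - 2 / 3 * (1 - epsP) * Y 0 := rfl

omit P in
/-- The level is its linear part plus a constant. [folklore] -/
theorem lev_eq_levL (Y : 𝔼 3) : lev Y = levL Y + 2 / 3 * (1 - epsP) := by rw [lev_eq, levL_apply]; ring

omit P in
/-- The linear part is bounded by `2`. [folklore] -/
theorem abs_levL_le (v : 𝔼 3) : |levL v| ≤ 2 * ‖v‖ := by
  have h := abs_lev_sub_le v 0
  rw [lev_eq_levL, lev_eq_levL, map_zero, sub_zero] at h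
  simpa using h

omit P in
/-- Chain rule for the level. [folklore] -/
theorem hasDerivAt_lev_comp {f : ℝ → 𝔼 3} {f' : 𝔼 3} {x : ℝ} (hf : HasDerivAt f f' x) :
    HasDerivAt (fun x ↦ lev (f x)) (levL f') x := by
  have e : (fun x ↦ lev (f x)) = fun x ↦ levL (f x) + 2 / 3 * (1 - epsP) := funext fun x ↦ lev_eq_levL _
  rw [e]; exact (levL.hasFDerivAt.comp_hasDerivAt x hf).add_const _

omit P in
/-- The derivative of the target. [folklore] -/
def tgtD (m : ℝ) : 𝔼 2 := pt2 (deriv (fun m ↦ tgt m 0) m) (deriv (fun m ↦ tgt m 1) m)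

omit P in
/-- The target has derivative `tgtD`. [folklore] -/
theorem hasDerivAt_tgt' (m : ℝ) : HasDerivAt tgt (tgtD m) m := hasDerivAt_tgt m

omit P in
/-- `‖tgtD m‖ ≤ tgtLip`. [folklore] -/
theorem norm_tgtD_le (m : ℝ) : ‖tgtD m‖ ≤ tgtLip := by
  refine (BandData.norm_pt2_le _ _).trans ?_
  have h0 := abs_deriv_tgt_zero_le m; have h1 := abs_deriv_tgt_one_le m
  have hε := epsP_pos; have hC := smoothTransitionDerivBound_pos
  unfold tgtLip
  have e1 : 24 * smoothTransitionDerivBound / epsP + 8 * smoothTransitionDerivBound / epsP ≤ 40 * smoothTransitionDerivBound / epsP := by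
    rw [← add_div, div_le_div_iff_of_pos_right hε]; nlinarith
  have e2 : 1 / epsP + 1 / epsP = 2 / epsP := by ring
  linarith

omit P in
/-- **The level sees the lifted target derivative with unit speed**: `levL (lift (tgtD m) 0) = 1`.
[folklore] -/
theorem levL_lift_tgtD (m : ℝ) : levL (lift (tgtD m) 0) = 1 := by
  have h0 : HasDerivAt (fun m ↦ tgt m 0) (deriv (fun m ↦ tgt m 0) m) m :=
    (((contDiff_euclidean.1 contDiff_tgt 0).differentiable (by simp)) m).hasDerivAt
  have h1 : HasDerivAt (fun m ↦ tgt m 1) (deriv (fun m ↦ tgt m 1) m) m :=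
    (((contDiff_euclidean.1 contDiff_tgt 1).differentiable (by simp)) m).hasDerivAt
  have hF : HasDerivAt (fun m ↦ (1 + epsP) / 2 * tgt m 1 - 2 / 3 * (1 - epsP) * (tgt m 0 - 1))
      ((1 + epsP) / 2 * deriv (fun m ↦ tgt m 1) m - 2 / 3 * (1 - epsP) * deriv (fun m ↦ tgt m 0) m) m := by
    have := (h1.const_mul ((1 + epsP) / 2)).sub ((h0.sub_const 1).const_mul (2 / 3 * (1 - epsP)))
    exact this
  have e1 : (fun m ↦ (1 + epsP) / 2 * tgt m 1 - 2 / 3 * (1 - epsP) * (tgt m 0 - 1)) = id := by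
    funext m; have := lev_lift_tgt m 0; rw [lev_eq] at this; simpa using this
  have hid : HasDerivAt (fun m ↦ (1 + epsP) / 2 * tgt m 1 - 2 / 3 * (1 - epsP) * (tgt m 0 - 1)) 1 m := by
    rw [e1]; exact hasDerivAt_id m
  have := hF.unique hid
  rw [levL_apply, tgtD]; simpa using this

omit P in
/-- `|gLoT| ≤ 1` on `[0, 3/8]`. [folklore] -/
theorem abs_gLoT_le {α : ℝ} (hα : α ∈ Icc (0 : ℝ) (3 / 8)) : |gLoT α| ≤ 1 := by
  have hw := wCut_mem α
  rw [gLoT, abs_le]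
  by_cases h : α ≤ 1 / 4 + 1 / 48
  · rw [wCut_of_le h]; norm_num
  · push Not at h
    constructor <;> nlinarith [hw.1, hw.2, hα.2]

omit P in
/-- `|gHiT| ≤ 1` on `[0, 3/8]`. [folklore] -/
theorem abs_gHiT_le {α : ℝ} (hα : α ∈ Icc (0 : ℝ) (3 / 8)) : |gHiT α| ≤ 1 := by
  have h := abs_gLoT_le hα
  have e : gHiT α = -gLoT α := by simp [gHiT, gLoT]; ring
  rw [e, abs_neg]; exact h

/-- The level of the track is `C^∞` on the region. [folklore] -/
theorem contDiffAt_mu {s : ℝ} (hs : s ∈ Icc (P.paramLo zero_mem07) (P.paramHi zero_mem07)) : ContDiffAt ℝ ∞ P.mu s :=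
  contDiff_lev.contDiffAt.comp s (P.contDiffAt_trk hs)

/-! ### Derivatives on the three zones -/

section Zones

variable {ε₁ r₁ : ℝ} (hf₁ : b.IsFlat hcross ε₁ r₁) (hε₁ : ε₁ ≤ epsU) (hr₁ : 4 * κ < r₁)
include hf₁ hε₁ hr₁

/-- **Middle zone: the level of the family increases.** For `u ∈ [0, 1]` and `s ∈ [eL, eU]` the
function `s ↦ lev (mix u s)` has a positive derivative. [folklore] -/
theorem hasDerivAt_lev_mix_zoneMid {u : ℝ} (hu : u ∈ Icc (0 : ℝ) 1) {s : ℝ} (hs : s ∈ Icc P.eL P.eU) :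
    ∃ D, HasDerivAt (fun s ↦ lev (P.mix u s)) D s ∧ 0 < D := by
  have hκ := P.HU.cone.spike.κ_pos
  obtain ⟨hαL, hαH, hsq⟩ := P.zoneMid_facts hs
  have hq := P.paramLo_spec quarter_mem07; have hq' := P.paramHi_spec quarter_mem07
  have h0 := P.paramLo_spec zero_mem07; have h0' := P.paramHi_spec zero_mem07
  have hle : P.paramLo zero_mem07 ≤ P.paramLo quarter_mem07 := by
    rw [← P.alphaLo_le_iff quarter_mem07 (P.paramLo_mem_core zero_mem07), h0.2]; norm_num
  have hle' : P.paramHi quarter_mem07 ≤ P.paramHi zero_mem07 := by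
    rw [← P.alphaHi_le_iff quarter_mem07 (P.paramHi_mem_core zero_mem07), h0'.2]; norm_num
  have hs0 : s ∈ Icc (P.paramLo zero_mem07) (P.paramHi zero_mem07) := ⟨hle.trans hsq.1.le, hsq.2.le.trans hle'⟩
  -- the level of the track
  have hμ : HasDerivAt P.mu (deriv P.mu s) s := ((P.contDiffAt_mu hs0).differentiableAt (by simp)).hasDerivAt
  have hμpos : 0 < deriv P.mu s := P.deriv_mu_pos hsq
  -- near `s` the target is `tgt ∘ mu`
  have hc := (b.contDiff_alphaLo κ).continuous; have hc' := (b.contDiff_alphaHi κ).continuous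
  have hev : P.hh =ᶠ[𝓝 s] fun s ↦ tgt (P.mu s) := by
    have h1 : ∀ᶠ s' in 𝓝 s, 1 / 4 + 1 / 24 < b.alphaLo κ s' := hc.continuousAt.eventually (Ioi_mem_nhds (by linarith))
    have h2 : ∀ᶠ s' in 𝓝 s, 1 / 4 + 1 / 24 < b.alphaHi κ s' := hc'.continuousAt.eventually (Ioi_mem_nhds (by linarith))
    filter_upwards [h1, h2] with s' h1 h2 using P.hh_of_ge h1.le h2.le
  -- the derivative of `Npl ∘ tgt ∘ mu`
  set m := P.mu s with hm
  have hmm : m ∈ Icc (-epsP) 1 := P.mu_mem ⟨hsq.1.le, hsq.2.le⟩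
  have htq : ‖κ • tgt m‖ < r₁ := by
    obtain ⟨ht0, ht1⟩ := tgt_mem hmm
    have e : tgt m = pt2 (tgt m 0) (tgt m 1) := by ext i; fin_cases i <;> rfl
    have hn : ‖tgt m‖ ≤ 9 / 4 := by
      rw [e]; refine (BandData.norm_pt2_le _ _).trans ?_
      rw [abs_of_nonneg (by linarith [ht0.1])]; have := abs_le.2 ⟨ht1.1, ht1.2⟩; linarith [ht0.2]
    rw [norm_smul, Real.norm_eq_abs, abs_of_pos hκ]; nlinarith
  obtain ⟨hN, hNb⟩ := P.hasFDerivAt_Npl hf₁ htq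
  have hTM : HasDerivAt (fun s ↦ tgt (P.mu s)) (deriv P.mu s • tgtD m) s := by
    have := (hasDerivAt_tgt' m).scomp s hμ; exact this
  have hNTM : HasDerivAt (P.Npl ∘ fun s ↦ tgt (P.mu s)) _ s := hN.comp_hasDerivAt s hTM
  have hF := hasDerivAt_lev_comp hNTM
  set L := (((b.frame hcross).symm : (𝔼 3) ≃L[ℝ] 𝔼 3) : (𝔼 3) →L[ℝ] 𝔼 3).comp (fderiv ℝ b.Fband (κ • tgt m)) with hL
  -- value of this derivative: `mu' levL (L (tgtD m))` with `|levL (L (tgtD m)) - 1| ≤ 2 ε₁ tgtLip`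
  have hval : levL (L (deriv P.mu s • tgtD m)) = deriv P.mu s * levL (L (tgtD m)) := by
    rw [map_smul, map_smul, smul_eq_mul]
  have herr : |levL (L (tgtD m)) - 1| ≤ 2 * (ε₁ * tgtLip) := by
    rw [← levL_lift_tgtD m, ← map_sub]
    refine (abs_levL_le _).trans ?_
    have := hNb (tgtD m)
    change ‖L (tgtD m) - lift (tgtD m) 0‖ ≤ ε₁ * ‖tgtD m‖ at this
    have hT := norm_tgtD_le m
    have hε0 := hf₁.eps_nonneg
    nlinarith
  have hsmall := (epsU_small hε₁).1
  have hB := bumpBound_spec.1; have hC := smoothTransitionDerivBound_pos; have hTL := tgtLip_pos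
  have hεT : ε₁ * tgtLip ≤ 1 / 64 := by nlinarith [hf₁.eps_nonneg]
  -- the level of the track part
  have hG : HasDerivAt (fun s ↦ lev (P.trk s)) (deriv P.mu s) s := hμ
  -- assemble
  have hmixev : (fun s ↦ lev (P.mix u s)) =ᶠ[𝓝 s] fun x ↦ (1 - u) * lev (P.trk x) + u * lev ((P.Npl ∘ fun s ↦ tgt (P.mu s)) x) := by
    filter_upwards [hev] with s' hs'
    rw [mix, lev_lineMap, hs', Function.comp_apply]
  have hsum : HasDerivAt (fun x ↦ (1 - u) * lev (P.trk x) + u * lev ((P.Npl ∘ fun s ↦ tgt (P.mu s)) x))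
      ((1 - u) * deriv P.mu s + u * levL (L (deriv P.mu s • tgtD m))) s := (hG.const_mul (1 - u)).add (hF.const_mul u)
  refine ⟨(1 - u) * deriv P.mu s + u * levL (L (deriv P.mu s • tgtD m)), hsum.congr_of_eventuallyEq hmixev, ?_⟩
  rw [hval]
  have hab := abs_le.1 herr
  have h1 : 1 / 2 ≤ levL (L (tgtD m)) := by linarith [hab.1]
  have : 0 < (1 - u) + u * levL (L (tgtD m)) := by nlinarith [hu.1, hu.2]
  nlinarith [hu.1, hu.2]

/-- **Lower zone: the first coordinate of the family increases.** [folklore] -/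
theorem hasDerivAt_mix_zero_zoneLo {u : ℝ} (hu : u ∈ Icc (0 : ℝ) 1) {s : ℝ} (hs : s ∈ Icc P.sLo P.zL) :
    ∃ D, HasDerivAt (fun s ↦ P.mix u s 0) D s ∧ 0 < D := by
  have hκ := P.HU.cone.spike.κ_pos
  obtain ⟨hso, hα⟩ := P.zoneLo_facts hs
  have hsc := Ioo_subset_Icc_self hso
  set α := b.alphaLo κ s with hαdef
  have hαabs : |α| ≤ 11 / 32 := by rw [abs_le]; constructor <;> linarith [hα.1, hα.2]
  have hq1 : κ * (|α| + 1) < r₁ := by nlinarith [abs_nonneg α]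
  have hqr : κ * (|α| + 1) < r := P.scale_lt_of_abs_le (by linarith [P.HU.cone.spike.seven_le])
  -- derivative of `αLo`
  have hA : HasDerivAt (b.alphaLo κ) (deriv b.chiLo s / κ) s := b.hasDerivAt_alphaLo κ s
  have hApos : 0 < deriv b.chiLo s / κ := div_pos (b.deriv_chiLo_pos hsc) hκ
  -- the track part: `g ∘ αLo` with `g a = blowUp (pieceLo 1 a) 0`
  obtain ⟨g', hg, hgb⟩ := b.hasDerivAt_blowUp_pieceLo_zero hf₁ hκ (u := 1) ⟨zero_le_one, le_rfl⟩ b.depthSign hq1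
  have hc := (b.contDiff_alphaLo κ).continuous
  have hevT : (fun s ↦ P.trk s 0) =ᶠ[𝓝 s] fun s ↦ b.blowUp hcross κ (b.pieceLo hcross κ b.depthSign 1 (b.alphaLo κ s)) 0 := by
    have h1 : ∀ᶠ s' in 𝓝 s, s' ∈ Ioo (b.tcLo - b.epsLo / 8) (b.tcLo + b.epsLo / 8) := isOpen_Ioo.mem_nhds hso
    have h2 : ∀ᶠ s' in 𝓝 s, b.alphaLo κ s' < 3 / 8 := hc.continuousAt.eventually (Iio_mem_nhds (by linarith [hα.2]))
    have h3 : ∀ᶠ s' in 𝓝 s, -7 < b.alphaLo κ s' := hc.continuousAt.eventually (Ioi_mem_nhds (by linarith [hα.1]))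
    filter_upwards [h1, h2, h3] with s' h1 h2 h3
    rw [P.trk_zoneLo (Ioo_subset_Icc_self h1) h2 (P.scale_lt_of_abs_le (by rw [abs_le]; constructor <;> linarith [P.HU.cone.spike.seven_le]))]
  have hT : HasDerivAt (fun s ↦ P.trk s 0) (g' * (deriv b.chiLo s / κ)) s := by
    have := hg.comp s hA
    exact this.congr_of_eventuallyEq (hevT.trans (Filter.Eventually.of_forall fun x ↦ rfl))
  -- the band part: `Npl ∘ Q ∘ αLo` with `Q a = (a, gLoT a)`
  obtain ⟨hG, hGb⟩ := hasDerivAt_gLoT α ⟨by linarith [hα.1], by linarith [hα.2]⟩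
  have hQ : HasDerivAt (fun a ↦ (pt2 a (gLoT a) : 𝔼 2)) (pt2 1 (deriv gLoT α)) α := hasDerivAt_pt2 (hasDerivAt_id α) hG
  have hQn : ‖κ • (pt2 α (gLoT α) : 𝔼 2)‖ < r₁ := by
    have hy : |gLoT α| ≤ 1 := abs_gLoT_le ⟨by linarith [hα.1], by linarith [hα.2]⟩
    have : ‖(pt2 α (gLoT α) : 𝔼 2)‖ ≤ 2 := (BandData.norm_pt2_le _ _).trans (by linarith)
    rw [norm_smul, Real.norm_eq_abs, abs_of_pos hκ]; nlinarith
  obtain ⟨hN, hNb⟩ := P.hasFDerivAt_Npl hf₁ hQn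
  set L := (((b.frame hcross).symm : (𝔼 3) ≃L[ℝ] 𝔼 3) : (𝔼 3) →L[ℝ] 𝔼 3).comp (fderiv ℝ b.Fband (κ • (pt2 α (gLoT α) : 𝔼 2))) with hL
  have hevN : (fun s ↦ P.Npl (P.hh s) 0) =ᶠ[𝓝 s] fun s ↦ P.Npl (pt2 (b.alphaLo κ s) (gLoT (b.alphaLo κ s))) 0 := by
    have h1 : ∀ᶠ s' in 𝓝 s, s' ∈ Ioo (b.tcLo - b.epsLo / 8) (b.tcLo + b.epsLo / 8) := isOpen_Ioo.mem_nhds hso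
    have h2 : ∀ᶠ s' in 𝓝 s, b.alphaLo κ s' < 3 / 8 := hc.continuousAt.eventually (Iio_mem_nhds (by linarith [hα.2]))
    filter_upwards [h1, h2] with s' h1 h2
    rw [P.hh_zoneLo (Ioo_subset_Icc_self h1) h2.le]
  have hQA : HasDerivAt ((fun a ↦ (pt2 a (gLoT a) : 𝔼 2)) ∘ b.alphaLo κ) ((deriv b.chiLo s / κ) • pt2 1 (deriv gLoT α)) s :=
    hQ.scomp s hA
  have hNQ : HasDerivAt (P.Npl ∘ ((fun a ↦ (pt2 a (gLoT a) : 𝔼 2)) ∘ b.alphaLo κ)) (L ((deriv b.chiLo s / κ) • pt2 1 (deriv gLoT α))) s :=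
    hN.comp_hasDerivAt s hQA
  have hevN' : (fun s ↦ P.Npl (P.hh s) 0) =ᶠ[𝓝 s] fun x ↦ (EuclideanSpace.proj (0 : Fin 3) : 𝔼 3 →L[ℝ] ℝ) ((P.Npl ∘ ((fun a ↦ (pt2 a (gLoT a) : 𝔼 2)) ∘ b.alphaLo κ)) x) :=
    hevN.trans (Filter.Eventually.of_forall fun x ↦ rfl)
  have hNQ0 : HasDerivAt (fun s ↦ P.Npl (P.hh s) 0) ((L ((deriv b.chiLo s / κ) • pt2 1 (deriv gLoT α))) 0) s :=
    (((EuclideanSpace.proj (0 : Fin 3) : 𝔼 3 →L[ℝ] ℝ).hasFDerivAt).comp_hasDerivAt s hNQ).congr_of_eventuallyEq hevN'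
  -- value of the band part derivative: `α' (1 + e)` with `|e| ≤ ε₁ (1 + |G'|)`
  have hval : (L ((deriv b.chiLo s / κ) • pt2 1 (deriv gLoT α))) 0 =
      (deriv b.chiLo s / κ) * (1 + (L (pt2 1 (deriv gLoT α)) - lift (pt2 1 (deriv gLoT α)) 0) 0) := by
    rw [map_smul, PiLp.smul_apply, smul_eq_mul, PiLp.sub_apply, lift_apply_zero, pt2_apply_zero]; ring
  have herr : |(L (pt2 1 (deriv gLoT α)) - lift (pt2 1 (deriv gLoT α)) 0) 0| ≤ ε₁ * (7 / 3 + 16 * smoothTransitionDerivBound) := by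
    refine (BandFoliation.abs_apply_le_norm _ 0).trans ((hNb _).trans ?_)
    have : ‖(pt2 1 (deriv gLoT α) : 𝔼 2)‖ ≤ 7 / 3 + 16 * smoothTransitionDerivBound :=
      (BandData.norm_pt2_le _ _).trans (by rw [abs_one]; linarith)
    exact mul_le_mul_of_nonneg_left this hf₁.eps_nonneg
  have hsmall := (epsU_small hε₁).1
  have h256 := (epsU_small hε₁).2
  have hB := bumpBound_spec.1; have hC := smoothTransitionDerivBound_pos; have hTL := tgtLip_pos
  have hε0 := hf₁.eps_nonneg
  have hεB : ε₁ * bumpBound ≤ 1 / 64 := by nlinarith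
  have hεC : ε₁ * smoothTransitionDerivBound ≤ 1 / 512 := by nlinarith
  -- assemble
  refine ⟨(1 - u) * (g' * (deriv b.chiLo s / κ)) + u * ((L ((deriv b.chiLo s / κ) • pt2 1 (deriv gLoT α))) 0), ?_, ?_⟩
  · have e : (fun s ↦ P.mix u s 0) = fun s ↦ (1 - u) * P.trk s 0 + u * P.Npl (P.hh s) 0 := by
      funext s'; simp [mix]
    rw [e]; exact (hT.const_mul _).add (hNQ0.const_mul _)
  · rw [hval]
    have hab := abs_le.1 herr
    have hg1 : 1 / 2 ≤ g' := by
      refine le_trans ?_ hgb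
      have : bumpBound * ε₁ * (|α| + 1) ≤ 1 / 64 * 2 := by nlinarith [abs_nonneg α]
      linarith
    have he1 : 1 / 2 ≤ 1 + (L (pt2 1 (deriv gLoT α)) - lift (pt2 1 (deriv gLoT α)) 0) 0 := by nlinarith [hab.1]
    have : 0 < (1 - u) * g' + u * (1 + (L (pt2 1 (deriv gLoT α)) - lift (pt2 1 (deriv gLoT α)) 0) 0) := by
      nlinarith [hu.1, hu.2]
    have e : (1 - u) * (g' * (deriv b.chiLo s / κ)) + u * ((deriv b.chiLo s / κ) * (1 + (L (pt2 1 (deriv gLoT α)) - lift (pt2 1 (deriv gLoT α)) 0) 0)) =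
        (deriv b.chiLo s / κ) * ((1 - u) * g' + u * (1 + (L (pt2 1 (deriv gLoT α)) - lift (pt2 1 (deriv gLoT α)) 0) 0)) := by ring
    rw [e]; exact mul_pos hApos this

/-- **Upper zone: the first coordinate of the family decreases.** [folklore] -/
theorem hasDerivAt_mix_zero_zoneHi {u : ℝ} (hu : u ∈ Icc (0 : ℝ) 1) {s : ℝ} (hs : s ∈ Icc P.zU P.sHi) :
    ∃ D, HasDerivAt (fun s ↦ P.mix u s 0) D s ∧ D < 0 := by
  have hκ := P.HU.cone.spike.κ_pos
  obtain ⟨hso, hα⟩ := P.zoneHi_facts hs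
  have hsc := Ioo_subset_Icc_self hso
  set α := b.alphaHi κ s with hαdef
  have hαabs : |α| ≤ 11 / 32 := by rw [abs_le]; constructor <;> linarith [hα.1, hα.2]
  have hq1 : κ * (|α| + 1) < r₁ := by nlinarith [abs_nonneg α]
  have hA : HasDerivAt (b.alphaHi κ) (deriv b.chiHi s / κ) s := b.hasDerivAt_alphaHi κ s
  have hAneg : deriv b.chiHi s / κ < 0 := div_neg_of_neg_of_pos (b.deriv_chiHi_neg hsc) hκ
  obtain ⟨g', hg, hgb⟩ := b.hasDerivAt_blowUp_pieceHi_zero hf₁ hκ (u := 1) ⟨zero_le_one, le_rfl⟩ b.depthSign hq1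
  have hc := (b.contDiff_alphaHi κ).continuous
  have hevT : (fun s ↦ P.trk s 0) =ᶠ[𝓝 s] fun s ↦ b.blowUp hcross κ (b.pieceHi hcross κ b.depthSign 1 (b.alphaHi κ s)) 0 := by
    have h1 : ∀ᶠ s' in 𝓝 s, s' ∈ Ioo (b.tcHi - b.epsHi / 8) (b.tcHi + b.epsHi / 8) := isOpen_Ioo.mem_nhds hso
    have h2 : ∀ᶠ s' in 𝓝 s, b.alphaHi κ s' < 3 / 8 := hc.continuousAt.eventually (Iio_mem_nhds (by linarith [hα.2]))
    have h3 : ∀ᶠ s' in 𝓝 s, -7 < b.alphaHi κ s' := hc.continuousAt.eventually (Ioi_mem_nhds (by linarith [hα.1]))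
    filter_upwards [h1, h2, h3] with s' h1 h2 h3
    rw [P.trk_zoneHi (Ioo_subset_Icc_self h1) h2 (P.scale_lt_of_abs_le (by rw [abs_le]; constructor <;> linarith [P.HU.cone.spike.seven_le]))]
  have hT : HasDerivAt (fun s ↦ P.trk s 0) (g' * (deriv b.chiHi s / κ)) s :=
    (hg.comp s hA).congr_of_eventuallyEq (hevT.trans (Filter.Eventually.of_forall fun x ↦ rfl))
  obtain ⟨hG, hGb⟩ := hasDerivAt_gHiT α ⟨by linarith [hα.1], by linarith [hα.2]⟩
  have hQ : HasDerivAt (fun a ↦ (pt2 a (gHiT a) : 𝔼 2)) (pt2 1 (deriv gHiT α)) α := hasDerivAt_pt2 (hasDerivAt_id α) hG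
  have hQn : ‖κ • (pt2 α (gHiT α) : 𝔼 2)‖ < r₁ := by
    have hy : |gHiT α| ≤ 1 := abs_gHiT_le ⟨by linarith [hα.1], by linarith [hα.2]⟩
    have : ‖(pt2 α (gHiT α) : 𝔼 2)‖ ≤ 2 := (BandData.norm_pt2_le _ _).trans (by linarith)
    rw [norm_smul, Real.norm_eq_abs, abs_of_pos hκ]; nlinarith
  obtain ⟨hN, hNb⟩ := P.hasFDerivAt_Npl hf₁ hQn
  set L := (((b.frame hcross).symm : (𝔼 3) ≃L[ℝ] 𝔼 3) : (𝔼 3) →L[ℝ] 𝔼 3).comp (fderiv ℝ b.Fband (κ • (pt2 α (gHiT α) : 𝔼 2))) with hL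
  have hevN : (fun s ↦ P.Npl (P.hh s) 0) =ᶠ[𝓝 s] fun s ↦ P.Npl (pt2 (b.alphaHi κ s) (gHiT (b.alphaHi κ s))) 0 := by
    have h1 : ∀ᶠ s' in 𝓝 s, s' ∈ Ioo (b.tcHi - b.epsHi / 8) (b.tcHi + b.epsHi / 8) := isOpen_Ioo.mem_nhds hso
    have h2 : ∀ᶠ s' in 𝓝 s, b.alphaHi κ s' < 3 / 8 := hc.continuousAt.eventually (Iio_mem_nhds (by linarith [hα.2]))
    filter_upwards [h1, h2] with s' h1 h2
    rw [P.hh_zoneHi (Ioo_subset_Icc_self h1) h2.le]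
  have hQA : HasDerivAt ((fun a ↦ (pt2 a (gHiT a) : 𝔼 2)) ∘ b.alphaHi κ) ((deriv b.chiHi s / κ) • pt2 1 (deriv gHiT α)) s :=
    hQ.scomp s hA
  have hNQ : HasDerivAt (P.Npl ∘ ((fun a ↦ (pt2 a (gHiT a) : 𝔼 2)) ∘ b.alphaHi κ)) (L ((deriv b.chiHi s / κ) • pt2 1 (deriv gHiT α))) s :=
    hN.comp_hasDerivAt s hQA
  have hevN' : (fun s ↦ P.Npl (P.hh s) 0) =ᶠ[𝓝 s] fun x ↦ (EuclideanSpace.proj (0 : Fin 3) : 𝔼 3 →L[ℝ] ℝ) ((P.Npl ∘ ((fun a ↦ (pt2 a (gHiT a) : 𝔼 2)) ∘ b.alphaHi κ)) x) :=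
    hevN.trans (Filter.Eventually.of_forall fun x ↦ rfl)
  have hNQ0 : HasDerivAt (fun s ↦ P.Npl (P.hh s) 0) ((L ((deriv b.chiHi s / κ) • pt2 1 (deriv gHiT α))) 0) s :=
    (((EuclideanSpace.proj (0 : Fin 3) : 𝔼 3 →L[ℝ] ℝ).hasFDerivAt).comp_hasDerivAt s hNQ).congr_of_eventuallyEq hevN'
  have hval : (L ((deriv b.chiHi s / κ) • pt2 1 (deriv gHiT α))) 0 =
      (deriv b.chiHi s / κ) * (1 + (L (pt2 1 (deriv gHiT α)) - lift (pt2 1 (deriv gHiT α)) 0) 0) := by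
    rw [map_smul, PiLp.smul_apply, smul_eq_mul, PiLp.sub_apply, lift_apply_zero, pt2_apply_zero]; ring
  have herr : |(L (pt2 1 (deriv gHiT α)) - lift (pt2 1 (deriv gHiT α)) 0) 0| ≤ ε₁ * (7 / 3 + 16 * smoothTransitionDerivBound) := by
    refine (BandFoliation.abs_apply_le_norm _ 0).trans ((hNb _).trans ?_)
    have : ‖(pt2 1 (deriv gHiT α) : 𝔼 2)‖ ≤ 7 / 3 + 16 * smoothTransitionDerivBound :=
      (BandData.norm_pt2_le _ _).trans (by rw [abs_one]; linarith)
    exact mul_le_mul_of_nonneg_left this hf₁.eps_nonneg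
  have hsmall := (epsU_small hε₁).1
  have h256 := (epsU_small hε₁).2
  have hB := bumpBound_spec.1; have hC := smoothTransitionDerivBound_pos; have hTL := tgtLip_pos
  have hε0 := hf₁.eps_nonneg
  have hεB : ε₁ * bumpBound ≤ 1 / 64 := by nlinarith
  have hεC : ε₁ * smoothTransitionDerivBound ≤ 1 / 512 := by nlinarith
  refine ⟨(1 - u) * (g' * (deriv b.chiHi s / κ)) + u * ((L ((deriv b.chiHi s / κ) • pt2 1 (deriv gHiT α))) 0), ?_, ?_⟩
  · have e : (fun s ↦ P.mix u s 0) = fun s ↦ (1 - u) * P.trk s 0 + u * P.Npl (P.hh s) 0 := by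
      funext s'; simp [mix]
    rw [e]; exact (hT.const_mul _).add (hNQ0.const_mul _)
  · rw [hval]
    have hab := abs_le.1 herr
    have hg1 : 1 / 2 ≤ g' := by
      refine le_trans ?_ hgb
      have : bumpBound * ε₁ * (|α| + 1) ≤ 1 / 64 * 2 := by nlinarith [abs_nonneg α]
      linarith
    have he1 : 1 / 2 ≤ 1 + (L (pt2 1 (deriv gHiT α)) - lift (pt2 1 (deriv gHiT α)) 0) 0 := by nlinarith [hab.1]
    have : 0 < (1 - u) * g' + u * (1 + (L (pt2 1 (deriv gHiT α)) - lift (pt2 1 (deriv gHiT α)) 0) 0) := by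
      nlinarith [hu.1, hu.2]
    have e : (1 - u) * (g' * (deriv b.chiHi s / κ)) + u * ((deriv b.chiHi s / κ) * (1 + (L (pt2 1 (deriv gHiT α)) - lift (pt2 1 (deriv gHiT α)) 0) 0)) =
        (deriv b.chiHi s / κ) * ((1 - u) * g' + u * (1 + (L (pt2 1 (deriv gHiT α)) - lift (pt2 1 (deriv gHiT α)) 0) 0)) := by ring
    rw [e]; exact mul_neg_of_neg_of_pos hAneg this

end Zones

/-! ### Consequences: monotone coordinates on the zones, non-vanishing speed -/

/-- `mix u` is differentiable on the region. [folklore] -/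
theorem hasDerivAt_mix (u : ℝ) {s : ℝ} (hs : s ∈ Icc (P.paramLo zero_mem07) (P.paramHi zero_mem07)) :
    HasDerivAt (P.mix u) (deriv (P.mix u) s) s := by
  have hd : DifferentiableAt ℝ (uncurry P.mix) (u, s) := (P.contDiffAt_mix hs).differentiableAt (by simp)
  have h2 : DifferentiableAt ℝ (fun s : ℝ ↦ (u, s)) s := (differentiableAt_const u).prodMk differentiableAt_id
  have : DifferentiableAt ℝ (P.mix u) s := by
    have := hd.comp s h2; exact this
  exact this.hasDerivAt

/-- `mix u` is continuous on the region. [folklore] -/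
theorem continuousOn_mix (u : ℝ) : ContinuousOn (P.mix u) (Icc (P.paramLo zero_mem07) (P.paramHi zero_mem07)) :=
  fun _ hs ↦ (P.hasDerivAt_mix u hs).continuousAt.continuousWithinAt

omit P in
/-- The windows are ordered. [folklore] -/
theorem window_order : b.tcLo + b.epsLo / 2 < b.tcHi - b.epsHi / 2 := by
  obtain ⟨-, h2, h3, -⟩ := b.neckSet_bounds
  have := b.marks_lt.2.2.2.1
  have := b.epsLo_bounds.1; have := b.epsHi_bounds.1
  linarith

/-- The lower zone lies in the region. [folklore] -/
theorem zoneLo_subset : Icc P.sLo P.zL ⊆ Icc (P.paramLo zero_mem07) (P.paramHi zero_mem07) := fun s hs ↦ by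
  have hzm := P.zone_marks; have hm := P.marks; have hco := b.coreLo_lt_coreHi
  exact ⟨hm.1.le.trans hs.1, by linarith [hs.2, hzm.2.2.1, hzm.2.2.2.1, hzm.2.2.2.2.1, hzm.2.2.2.2.2, hm.2.2]⟩

/-- The upper zone lies in the region. [folklore] -/
theorem zoneHi_subset : Icc P.zU P.sHi ⊆ Icc (P.paramLo zero_mem07) (P.paramHi zero_mem07) := fun s hs ↦ by
  have hzm := P.zone_marks; have hm := P.marks; have hco := b.coreLo_lt_coreHi
  exact ⟨by linarith [hs.1, hzm.1, hzm.2.1, hzm.2.2.1, hzm.2.2.2.1, hm.1], hs.2.trans hm.2.2.le⟩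

/-- The middle zone lies in the region. [folklore] -/
theorem zoneMid_subset : Icc P.eL P.eU ⊆ Icc (P.paramLo zero_mem07) (P.paramHi zero_mem07) := fun s hs ↦ by
  have hzm := P.zone_marks; have hm := P.marks
  exact ⟨by linarith [hs.1, hzm.1, hm.1], by linarith [hs.2, hzm.2.2.2.2.2, hm.2.2]⟩

section Zones2

variable {ε₁ r₁ : ℝ} (hf₁ : b.IsFlat hcross ε₁ r₁) (hε₁ : ε₁ ≤ epsU) (hr₁ : 4 * κ < r₁)
include hf₁ hε₁ hr₁

/-- **On the lower zone the first coordinate of the family is strictly increasing.** [folklore] -/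
theorem strictMonoOn_mix_zero_zoneLo {u : ℝ} (hu : u ∈ Icc (0 : ℝ) 1) :
    StrictMonoOn (fun s ↦ P.mix u s 0) (Icc P.sLo P.zL) := by
  have hsub := P.zoneLo_subset
  refine strictMonoOn_of_deriv_pos (convex_Icc _ _) (fun s hs ↦ ?_) (fun s hs ↦ ?_)
  · exact (((EuclideanSpace.proj (0 : Fin 3) : 𝔼 3 →L[ℝ] ℝ).continuous).continuousAt.comp
      (P.hasDerivAt_mix u (hsub hs)).continuousAt).continuousWithinAt
  · rw [interior_Icc] at hs
    obtain ⟨D, hD, hpos⟩ := P.hasDerivAt_mix_zero_zoneLo hf₁ hε₁ hr₁ hu (Ioo_subset_Icc_self hs)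
    rwa [hD.deriv]

/-- **On the upper zone the first coordinate of the family is strictly decreasing.** [folklore] -/
theorem strictAntiOn_mix_zero_zoneHi {u : ℝ} (hu : u ∈ Icc (0 : ℝ) 1) :
    StrictAntiOn (fun s ↦ P.mix u s 0) (Icc P.zU P.sHi) := by
  have hsub := P.zoneHi_subset
  refine strictAntiOn_of_deriv_neg (convex_Icc _ _) (fun s hs ↦ ?_) (fun s hs ↦ ?_)
  · exact (((EuclideanSpace.proj (0 : Fin 3) : 𝔼 3 →L[ℝ] ℝ).continuous).continuousAt.comp
      (P.hasDerivAt_mix u (hsub hs)).continuousAt).continuousWithinAt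
  · rw [interior_Icc] at hs
    obtain ⟨D, hD, hneg⟩ := P.hasDerivAt_mix_zero_zoneHi hf₁ hε₁ hr₁ hu (Ioo_subset_Icc_self hs)
    rwa [hD.deriv]

/-- **On the middle zone the level of the family is strictly increasing.** [folklore] -/
theorem strictMonoOn_lev_mix_zoneMid {u : ℝ} (hu : u ∈ Icc (0 : ℝ) 1) :
    StrictMonoOn (fun s ↦ lev (P.mix u s)) (Icc P.eL P.eU) := by
  have hsub := P.zoneMid_subset
  refine strictMonoOn_of_deriv_pos (convex_Icc _ _) (fun s hs ↦ ?_) (fun s hs ↦ ?_)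
  · exact (contDiff_lev.continuous.continuousAt.comp (P.hasDerivAt_mix u (hsub hs)).continuousAt).continuousWithinAt
  · rw [interior_Icc] at hs
    obtain ⟨D, hD, hpos⟩ := P.hasDerivAt_lev_mix_zoneMid hf₁ hε₁ hr₁ hu (Ioo_subset_Icc_self hs)
    rwa [hD.deriv]

/-- **The blow-up family has non-vanishing speed on the moving interval.** [folklore] -/
theorem deriv_mix_ne_zero {u : ℝ} (hu : u ∈ Icc (0 : ℝ) 1) {s : ℝ} (hs : s ∈ Icc P.sLo P.sHi) :
    deriv (P.mix u) s ≠ 0 := by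
  have hzm := P.zone_marks
  have hd := P.hasDerivAt_mix u (P.Icc_sLo_sHi_subset hs)
  intro h0
  by_cases h1 : s ≤ P.zL
  · obtain ⟨D, hD, hpos⟩ := P.hasDerivAt_mix_zero_zoneLo hf₁ hε₁ hr₁ hu ⟨hs.1, h1⟩
    have h' : HasDerivAt (fun s ↦ P.mix u s 0) ((deriv (P.mix u) s) 0) s :=
      ((EuclideanSpace.proj (0 : Fin 3) : 𝔼 3 →L[ℝ] ℝ).hasFDerivAt).comp_hasDerivAt s hd
    have := hD.unique h'
    rw [h0] at this; simp at this; linarith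
  by_cases h2 : P.zU ≤ s
  · obtain ⟨D, hD, hneg⟩ := P.hasDerivAt_mix_zero_zoneHi hf₁ hε₁ hr₁ hu ⟨h2, hs.2⟩
    have h' : HasDerivAt (fun s ↦ P.mix u s 0) ((deriv (P.mix u) s) 0) s :=
      ((EuclideanSpace.proj (0 : Fin 3) : 𝔼 3 →L[ℝ] ℝ).hasFDerivAt).comp_hasDerivAt s hd
    have := hD.unique h'
    rw [h0] at this; simp at this; linarith
  push Not at h1 h2
  obtain ⟨D, hD, hpos⟩ := P.hasDerivAt_lev_mix_zoneMid hf₁ hε₁ hr₁ hu ⟨by linarith [hzm.2.1], by linarith [hzm.2.2.2.2.1]⟩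
  have h' := hasDerivAt_lev_comp hd
  have := hD.unique h'
  rw [h0, map_zero] at this; linarith

/-- **The family has non-vanishing speed** on the moving interval, for `u ∈ [0, 1]`. [folklore] -/
theorem deriv_fam_ne_zero {u : ℝ} (hu : u ∈ Icc (0 : ℝ) 1) {s : ℝ} (hs : s ∈ Icc P.sLo P.sHi) :
    deriv (P.fam u) s ≠ 0 := by
  have hκ := P.HU.cone.spike.κ_pos
  have hm := P.marks
  have hc := (b.contDiff_alphaLo κ).continuous; have hc' := (b.contDiff_alphaHi κ).continuous
  have h16 := P.alphaLo_ge_of_mem hs; have h16' := P.alphaHi_ge_of_mem hs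
  -- near the ends the family is the host
  by_cases hA : b.alphaLo κ s < 1 / 8
  · have hev : P.fam u =ᶠ[𝓝 s] Knot.curve P.host := by
      have h1 : ∀ᶠ s' in 𝓝 s, b.alphaLo κ s' < 1 / 8 := hc.continuousAt.eventually (Iio_mem_nhds hA)
      have h2 : ∀ᶠ s' in 𝓝 s, 0 < b.alphaLo κ s' := hc.continuousAt.eventually (Ioi_mem_nhds (by linarith))
      filter_upwards [h1, h2] with s' h1 h2
      by_cases hs' : s' ∈ Icc P.sLo P.sHi
      · have hcore := P.mem_coreLo_of_alphaLo_lt (P.sLo_spec.2.1.trans hs'.1) (by linarith)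
        have hmix : P.mix u s' = P.trk s' := by
          rw [mix, P.Npl_hh_eq_trk_of_alphaLo_le hcore h2.le h1.le, ← add_smul]; simp
        rw [P.fam_of_mem hs', hmix, P.curve_host, P.coe_hostPt_eq (P.Icc_sLo_sHi_subset hs')]
      · exact P.fam_of_not_mem u (fun h ↦ hs' (Ioo_subset_Icc_self h))
    rw [hev.deriv_eq]; exact P.host.deriv_curve_ne_zero s
  by_cases hB : b.alphaHi κ s < 1 / 8
  · have hev : P.fam u =ᶠ[𝓝 s] Knot.curve P.host := by
      have h1 : ∀ᶠ s' in 𝓝 s, b.alphaHi κ s' < 1 / 8 := hc'.continuousAt.eventually (Iio_mem_nhds hB)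
      have h2 : ∀ᶠ s' in 𝓝 s, 0 < b.alphaHi κ s' := hc'.continuousAt.eventually (Ioi_mem_nhds (by linarith))
      filter_upwards [h1, h2] with s' h1 h2
      by_cases hs' : s' ∈ Icc P.sLo P.sHi
      · have hcore := P.mem_coreHi_of_alphaHi_lt (hs'.2.trans P.sHi_spec.2.2) (by linarith)
        have hmix : P.mix u s' = P.trk s' := by
          rw [mix, P.Npl_hh_eq_trk_of_alphaHi_le hcore h2.le h1.le, ← add_smul]; simp
        rw [P.fam_of_mem hs', hmix, P.curve_host, P.coe_hostPt_eq (P.Icc_sLo_sHi_subset hs')]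
      · exact P.fam_of_not_mem u (fun h ↦ hs' (Ioo_subset_Icc_self h))
    rw [hev.deriv_eq]; exact P.host.deriv_curve_ne_zero s
  push Not at hA hB
  -- otherwise `s` is an interior point of the moving interval and the family is `ψ⁻¹ ∘ blowDown ∘ mix u`
  have hlt1 : P.sLo < s := by
    rcases eq_or_lt_of_le hs.1 with h | h
    · exfalso; rw [← h, P.sLo_spec.1] at hA; norm_num at hA
    · exact h
  have hlt2 : s < P.sHi := by
    rcases eq_or_lt_of_le hs.2 with h | h
    · exfalso; rw [h, P.sHi_spec.1] at hB; norm_num at hB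
    · exact h
  have hev : P.fam u =ᶠ[𝓝 s] fun s ↦ ((psiN.symm (b.blowDown hcross κ (P.mix u s)) : 𝕊 3) : 𝔼 4) := by
    filter_upwards [Icc_mem_nhds hlt1 hlt2] with s' hs' using P.fam_of_mem hs'
  rw [hev.deriv_eq]
  have hd := P.hasDerivAt_mix u (P.Icc_sLo_sHi_subset hs)
  have hbd : HasDerivAt (fun s ↦ b.blowDown hcross κ (P.mix u s)) (κ • b.frame hcross (deriv (P.mix u) s)) s := by
    have := (((b.frame hcross : (𝔼 3) ≃L[ℝ] 𝔼 3) : (𝔼 3) →L[ℝ] 𝔼 3).hasFDerivAt.comp_hasDerivAt s hd).const_smul κ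
    exact (this.const_add b.pZero).congr_of_eventuallyEq (Filter.Eventually.of_forall fun x ↦ by simp [blowDown])
  refine deriv_coe_psiN_symm_comp_ne_zero hbd (smul_ne_zero hκ.ne' fun h0 ↦ ?_)
  exact P.deriv_mix_ne_zero hf₁ hε₁ hr₁ hu hs ((b.frame hcross).injective (h0.trans (map_zero _).symm))

end Zones2

/-! ### Coordinates of the track on the moving interval, regime by regime -/

omit P in
/-- Norm by coordinates in `ℝ³`. [folklore] -/
theorem norm_le_abs3 (Y : 𝔼 3) : ‖Y‖ ≤ |Y 0| + |Y 1| + |Y 2| := by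
  have e : Y = pt3 (Y 0) (Y 1) (Y 2) := by ext i; fin_cases i <;> rfl
  rw [e]; simpa using norm_pt3_le (Y 0) (Y 1) (Y 2)

/-- The lower ray scalar is at most `1 - (4/3)(αLo - 1/4)` (for `1/4 ≤ αLo ≤ 1`) and nonnegative. [folklore] -/
theorem psiLo_bounds {s : ℝ} (hα : b.alphaLo κ s ∈ Icc (1 / 4 : ℝ) 1) :
    0 ≤ b.psiLo κ lam₀ s ∧ b.psiLo κ lam₀ s ≤ 1 - 4 / 3 * (b.alphaLo κ s - 1 / 4) := by
  have hl := P.hl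
  have hw := spikeWin_mem_Icc (b.alphaLo κ s)
  simp only [BandData.psiLo, spikeScalar]
  have h1 : 0 ≤ 1 - spikeWin (b.alphaLo κ s) * (1 * (1 - lam₀)) ∧ 1 - spikeWin (b.alphaLo κ s) * (1 * (1 - lam₀)) ≤ 1 :=
    ⟨by nlinarith [hw.1, hw.2, hl.1, hl.2], by nlinarith [hw.1, hw.2, hl.1, hl.2]⟩
  have h2 : 0 ≤ 1 - (b.alphaLo κ s - 1 / 4) / (3 / 4) := by rw [sub_nonneg, div_le_one (by norm_num)]; linarith [hα.2]
  constructor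
  · exact mul_nonneg h1.1 h2
  · calc _ ≤ 1 * (1 - (b.alphaLo κ s - 1 / 4) / (3 / 4)) := mul_le_mul_of_nonneg_right h1.2 h2
      _ = _ := by ring

/-- The upper ray scalar is at most `1 - (4/3)(αHi - 1/4)` and nonnegative. [folklore] -/
theorem psiHi_bounds {s : ℝ} (hα : b.alphaHi κ s ∈ Icc (1 / 4 : ℝ) 1) :
    0 ≤ b.psiHi κ lam₀ s ∧ b.psiHi κ lam₀ s ≤ 1 - 4 / 3 * (b.alphaHi κ s - 1 / 4) := by
  have hl := P.hl
  have hw := spikeWin_mem_Icc (b.alphaHi κ s)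
  simp only [BandData.psiHi, spikeScalar]
  have h1 : 0 ≤ 1 - spikeWin (b.alphaHi κ s) * (1 * (1 - lam₀)) ∧ 1 - spikeWin (b.alphaHi κ s) * (1 * (1 - lam₀)) ≤ 1 :=
    ⟨by nlinarith [hw.1, hw.2, hl.1, hl.2], by nlinarith [hw.1, hw.2, hl.1, hl.2]⟩
  have h2 : 0 ≤ 1 - (b.alphaHi κ s - 1 / 4) / (3 / 4) := by rw [sub_nonneg, div_le_one (by norm_num)]; linarith [hα.2]
  constructor
  · exact mul_nonneg h1.1 h2
  · calc _ ≤ 1 * (1 - (b.alphaHi κ s - 1 / 4) / (3 / 4)) := mul_le_mul_of_nonneg_right h1.2 h2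
      _ = _ := by ring

/-- **The five regimes of the track on the moving interval.** For `s ∈ [s₀, s₀']` one of:
(1) lower core, `αLo ∈ [1/16, 3/8)`; (2) lower core, `αLo ∈ [3/8, 3/4)`, `s < collarLo`;
(3) `s ∈ [collarLo, collarHi]`; (4) upper core, `αHi ∈ [3/8, 3/4)`, `collarHi < s`;
(5) upper core, `αHi ∈ [1/16, 3/8)`. [folklore] -/
theorem regime_cases {s : ℝ} (hs : s ∈ Icc P.sLo P.sHi) :
    (s ∈ Icc (b.tcLo - b.epsLo / 8) (b.tcLo + b.epsLo / 8) ∧ b.alphaLo κ s ∈ Ico (1 / 16 : ℝ) (3 / 8)) ∨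
    (s ∈ Icc (b.tcLo - b.epsLo / 8) (b.tcLo + b.epsLo / 8) ∧ b.alphaLo κ s ∈ Ico (3 / 8 : ℝ) (3 / 4) ∧ s < b.collarLo P.HU P.hl) ∨
    (s ∈ Icc (b.collarLo P.HU P.hl) (b.collarHi P.HU P.hl)) ∨
    (s ∈ Icc (b.tcHi - b.epsHi / 8) (b.tcHi + b.epsHi / 8) ∧ b.alphaHi κ s ∈ Ico (3 / 8 : ℝ) (3 / 4) ∧ b.collarHi P.HU P.hl < s) ∨
    (s ∈ Icc (b.tcHi - b.epsHi / 8) (b.tcHi + b.epsHi / 8) ∧ b.alphaHi κ s ∈ Ico (1 / 16 : ℝ) (3 / 8)) := by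
  have hκ := P.HU.cone.spike.κ_pos
  have hcLc := b.collarLo_mem_core P.HU P.hl; have hcHc := b.collarHi_mem_core P.HU P.hl
  have h16 := P.alphaLo_ge_of_mem hs; have h16' := P.alphaHi_ge_of_mem hs
  have hsl := P.sLo_spec; have hsh := P.sHi_spec
  by_cases h1 : s < b.collarLo P.HU P.hl
  · have hsc : s ∈ Icc (b.tcLo - b.epsLo / 8) (b.tcLo + b.epsLo / 8) := ⟨by linarith [hs.1, hsl.2.1, b.epsLo_bounds.1], by linarith [hcLc.2]⟩
    have hlt : b.alphaLo κ s < 3 / 4 := by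
      have hm := b.strictMonoOn_alphaLo (κ := κ) hκ
      linarith [hm hsc hcLc h1, P.alphaLo_collarLo_mem.2]
    by_cases h38 : b.alphaLo κ s < 3 / 8
    · exact Or.inl ⟨hsc, h16, h38⟩
    · push Not at h38; exact Or.inr (Or.inl ⟨hsc, ⟨h38, hlt⟩, h1⟩)
  by_cases h2 : b.collarHi P.HU P.hl < s
  · have hsc : s ∈ Icc (b.tcHi - b.epsHi / 8) (b.tcHi + b.epsHi / 8) := ⟨by linarith [hcHc.1], by linarith [hs.2, hsh.2.2, b.epsHi_bounds.1]⟩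
    have hlt : b.alphaHi κ s < 3 / 4 := by
      have hm := b.strictAntiOn_alphaHi (κ := κ) hκ
      linarith [hm hcHc hsc h2, P.alphaHi_collarHi_mem.2]
    by_cases h38 : b.alphaHi κ s < 3 / 8
    · exact Or.inr (Or.inr (Or.inr (Or.inr ⟨hsc, h16', h38⟩)))
    · push Not at h38; exact Or.inr (Or.inr (Or.inr (Or.inl ⟨hsc, ⟨h38, hlt⟩, h2⟩)))
  push Not at h1 h2
  exact Or.inr (Or.inr (Or.inl ⟨h1, h2⟩))

section Flat2

variable {ε₁ r₁ : ℝ} (hf₁ : b.IsFlat hcross ε₁ r₁) (hε₁ : ε₁ ≤ epsU) (hr₁ : 4 * κ < r₁)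
include hf₁ hε₁ hr₁

/-- **Regime 1 (lower bridge)**: coordinates of the track. With `α = αLo s ∈ [1/16, 3/8)`:
`|Y₀ - α| ≤ 2ε₁`, `Y₁ ≤ max (-1 + 2ε₁) (-1 + (4/3)(α - 1/4))`, `-2 ≤ Y₁`, `|Y₂| ≤ 1`, and for
`α ≥ 1/4`: `Y₀ = α`, `Y₁ = -1 + (4/3)(α - 1/4)`. [folklore] -/
theorem trk_regime1 {s : ℝ} (hsc : s ∈ Icc (b.tcLo - b.epsLo / 8) (b.tcLo + b.epsLo / 8)) (hα : b.alphaLo κ s ∈ Ico (1 / 16 : ℝ) (3 / 8)) :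
    |P.trk s 0 - b.alphaLo κ s| ≤ 2 * ε₁ ∧ P.trk s 1 ≤ max (-1 + 2 * ε₁) (-1 + 4 / 3 * (b.alphaLo κ s - 1 / 4)) ∧
      -2 ≤ P.trk s 1 ∧ |P.trk s 2| ≤ 1 ∧
      (1 / 4 ≤ b.alphaLo κ s → P.trk s 0 = b.alphaLo κ s ∧ P.trk s 1 = -1 + 4 / 3 * (b.alphaLo κ s - 1 / 4)) := by
  have hκ := P.HU.cone.spike.κ_pos
  have hqr : κ * (|b.alphaLo κ s| + 1) < r :=
    P.scale_lt_of_abs_le (by rw [abs_le]; constructor <;> linarith [P.HU.cone.spike.seven_le, hα.1, hα.2])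
  have hT := P.trk_zoneLo hsc hα.2 hqr
  have e0 := congrArg (fun Y : 𝔼 3 ↦ Y 0) hT
  have e1 := congrArg (fun Y : 𝔼 3 ↦ Y 1) hT
  have e2 := congrArg (fun Y : 𝔼 3 ↦ Y 2) hT
  simp only at e0 e1 e2
  rw [b.blowUp_pieceLo_zero hcross hκ.ne'] at e0
  rw [b.blowUp_pieceLo_one hcross hκ.ne'] at e1
  rw [b.blowUp_pieceLo hcross hκ.ne'] at e2
  simp only [PiLp.add_apply, PiLp.smul_apply, smul_eq_mul, modelLo_apply_two, one_mul] at e2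
  generalize b.alphaLo κ s = α at *
  have hαabs : |α| ≤ 3 / 8 := by rw [abs_le]; constructor <;> linarith [hα.1, hα.2]
  have hq1 : κ * (|α| + 1) < r₁ := by nlinarith [abs_nonneg α]
  obtain ⟨hR0, hR1, hR2⟩ := b.blowUp_railLoPsi_coord hf₁ hκ hq1
  have hε0 := hf₁.eps_nonneg
  have h256 := (epsU_small hε₁).2
  have hβ := spikeBump_mem_Icc α
  have hsp : spikeProfile α = (α - 1 / 4) / (3 / 4) := spikeProfile_of_le (by linarith [hα.2])
  have hεα : ε₁ * (|α| + 1) ≤ 2 * ε₁ := by nlinarith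
  set R := b.blowUp hcross κ (b.railLoPsi κ α) with hR
  have hR0' := abs_le.1 (hR0.trans hεα); have hR1' := abs_le.1 (hR1.trans hεα); have hR2' := abs_le.1 (hR2.trans hεα)
  have h1β : 0 ≤ 1 - spikeBump α := by linarith [hβ.2]
  refine ⟨?_, ?_, ?_, ?_, fun h14 ↦ ?_⟩
  · rw [e0]
    have e : (1 - 1 * spikeBump α) * R 0 + 1 * spikeBump α * α - α = (1 - spikeBump α) * (R 0 - α) := by ring
    rw [e, abs_mul, abs_of_nonneg h1β]
    calc (1 - spikeBump α) * |R 0 - α| ≤ 1 * (2 * ε₁) :=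
          mul_le_mul (by linarith [hβ.1]) (hR0.trans hεα) (abs_nonneg _) zero_le_one
      _ = 2 * ε₁ := one_mul _
  · rw [e1]
    have h : (1 - 1 * spikeBump α) * R 1 + 1 * spikeBump α * (-1 + spikeProfile α) ≤
        (1 - spikeBump α) * (-1 + 2 * ε₁) + spikeBump α * (-1 + 4 / 3 * (α - 1 / 4)) := by
      rw [hsp]
      have := mul_le_mul_of_nonneg_left hR1'.2 h1β
      nlinarith
    exact h.trans (convexComb_le_max hβ)
  · rw [e1, hsp]
    have := mul_le_mul_of_nonneg_left hR1'.1 h1β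
    nlinarith [hβ.1, hβ.2, hα.1, hα.2]
  · rw [e2]
    have hσ := b.abs_depthSign
    have hprod : |b.depthSign * spikeProfile α| ≤ 1 / 4 := by
      rw [abs_mul, hσ, one_mul, hsp, abs_le]; constructor <;> linarith [hα.1, hα.2]
    calc |(1 - spikeBump α) * R 2 + spikeBump α * (b.depthSign * spikeProfile α)|
        ≤ |(1 - spikeBump α) * R 2| + |spikeBump α * (b.depthSign * spikeProfile α)| := abs_add_le _ _
      _ = (1 - spikeBump α) * |R 2| + spikeBump α * |b.depthSign * spikeProfile α| := by
          rw [abs_mul, abs_mul, abs_of_nonneg h1β, abs_of_nonneg hβ.1]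
      _ ≤ (1 - spikeBump α) * (2 * ε₁) + spikeBump α * (1 / 4) :=
          add_le_add (mul_le_mul_of_nonneg_left (hR2.trans hεα) h1β) (mul_le_mul_of_nonneg_left hprod hβ.1)
      _ ≤ 1 := by nlinarith [hβ.1, hβ.2]
  · rw [e0, e1, hsp, spikeBump_eq_one ⟨h14, by linarith [hα.2]⟩]; constructor <;> ring

/-- **Regime 5 (upper bridge)**: coordinates of the track, `α = αHi s ∈ [1/16, 3/8)`. [folklore] -/
theorem trk_regime5 {s : ℝ} (hsc : s ∈ Icc (b.tcHi - b.epsHi / 8) (b.tcHi + b.epsHi / 8)) (hα : b.alphaHi κ s ∈ Ico (1 / 16 : ℝ) (3 / 8)) :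
    |P.trk s 0 - b.alphaHi κ s| ≤ 2 * ε₁ ∧ min (1 - 2 * ε₁) (1 - 4 / 3 * (b.alphaHi κ s - 1 / 4)) ≤ P.trk s 1 ∧
      P.trk s 1 ≤ 2 ∧ |P.trk s 2| ≤ 1 ∧
      (1 / 4 ≤ b.alphaHi κ s → P.trk s 0 = b.alphaHi κ s ∧ P.trk s 1 = 1 - 4 / 3 * (b.alphaHi κ s - 1 / 4)) := by
  have hκ := P.HU.cone.spike.κ_pos
  have hqr : κ * (|b.alphaHi κ s| + 1) < r :=
    P.scale_lt_of_abs_le (by rw [abs_le]; constructor <;> linarith [P.HU.cone.spike.seven_le, hα.1, hα.2])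
  have hT := P.trk_zoneHi hsc hα.2 hqr
  have e0 := congrArg (fun Y : 𝔼 3 ↦ Y 0) hT
  have e1 := congrArg (fun Y : 𝔼 3 ↦ Y 1) hT
  have e2 := congrArg (fun Y : 𝔼 3 ↦ Y 2) hT
  simp only at e0 e1 e2
  rw [b.blowUp_pieceHi_zero hcross hκ.ne'] at e0
  rw [b.blowUp_pieceHi hcross hκ.ne'] at e1 e2
  simp only [PiLp.add_apply, PiLp.smul_apply, smul_eq_mul, modelHi_apply_one, modelHi_apply_two, one_mul] at e1 e2
  generalize b.alphaHi κ s = α at *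
  have hαabs : |α| ≤ 3 / 8 := by rw [abs_le]; constructor <;> linarith [hα.1, hα.2]
  have hq1 : κ * (|α| + 1) < r₁ := by nlinarith [abs_nonneg α]
  obtain ⟨hR0, hR1, hR2⟩ := b.blowUp_railHiPsi_coord hf₁ hκ hq1
  have hε0 := hf₁.eps_nonneg
  have h256 := (epsU_small hε₁).2
  have hβ := spikeBump_mem_Icc α
  have hsp : spikeProfile α = (α - 1 / 4) / (3 / 4) := spikeProfile_of_le (by linarith [hα.2])
  have hεα : ε₁ * (|α| + 1) ≤ 2 * ε₁ := by nlinarith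
  set R := b.blowUp hcross κ (b.railHiPsi κ α) with hR
  have hR0' := abs_le.1 (hR0.trans hεα); have hR1' := abs_le.1 (hR1.trans hεα); have hR2' := abs_le.1 (hR2.trans hεα)
  have h1β : 0 ≤ 1 - spikeBump α := by linarith [hβ.2]
  refine ⟨?_, ?_, ?_, ?_, fun h14 ↦ ?_⟩
  · rw [e0]
    have e : (1 - 1 * spikeBump α) * R 0 + 1 * spikeBump α * α - α = (1 - spikeBump α) * (R 0 - α) := by ring
    rw [e, abs_mul, abs_of_nonneg h1β]
    calc (1 - spikeBump α) * |R 0 - α| ≤ 1 * (2 * ε₁) :=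
          mul_le_mul (by linarith [hβ.1]) (hR0.trans hεα) (abs_nonneg _) zero_le_one
      _ = 2 * ε₁ := one_mul _
  · rw [e1]
    have h : (1 - spikeBump α) * (1 - 2 * ε₁) + spikeBump α * (1 - 4 / 3 * (α - 1 / 4)) ≤
        (1 - spikeBump α) * R 1 + spikeBump α * (1 - spikeProfile α) := by
      rw [hsp]
      have := mul_le_mul_of_nonneg_left hR1'.1 h1β
      nlinarith
    exact (min_le_convexComb hβ).trans h
  · rw [e1, hsp]
    have := mul_le_mul_of_nonneg_left hR1'.2 h1β
    nlinarith [hβ.1, hβ.2, hα.1, hα.2]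
  · rw [e2]
    have hσ := b.abs_depthSign
    have hprod : |b.depthSign * spikeProfile α| ≤ 1 / 4 := by
      rw [abs_mul, hσ, one_mul, hsp, abs_le]; constructor <;> linarith [hα.1, hα.2]
    calc |(1 - spikeBump α) * R 2 + spikeBump α * (b.depthSign * spikeProfile α)|
        ≤ |(1 - spikeBump α) * R 2| + |spikeBump α * (b.depthSign * spikeProfile α)| := abs_add_le _ _
      _ = (1 - spikeBump α) * |R 2| + spikeBump α * |b.depthSign * spikeProfile α| := by
          rw [abs_mul, abs_mul, abs_of_nonneg h1β, abs_of_nonneg hβ.1]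
      _ ≤ (1 - spikeBump α) * (2 * ε₁) + spikeBump α * (1 / 4) :=
          add_le_add (mul_le_mul_of_nonneg_left (hR2.trans hεα) h1β) (mul_le_mul_of_nonneg_left hprod hβ.1)
      _ ≤ 1 := by nlinarith [hβ.1, hβ.2]
  · rw [e0, e1, hsp, spikeBump_eq_one ⟨h14, by linarith [hα.2]⟩]; constructor <;> ring

omit hf₁ hε₁ hr₁ in
/-- **Regime 2 (lower line)**: `trk = lowerPt (-ψLo)` with `ψLo ∈ (3/8, 5/6]`: `Y₀ = 1 - (3/4) ψLo`,
`Y₁ = -ψLo`, `|Y₂| ≤ 1`, and `mu = -ε_P ψLo`. [folklore] -/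
theorem trk_regime2 {s : ℝ} (hsc : s ∈ Icc (b.tcLo - b.epsLo / 8) (b.tcLo + b.epsLo / 8)) (hα : b.alphaLo κ s ∈ Ico (3 / 8 : ℝ) (3 / 4))
    (h1 : s < b.collarLo P.HU P.hl) :
    P.trk s 0 = 1 - 3 / 4 * b.psiLo κ lam₀ s ∧ P.trk s 1 = -b.psiLo κ lam₀ s ∧ |P.trk s 2| ≤ 1 ∧
      b.psiLo κ lam₀ s ∈ Ioc (3 / 8 : ℝ) (5 / 6) ∧ P.mu s = -(epsP * b.psiLo κ lam₀ s) := by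
  have hαI : b.alphaLo κ s ∈ Icc (1 / 4 : ℝ) (3 / 4) := ⟨by linarith [hα.1], hα.2.le⟩
  have hT := P.trk_lower hsc hαI h1.le
  obtain ⟨hψ0, hψ1⟩ := P.psiLo_bounds (s := s) ⟨by linarith [hα.1], by linarith [hα.2]⟩
  have hψ : b.psiLo κ lam₀ s ∈ Ioc (3 / 8 : ℝ) (5 / 6) := ⟨P.lt_psiLo_of_lt_collarLo hsc h1, by linarith [hα.1]⟩
  refine ⟨?_, ?_, ?_, hψ, ?_⟩
  · rw [hT, lowerPt_eq, oblPt_apply_zero]; ring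
  · rw [hT, lowerPt_eq, oblPt_apply_one]; ring
  · rw [hT, lowerPt_eq, oblPt_apply_two, abs_mul, b.abs_depthSign, one_mul, abs_le]
    constructor <;> linarith [hψ.2, hψ0]
  · show lev (P.trk s) = _; rw [hT, lev_lowerPt]; ring

omit hf₁ hε₁ hr₁ in
/-- **Regime 3 (window)**: `trk = lowerPt (clockFn s)` with `clockFn ∈ [-1/2, 1/2]`. [folklore] -/
theorem trk_regime3 {s : ℝ} (hs : s ∈ Icc (b.collarLo P.HU P.hl) (b.collarHi P.HU P.hl)) :
    P.trk s 0 = 1 + 3 / 4 * b.clockFn P.HU P.hl P.hl2 s ∧ P.trk s 1 = b.clockFn P.HU P.hl P.hl2 s ∧ |P.trk s 2| ≤ 2 ∧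
      b.clockFn P.HU P.hl P.hl2 s ∈ Icc (-(1 / 2) : ℝ) (1 / 2) ∧ P.mu s = epsP * b.clockFn P.HU P.hl P.hl2 s := by
  have hsw : s ∈ Icc (b.winLo P.HU P.hl) (b.winHi P.HU P.hl) := ⟨by linarith [hs.1, P.winLo_lt_collarLo], by linarith [hs.2, P.collarHi_lt_winHi]⟩
  have hT := P.trk_window hsw
  have hc := b.clockFn_mem P.HU P.hl P.hl2 hsw
  refine ⟨?_, ?_, ?_, hc, ?_⟩
  · rw [hT, lowerPt_eq, oblPt_apply_zero]; ring
  · rw [hT, lowerPt_eq, oblPt_apply_one]; ring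
  · rw [hT, lowerPt_eq, oblPt_apply_two, abs_mul, b.abs_depthSign, one_mul, abs_le]
    constructor <;> linarith [hc.1, hc.2]
  · show lev (P.trk s) = _; rw [hT, lev_lowerPt]

omit hf₁ hε₁ hr₁ in
/-- **Regime 4 (bent upper ray)**: `trk = genPt (ψHi)` with `ψ = ψHi ∈ (3/8, 5/6]`, bend angle
`φ ∈ [0, π/2]`: `Y₀ = 1 + (3/4) ψ (sin φ - cos φ)`, `Y₁ = ψ (sin φ + cos φ)`, `|Y₂| ≤ 3`,
`mu = ψ cos φ + ε_P ψ sin φ`; and `φ = 0` when `ψ ≥ 3/4`. [folklore] -/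
theorem trk_regime4 {s : ℝ} (hsc : s ∈ Icc (b.tcHi - b.epsHi / 8) (b.tcHi + b.epsHi / 8)) (hα : b.alphaHi κ s ∈ Ico (3 / 8 : ℝ) (3 / 4))
    (h2 : b.collarHi P.HU P.hl < s) :
    let ψ := b.psiHi κ lam₀ s; let φ := bendAng rA ψ
    P.trk s 0 = 1 + 3 / 4 * (ψ * Real.sin φ) - 3 / 4 * (ψ * Real.cos φ) ∧ P.trk s 1 = ψ * Real.sin φ + ψ * Real.cos φ ∧
      |P.trk s 2| ≤ 3 ∧ ψ ∈ Ioc (3 / 8 : ℝ) (5 / 6) ∧ φ ∈ Icc 0 (π / 2) ∧ P.mu s = ψ * Real.cos φ + epsP * (ψ * Real.sin φ) ∧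
      (3 / 4 ≤ ψ → φ = 0) := by
  intro ψ φ
  have hαI : b.alphaHi κ s ∈ Icc (1 / 4 : ℝ) (3 / 4) := ⟨by linarith [hα.1], hα.2.le⟩
  have hT := P.trk_upper hsc hαI h2.le
  obtain ⟨hψ0, hψ1⟩ := P.psiHi_bounds (s := s) ⟨by linarith [hα.1], by linarith [hα.2]⟩
  have hψ : ψ ∈ Ioc (3 / 8 : ℝ) (5 / 6) := ⟨P.lt_psiHi_of_collarHi_lt hsc h2, by show b.psiHi κ lam₀ s ≤ 5 / 6; linarith [hα.1]⟩
  have hφ : φ ∈ Icc 0 (π / 2) := bendAng_mem rA ψ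
  have hs0 := Real.sin_nonneg_of_nonneg_of_le_pi hφ.1 (by linarith [hφ.2, Real.pi_pos])
  have hs1 := Real.sin_le_one φ
  have hc0 := Real.cos_nonneg_of_mem_Icc ⟨by linarith [hφ.1, Real.pi_pos], hφ.2⟩
  have hc1 := Real.cos_le_one φ
  rw [hT, genPt_eq]
  refine ⟨?_, ?_, ?_, hψ, hφ, ?_, fun h34 ↦ ?_⟩
  · rw [oblPt_apply_zero]
  · rw [oblPt_apply_one]
  · rw [oblPt_apply_two, abs_mul, b.abs_depthSign, one_mul, abs_le]
    have : 0 ≤ ψ := hψ0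
    constructor <;> nlinarith [hψ.2]
  · show lev (P.trk s) = _; rw [hT, lev_genPt, levGen]
  · show bendAng rA ψ = 0
    rw [bendAng, annulusCut_of_ge (by nlinarith), mul_zero]

omit hf₁ hε₁ hr₁ in
/-- **The three regimes of the target**: lower blend `(αLo, gLoT αLo)` (`αLo ≤ 3/8`, lower core),
upper blend, or `tgt (mu s)` with `mu s ∈ [-(5/6) ε_P, 5/6]`. [folklore] -/
theorem hh_cases {s : ℝ} (hs : s ∈ Icc P.sLo P.sHi) :
    (s ∈ Icc (b.tcLo - b.epsLo / 8) (b.tcLo + b.epsLo / 8) ∧ b.alphaLo κ s ∈ Icc (1 / 16 : ℝ) (3 / 8) ∧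
        P.hh s = pt2 (b.alphaLo κ s) (gLoT (b.alphaLo κ s))) ∨
    (s ∈ Icc (b.tcHi - b.epsHi / 8) (b.tcHi + b.epsHi / 8) ∧ b.alphaHi κ s ∈ Icc (1 / 16 : ℝ) (3 / 8) ∧
        P.hh s = pt2 (b.alphaHi κ s) (gHiT (b.alphaHi κ s))) ∨
    (3 / 8 < b.alphaLo κ s ∧ 3 / 8 < b.alphaHi κ s ∧ P.hh s = tgt (P.mu s) ∧ P.mu s ∈ Icc (-(5 / 6 * epsP)) (5 / 6)) := by
  have hκ := P.HU.cone.spike.κ_pos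
  have h16 := P.alphaLo_ge_of_mem hs; have h16' := P.alphaHi_ge_of_mem hs
  by_cases hL : b.alphaLo κ s ≤ 3 / 8
  · have hsc := P.mem_coreLo_of_alphaLo_lt (P.sLo_spec.2.1.trans hs.1) (by linarith)
    exact Or.inl ⟨hsc, ⟨h16, hL⟩, P.hh_zoneLo hsc hL⟩
  by_cases hH : b.alphaHi κ s ≤ 3 / 8
  · have hsc := P.mem_coreHi_of_alphaHi_lt (hs.2.trans P.sHi_spec.2.2) (by linarith)
    exact Or.inr (Or.inl ⟨hsc, ⟨h16', hH⟩, P.hh_zoneHi hsc hH⟩)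
  push Not at hL hH
  refine Or.inr (Or.inr ⟨hL, hH, P.hh_of_ge (by linarith) (by linarith), ?_⟩)
  -- `s` lies strictly between `paramLo (3/8)` and `paramHi (3/8)`
  have h38 : (3 / 8 : ℝ) ∈ Icc (0 : ℝ) 7 := by norm_num
  have hpL := P.paramLo_spec h38; have hpLc := P.paramLo_mem_core h38
  have hpH := P.paramHi_spec h38; have hpHc := P.paramHi_mem_core h38
  have hq := P.paramLo_spec quarter_mem07; have hq' := P.paramHi_spec quarter_mem07
  have hlo : P.paramLo h38 ≤ s := by
    by_contra hc; push Not at hc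
    have hsc : s ∈ Icc (b.tcLo - b.epsLo / 8) (b.tcLo + b.epsLo / 8) := ⟨by linarith [hs.1, P.sLo_spec.2.1, b.epsLo_bounds.1], by linarith [hpLc.2]⟩
    have := (P.alphaLo_lt_iff h38 hsc).2 hc; linarith
  have hhi : s ≤ P.paramHi h38 := by
    by_contra hc; push Not at hc
    have hsc : s ∈ Icc (b.tcHi - b.epsHi / 8) (b.tcHi + b.epsHi / 8) := ⟨by linarith [hpHc.1], by linarith [hs.2, P.sHi_spec.2.2, b.epsHi_bounds.1]⟩
    have := (P.alphaHi_lt_iff h38 hsc).2 hc; linarith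
  have hmlo : P.mu (P.paramLo h38) = -(5 / 6 * epsP) := by rw [P.mu_stubLo hpLc (by rw [hpL.2]; norm_num), hpL.2]; ring
  have hmhi : P.mu (P.paramHi h38) = 5 / 6 := by rw [P.mu_stubHi hpHc (by rw [hpH.2]; norm_num), hpH.2]; ring
  have hm := P.strictMonoOn_mu.monotoneOn
  have hqlo : P.paramLo quarter_mem07 ≤ P.paramLo h38 := by
    by_contra hc; push Not at hc
    have h' := (P.alphaLo_lt_iff quarter_mem07 hpLc).2 hc
    rw [hpL.2] at h'; norm_num at h'
  have hqhi : P.paramHi h38 ≤ P.paramHi quarter_mem07 := by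
    by_contra hc; push Not at hc
    have h' := (P.alphaHi_lt_iff quarter_mem07 hpHc).2 hc
    rw [hpH.2] at h'; norm_num at h'
  have hsI : s ∈ Icc (P.paramLo quarter_mem07) (P.paramHi quarter_mem07) := ⟨hqlo.trans hlo, hhi.trans hqhi⟩
  have hLI : P.paramLo h38 ∈ Icc (P.paramLo quarter_mem07) (P.paramHi quarter_mem07) := ⟨hqlo, hlo.trans hsI.2⟩
  have hHI : P.paramHi h38 ∈ Icc (P.paramLo quarter_mem07) (P.paramHi quarter_mem07) := ⟨hsI.1.trans hhi, hqhi⟩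
  exact ⟨hmlo ▸ hm hLI hsI hlo, hmhi ▸ hm hsI hHI hhi⟩


end Flat2

/-! ### Facts about the blow-up family on the moving interval -/

omit P in
/-- The lower height profile is at most `-1 + (4/3) max (α - 1/4) 0`. [folklore] -/
theorem gLoT_le (α : ℝ) : gLoT α ≤ -1 + 4 / 3 * max (α - 1 / 4) 0 := by
  have hw := wCut_mem α
  rw [gLoT]
  have : wCut α * (4 / 3 * (α - 1 / 4)) ≤ 4 / 3 * max (α - 1 / 4) 0 := by
    rcases le_or_gt (α - 1 / 4) 0 with h | h
    · rw [max_eq_right h]; nlinarith [hw.1]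
    · rw [max_eq_left h.le]; nlinarith [hw.2]
  linarith

omit P in
/-- The lower height profile for `α ≥ 1/4 + 1/24` is the line `-1 + (4/3)(α - 1/4)`. [folklore] -/
theorem gLoT_of_ge {α : ℝ} (h : 1 / 4 + 1 / 24 ≤ α) : gLoT α = -1 + 4 / 3 * (α - 1 / 4) := by
  rw [gLoT, wCut_of_ge h, one_mul]

omit P in
/-- The upper height profile is at least `1 - (4/3) max (α - 1/4) 0`. [folklore] -/
theorem le_gHiT (α : ℝ) : 1 - 4 / 3 * max (α - 1 / 4) 0 ≤ gHiT α := by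
  have h := gLoT_le α
  have e : gHiT α = -gLoT α := by simp [gHiT, gLoT]; ring
  rw [e]; linarith

omit P in
/-- The upper height profile for `α ≥ 1/4 + 1/24`. [folklore] -/
theorem gHiT_of_ge {α : ℝ} (h : 1 / 4 + 1 / 24 ≤ α) : gHiT α = 1 - 4 / 3 * (α - 1 / 4) := by
  rw [gHiT, wCut_of_ge h, one_mul]

/-- Coordinates of the family. [folklore] -/
theorem mix_apply (u s : ℝ) (i : Fin 3) : P.mix u s i = (1 - u) * P.trk s i + u * P.Npl (P.hh s) i := by
  simp [mix]

/-- A parameter of the moving interval with `αHi ≤ 3/8` lies right of the upper collar. [folklore] -/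
theorem collarHi_lt_of_alphaHi_le {s : ℝ} (hs : s ∈ Icc P.sLo P.sHi) (h : b.alphaHi κ s ≤ 3 / 8) : b.collarHi P.HU P.hl < s := by
  have hκ := P.HU.cone.spike.κ_pos
  have hsc := P.mem_coreHi_of_alphaHi_lt (hs.2.trans P.sHi_spec.2.2) (by linarith)
  have hcHc := b.collarHi_mem_core P.HU P.hl
  by_contra hc; push Not at hc
  have := (b.strictAntiOn_alphaHi (κ := κ) hκ).antitoneOn hsc hcHc hc
  linarith [P.alphaHi_collarHi_mem.1]

/-- A parameter of the moving interval with `αLo ≤ 3/8` lies left of the lower collar. [folklore] -/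
theorem lt_collarLo_of_alphaLo_le {s : ℝ} (hs : s ∈ Icc P.sLo P.sHi) (h : b.alphaLo κ s ≤ 3 / 8) : s < b.collarLo P.HU P.hl := by
  have hκ := P.HU.cone.spike.κ_pos
  have hsc := P.mem_coreLo_of_alphaLo_lt (P.sLo_spec.2.1.trans hs.1) (by linarith)
  have hcLc := b.collarLo_mem_core P.HU P.hl
  by_contra hc; push Not at hc
  have := (b.strictMonoOn_alphaLo (κ := κ) hκ).monotoneOn hcLc hsc hc
  linarith [P.alphaLo_collarLo_mem.1]

/-- `s ≥ zL` in the lower core means `αLo ≥ 11/32`. [folklore] -/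
theorem alphaLo_ge_of_zL_le {s : ℝ} (hsc : s ∈ Icc (b.tcLo - b.epsLo / 8) (b.tcLo + b.epsLo / 8)) (h : P.zL ≤ s) :
    11 / 32 ≤ b.alphaLo κ s := by
  by_contra hc; push Not at hc
  exact absurd ((P.alphaLo_lt_iff el32_mem07 hsc).1 hc) (not_lt.2 h)

/-- `s ≤ zU` in the upper core means `αHi ≥ 11/32`. [folklore] -/
theorem alphaHi_ge_of_le_zU {s : ℝ} (hsc : s ∈ Icc (b.tcHi - b.epsHi / 8) (b.tcHi + b.epsHi / 8)) (h : s ≤ P.zU) :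
    11 / 32 ≤ b.alphaHi κ s := by
  by_contra hc; push Not at hc
  exact absurd ((P.alphaHi_lt_iff el32_mem07 hsc).1 hc) (not_lt.2 h)

/-- `s ≤ eL` in the lower core means `αLo ≤ 3/10`. [folklore] -/
theorem alphaLo_le_of_le_eL {s : ℝ} (hsc : s ∈ Icc (b.tcLo - b.epsLo / 8) (b.tcLo + b.epsLo / 8)) (h : s ≤ P.eL) :
    b.alphaLo κ s ≤ 3 / 10 := (P.alphaLo_le_iff three10_mem07 hsc).2 h

/-- `eU ≤ s` in the upper core means `αHi ≤ 3/10`. [folklore] -/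
theorem alphaHi_le_of_eU_le {s : ℝ} (hsc : s ∈ Icc (b.tcHi - b.epsHi / 8) (b.tcHi + b.epsHi / 8)) (h : P.eU ≤ s) :
    b.alphaHi κ s ≤ 3 / 10 := (P.alphaHi_le_iff three10_mem07 hsc).2 h

omit P in
/-- A convex combination of two numbers `≥ a` is `≥ a`. [folklore] -/
theorem cvx_ge {a x y u : ℝ} (hu : u ∈ Icc (0 : ℝ) 1) (hx : a ≤ x) (hy : a ≤ y) : a ≤ (1 - u) * x + u * y := by
  have h1 := mul_le_mul_of_nonneg_left hx (show 0 ≤ 1 - u by linarith [hu.2])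
  have h2 := mul_le_mul_of_nonneg_left hy hu.1
  linarith

omit P in
/-- A convex combination of two numbers `≤ a` is `≤ a`. [folklore] -/
theorem cvx_le {a x y u : ℝ} (hu : u ∈ Icc (0 : ℝ) 1) (hx : x ≤ a) (hy : y ≤ a) : (1 - u) * x + u * y ≤ a := by
  have h1 := mul_le_mul_of_nonneg_left hx (show 0 ≤ 1 - u by linarith [hu.2])
  have h2 := mul_le_mul_of_nonneg_left hy hu.1
  linarith

section Facts

variable {ε₁ r₁ : ℝ} (hf₁ : b.IsFlat hcross ε₁ r₁) (hε₁ : ε₁ ≤ epsU) (hr₁ : 4 * κ < r₁)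
include hf₁ hε₁ hr₁

/-- **The true band at the target**: coordinates within `3 ε₁` of the planar target, third
coordinate within `3 ε₁` of `0`, norm at most `4`. [folklore] -/
theorem Npl_hh_coord {s : ℝ} (hs : s ∈ Icc (P.paramLo zero_mem07) (P.paramHi zero_mem07)) :
    |P.Npl (P.hh s) 0 - P.hh s 0| ≤ 3 * ε₁ ∧ |P.Npl (P.hh s) 1 - P.hh s 1| ≤ 3 * ε₁ ∧ |P.Npl (P.hh s) 2| ≤ 3 * ε₁ ∧
      ‖P.Npl (P.hh s)‖ ≤ 4 := by
  have hκ := P.HU.cone.spike.κ_pos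
  have hn := P.norm_hh_le hs
  have hq : ‖κ • P.hh s‖ < r₁ := by
    rw [norm_smul, Real.norm_eq_abs, abs_of_pos hκ]; nlinarith
  have h := P.norm_Npl_sub_lift_le hf₁ hq
  have hε0 := hf₁.eps_nonneg
  have h256 := (epsU_small hε₁).2
  have h3 : ‖P.Npl (P.hh s) - lift (P.hh s) 0‖ ≤ 3 * ε₁ := h.trans (by nlinarith)
  have hc : ∀ i : Fin 3, |(P.Npl (P.hh s) - lift (P.hh s) 0) i| ≤ 3 * ε₁ := fun i ↦ (BandFoliation.abs_apply_le_norm _ i).trans h3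
  refine ⟨by simpa using hc 0, by simpa using hc 1, by simpa using hc 2, ?_⟩
  calc ‖P.Npl (P.hh s)‖ = ‖(P.Npl (P.hh s) - lift (P.hh s) 0) + lift (P.hh s) 0‖ := by rw [sub_add_cancel]
    _ ≤ ‖P.Npl (P.hh s) - lift (P.hh s) 0‖ + ‖lift (P.hh s) 0‖ := norm_add_le _ _
    _ ≤ 3 * ε₁ + 3 := by rw [norm_lift_zero]; exact add_le_add h3 hn
    _ ≤ 4 := by linarith

/-- **Fact A: the first coordinate of the family is positive** (`≥ 1/16 - 3ε₁`) on the moving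
interval. [folklore] -/
theorem mix_zero_ge {u : ℝ} (hu : u ∈ Icc (0 : ℝ) 1) {s : ℝ} (hs : s ∈ Icc P.sLo P.sHi) : 1 / 16 - 3 * ε₁ ≤ P.mix u s 0 := by
  have hε0 := hf₁.eps_nonneg
  have h256 := (epsU_small hε₁).2
  obtain ⟨hN0, -, -, -⟩ := P.Npl_hh_coord hf₁ hε₁ hr₁ (P.Icc_sLo_sHi_subset hs)
  have hN0' := (abs_le.1 hN0).1
  -- the track part is `≥ 1/16 - 2ε₁`
  have hT : 1 / 16 - 2 * ε₁ ≤ P.trk s 0 := by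
    rcases P.regime_cases hs with ⟨hsc, hα⟩ | ⟨hsc, hα, h1⟩ | hw | ⟨hsc, hα, h2⟩ | ⟨hsc, hα⟩
    · have h := (abs_le.1 (P.trk_regime1 hf₁ hε₁ hr₁ hsc hα).1).1; linarith [hα.1]
    · obtain ⟨e0, -, -, hψ, -⟩ := P.trk_regime2 hsc hα h1; rw [e0]; linarith [hψ.2]
    · obtain ⟨e0, -, -, hc, -⟩ := P.trk_regime3 hw; rw [e0]; linarith [hc.1]
    · obtain ⟨e0, -, -, hψ, hφ, -, -⟩ := P.trk_regime4 hsc hα h2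
      rw [e0]
      have hs0 := Real.sin_nonneg_of_nonneg_of_le_pi hφ.1 (by linarith [hφ.2, Real.pi_pos])
      have hc1 := Real.cos_le_one (bendAng rA (b.psiHi κ lam₀ s))
      have hψ0 : 0 < b.psiHi κ lam₀ s := by linarith [hψ.1]
      nlinarith [hψ.2]
    · have h := (abs_le.1 (P.trk_regime5 hf₁ hε₁ hr₁ hsc hα).1).1; linarith [hα.1]
  -- the band part is `≥ 1/16 - 3ε₁`
  have hN : 1 / 16 - 3 * ε₁ ≤ P.Npl (P.hh s) 0 := by
    rcases P.hh_cases hs with ⟨-, hα, e⟩ | ⟨-, hα, e⟩ | ⟨-, -, e, hμ⟩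
    · have hq : P.hh s 0 = b.alphaLo κ s := by rw [e, pt2_apply_zero]
      linarith [hα.1]
    · have hq : P.hh s 0 = b.alphaHi κ s := by rw [e, pt2_apply_zero]
      linarith [hα.1]
    · have hε := epsP_pos
      obtain ⟨ht0, -⟩ := tgt_mem (m := P.mu s) ⟨by linarith [hμ.1], by linarith [hμ.2]⟩
      have hq : P.hh s 0 = tgt (P.mu s) 0 := by rw [e]
      linarith [ht0.1]
  rw [P.mix_apply]; exact cvx_ge hu (by linarith) hN

/-- **Fact N: the family is bounded** (`‖mix u s‖ ≤ 7`) on the moving interval. [folklore] -/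
theorem norm_mix_le {u : ℝ} (hu : u ∈ Icc (0 : ℝ) 1) {s : ℝ} (hs : s ∈ Icc P.sLo P.sHi) : ‖P.mix u s‖ ≤ 7 := by
  have hε0 := hf₁.eps_nonneg
  have h256 := (epsU_small hε₁).2
  obtain ⟨-, -, -, hN⟩ := P.Npl_hh_coord hf₁ hε₁ hr₁ (P.Icc_sLo_sHi_subset hs)
  have hT : ‖P.trk s‖ ≤ 7 := by
    refine (norm_le_abs3 _).trans ?_
    rcases P.regime_cases hs with ⟨hsc, hα⟩ | ⟨hsc, hα, h1⟩ | hw | ⟨hsc, hα, h2⟩ | ⟨hsc, hα⟩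
    · obtain ⟨h0, h1, h1', h2, -⟩ := P.trk_regime1 hf₁ hε₁ hr₁ hsc hα
      have h0' := abs_le.1 h0
      have ha : |P.trk s 0| ≤ 1 := by rw [abs_le]; constructor <;> linarith [hα.1, hα.2]
      have hb : |P.trk s 1| ≤ 2 := by
        rw [abs_le]; refine ⟨h1', h1.trans (max_le (by linarith) (by linarith [hα.2]))⟩
      linarith
    · obtain ⟨e0, e1, h2, hψ, -⟩ := P.trk_regime2 hsc hα h1
      have ha : |P.trk s 0| ≤ 1 := by rw [e0, abs_le]; constructor <;> linarith [hψ.1, hψ.2]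
      have hb : |P.trk s 1| ≤ 1 := by rw [e1, abs_le]; constructor <;> linarith [hψ.1, hψ.2]
      linarith
    · obtain ⟨e0, e1, h2, hc, -⟩ := P.trk_regime3 hw
      have ha : |P.trk s 0| ≤ 2 := by rw [e0, abs_le]; constructor <;> linarith [hc.1, hc.2]
      have hb : |P.trk s 1| ≤ 1 := by rw [e1, abs_le]; constructor <;> linarith [hc.1, hc.2]
      linarith
    · obtain ⟨e0, e1, h2, hψ, hφ, -, -⟩ := P.trk_regime4 hsc hα h2
      have hs0 := Real.sin_nonneg_of_nonneg_of_le_pi hφ.1 (by linarith [hφ.2, Real.pi_pos])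
      have hs1 := Real.sin_le_one (bendAng rA (b.psiHi κ lam₀ s))
      have hc0 := Real.cos_nonneg_of_mem_Icc ⟨by linarith [hφ.1, Real.pi_pos], hφ.2⟩
      have hc1 := Real.cos_le_one (bendAng rA (b.psiHi κ lam₀ s))
      have hψ0 : 0 < b.psiHi κ lam₀ s := by linarith [hψ.1]
      have ha : |P.trk s 0| ≤ 2 := by rw [e0, abs_le]; constructor <;> nlinarith [hψ.2]
      have hb : |P.trk s 1| ≤ 2 := by rw [e1, abs_le]; constructor <;> nlinarith [hψ.2]
      linarith
    · obtain ⟨h0, h1, h1', h2, -⟩ := P.trk_regime5 hf₁ hε₁ hr₁ hsc hα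
      have h0' := abs_le.1 h0
      have ha : |P.trk s 0| ≤ 1 := by rw [abs_le]; constructor <;> linarith [hα.1, hα.2]
      have hb : |P.trk s 1| ≤ 2 := by
        rw [abs_le]; refine ⟨le_trans (le_min (by linarith) (by linarith [hα.2])) h1, h1'⟩
      linarith
  calc ‖P.mix u s‖ ≤ ‖(1 - u) • P.trk s‖ + ‖u • P.Npl (P.hh s)‖ := norm_add_le _ _
    _ = (1 - u) * ‖P.trk s‖ + u * ‖P.Npl (P.hh s)‖ := by
        rw [norm_smul, norm_smul, Real.norm_eq_abs, Real.norm_eq_abs, abs_of_nonneg (by linarith [hu.2]), abs_of_nonneg hu.1]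
    _ ≤ (1 - u) * 7 + u * 7 := by gcongr <;> [linarith [hu.2]; exact hu.1; linarith]
    _ = 7 := by ring

/-- **Fact S1': left of `eL` the second coordinate is `≤ -14/15 + 3ε₁`.** [folklore] -/
theorem mix_one_le_of_le_eL {u : ℝ} (hu : u ∈ Icc (0 : ℝ) 1) {s : ℝ} (hs : s ∈ Icc P.sLo P.sHi) (h : s ≤ P.eL) :
    P.mix u s 1 ≤ -(14 / 15) + 3 * ε₁ := by
  have hε0 := hf₁.eps_nonneg
  have h256 := (epsU_small hε₁).2
  have h16 := P.alphaLo_ge_of_mem hs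
  have hsc := P.mem_coreLo_of_alphaLo_lt (P.sLo_spec.2.1.trans hs.1) (show b.alphaLo κ s < 7 by
    have := P.zone_marks; have hsc' : s ∈ Icc (b.tcLo - b.epsLo / 8) (b.tcLo + b.epsLo / 8) :=
      ⟨by linarith [hs.1, P.sLo_spec.2.1, b.epsLo_bounds.1], by linarith [this.2.1, this.2.2.1]⟩
    linarith [P.alphaLo_le_of_le_eL hsc' h])
  have hα := P.alphaLo_le_of_le_eL hsc h
  obtain ⟨-, hN1, -, -⟩ := P.Npl_hh_coord hf₁ hε₁ hr₁ (P.Icc_sLo_sHi_subset hs)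
  have hN1' := (abs_le.1 hN1).2
  obtain ⟨-, hT1, -, -, -⟩ := P.trk_regime1 hf₁ hε₁ hr₁ hsc ⟨h16, by linarith⟩
  have hT : P.trk s 1 ≤ -(14 / 15) + 2 * ε₁ := hT1.trans (max_le (by linarith) (by linarith))
  have hN : P.Npl (P.hh s) 1 ≤ -(14 / 15) + 3 * ε₁ := by
    have hq : P.hh s 1 = gLoT (b.alphaLo κ s) := by rw [P.hh_zoneLo hsc (by linarith), pt2_apply_one]
    have hg := gLoT_le (b.alphaLo κ s)
    have : max (b.alphaLo κ s - 1 / 4) 0 ≤ 1 / 20 := max_le (by linarith) (by norm_num)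
    linarith
  rw [P.mix_apply]; exact cvx_le hu (by linarith) hN

/-- **Fact S1: right of `zL` the second coordinate is `≥ -7/8 - 3ε₁`.** [folklore] -/
theorem mix_one_ge_of_zL_le {u : ℝ} (hu : u ∈ Icc (0 : ℝ) 1) {s : ℝ} (hs : s ∈ Icc P.sLo P.sHi) (h : P.zL ≤ s) :
    -(7 / 8) - 3 * ε₁ ≤ P.mix u s 1 := by
  have hε0 := hf₁.eps_nonneg
  have h256 := (epsU_small hε₁).2
  have hε := epsP_pos; have hε8 := epsP_le
  obtain ⟨-, hN1, -, -⟩ := P.Npl_hh_coord hf₁ hε₁ hr₁ (P.Icc_sLo_sHi_subset hs)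
  have hN1' := (abs_le.1 hN1).1
  have hT : -(7 / 8) - 2 * ε₁ ≤ P.trk s 1 := by
    rcases P.regime_cases hs with ⟨hsc, hα⟩ | ⟨hsc, hα, h1⟩ | hw | ⟨hsc, hα, h2⟩ | ⟨hsc, hα⟩
    · have h11 := P.alphaLo_ge_of_zL_le hsc h
      obtain ⟨-, -, -, -, hex⟩ := P.trk_regime1 hf₁ hε₁ hr₁ hsc hα
      rw [(hex (by linarith)).2]; linarith
    · obtain ⟨-, e1, -, hψ, -⟩ := P.trk_regime2 hsc hα h1; rw [e1]; linarith [hψ.2]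
    · obtain ⟨-, e1, -, hc, -⟩ := P.trk_regime3 hw; rw [e1]; linarith [hc.1]
    · obtain ⟨-, e1, -, hψ, hφ, -, -⟩ := P.trk_regime4 hsc hα h2
      rw [e1]
      have hs0 := Real.sin_nonneg_of_nonneg_of_le_pi hφ.1 (by linarith [hφ.2, Real.pi_pos])
      have hc0 := Real.cos_nonneg_of_mem_Icc ⟨by linarith [hφ.1, Real.pi_pos], hφ.2⟩
      have hψ0 : 0 < b.psiHi κ lam₀ s := by linarith [hψ.1]
      nlinarith
    · obtain ⟨-, h1, -, -, -⟩ := P.trk_regime5 hf₁ hε₁ hr₁ hsc hα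
      have : 5 / 6 - 2 * ε₁ ≤ min (1 - 2 * ε₁) (1 - 4 / 3 * (b.alphaHi κ s - 1 / 4)) := le_min (by linarith) (by linarith [hα.2])
      linarith
  have hN : -(7 / 8) - 3 * ε₁ ≤ P.Npl (P.hh s) 1 := by
    rcases P.hh_cases hs with ⟨hsc, hα, e⟩ | ⟨hsc, hα, e⟩ | ⟨-, -, e, hμ⟩
    · have h11 := P.alphaLo_ge_of_zL_le hsc h
      have hq : P.hh s 1 = -1 + 4 / 3 * (b.alphaLo κ s - 1 / 4) := by rw [e, pt2_apply_one, gLoT_of_ge (by linarith)]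
      linarith
    · have hq : P.hh s 1 = gHiT (b.alphaHi κ s) := by rw [e, pt2_apply_one]
      have hg := le_gHiT (b.alphaHi κ s)
      have : max (b.alphaHi κ s - 1 / 4) 0 ≤ 1 / 8 := max_le (by linarith [hα.2]) (by norm_num)
      linarith
    · have hq : P.hh s 1 = tgt (P.mu s) 1 := by rw [e]
      have hmono := tgt_one_le_tgt_one (show -(5 / 6 * epsP) ≤ P.mu s from hμ.1)
      have hv : tgt (-(5 / 6 * epsP)) 1 = -(5 / 6) := by
        rw [tgt_of_le (by rw [mA]; linarith), pt2_apply_one]; field_simp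
      linarith
  rw [P.mix_apply]; exact cvx_ge hu (by linarith) hN

end Facts

section Facts2

variable {ε₁ r₁ : ℝ} (hf₁ : b.IsFlat hcross ε₁ r₁) (hε₁ : ε₁ ≤ epsU) (hr₁ : 4 * κ < r₁)
include hf₁ hε₁ hr₁

/-- **Fact S2': right of `eU`**: `Y₁ ≥ 14/15 - 3ε₁` and `Y₀ ≤ 3/10 + 3ε₁`. [folklore] -/
theorem mix_of_eU_le {u : ℝ} (hu : u ∈ Icc (0 : ℝ) 1) {s : ℝ} (hs : s ∈ Icc P.sLo P.sHi) (h : P.eU ≤ s) :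
    14 / 15 - 3 * ε₁ ≤ P.mix u s 1 ∧ P.mix u s 0 ≤ 3 / 10 + 3 * ε₁ := by
  have hε0 := hf₁.eps_nonneg
  have h256 := (epsU_small hε₁).2
  have h16 := P.alphaHi_ge_of_mem hs
  have hzm := P.zone_marks
  have hsc : s ∈ Icc (b.tcHi - b.epsHi / 8) (b.tcHi + b.epsHi / 8) :=
    ⟨by linarith [hzm.2.2.2.1, hzm.2.2.2.2.1], by linarith [hs.2, P.sHi_spec.2.2, b.epsHi_bounds.1]⟩
  have hα := P.alphaHi_le_of_eU_le hsc h
  obtain ⟨hN0, hN1, -, -⟩ := P.Npl_hh_coord hf₁ hε₁ hr₁ (P.Icc_sLo_sHi_subset hs)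
  have hN0' := (abs_le.1 hN0).2; have hN1' := (abs_le.1 hN1).1
  obtain ⟨hT0, hT1, -, -, -⟩ := P.trk_regime5 hf₁ hε₁ hr₁ hsc ⟨h16, by linarith⟩
  have hT0' := (abs_le.1 hT0).2
  have hT1' : 14 / 15 - 2 * ε₁ ≤ P.trk s 1 := le_trans (le_min (by linarith) (by linarith)) hT1
  have hq0 : P.hh s 0 = b.alphaHi κ s := by rw [P.hh_zoneHi hsc (by linarith), pt2_apply_zero]
  have hq1 : P.hh s 1 = gHiT (b.alphaHi κ s) := by rw [P.hh_zoneHi hsc (by linarith), pt2_apply_one]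
  have hg := le_gHiT (b.alphaHi κ s)
  have : max (b.alphaHi κ s - 1 / 4) 0 ≤ 1 / 20 := max_le (by linarith) (by norm_num)
  rw [P.mix_apply, P.mix_apply]
  exact ⟨cvx_ge hu (by linarith) (by linarith), cvx_le hu (by linarith) (by linarith)⟩

/-- **Fact E: between `zL` and `zU` the first coordinate is `≥ 1/4 - 3ε₁`.** [folklore] -/
theorem mix_zero_ge_quarter {u : ℝ} (hu : u ∈ Icc (0 : ℝ) 1) {s : ℝ} (hs : s ∈ Icc P.sLo P.sHi) (h : s ∈ Icc P.zL P.zU) :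
    1 / 4 - 3 * ε₁ ≤ P.mix u s 0 := by
  have hε0 := hf₁.eps_nonneg
  have h256 := (epsU_small hε₁).2
  have hε := epsP_pos
  obtain ⟨hN0, -, -, -⟩ := P.Npl_hh_coord hf₁ hε₁ hr₁ (P.Icc_sLo_sHi_subset hs)
  have hN0' := (abs_le.1 hN0).1
  have hT : 1 / 4 ≤ P.trk s 0 := by
    rcases P.regime_cases hs with ⟨hsc, hα⟩ | ⟨hsc, hα, h1⟩ | hw | ⟨hsc, hα, h2⟩ | ⟨hsc, hα⟩
    · have h11 := P.alphaLo_ge_of_zL_le hsc h.1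
      obtain ⟨-, -, -, -, hex⟩ := P.trk_regime1 hf₁ hε₁ hr₁ hsc hα
      rw [(hex (by linarith)).1]; linarith
    · obtain ⟨e0, -, -, hψ, -⟩ := P.trk_regime2 hsc hα h1; rw [e0]; linarith [hψ.2]
    · obtain ⟨e0, -, -, hc, -⟩ := P.trk_regime3 hw; rw [e0]; linarith [hc.1]
    · obtain ⟨e0, -, -, hψ, hφ, -, -⟩ := P.trk_regime4 hsc hα h2
      rw [e0]
      have hs0 := Real.sin_nonneg_of_nonneg_of_le_pi hφ.1 (by linarith [hφ.2, Real.pi_pos])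
      have hc1 := Real.cos_le_one (bendAng rA (b.psiHi κ lam₀ s))
      have hψ0 : 0 < b.psiHi κ lam₀ s := by linarith [hψ.1]
      nlinarith [hψ.2]
    · have h11 := P.alphaHi_ge_of_le_zU hsc h.2
      obtain ⟨-, -, -, -, hex⟩ := P.trk_regime5 hf₁ hε₁ hr₁ hsc hα
      rw [(hex (by linarith)).1]; linarith
  have hN : 1 / 4 - 3 * ε₁ ≤ P.Npl (P.hh s) 0 := by
    rcases P.hh_cases hs with ⟨hsc, hα, e⟩ | ⟨hsc, hα, e⟩ | ⟨-, -, e, hμ⟩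
    · have h11 := P.alphaLo_ge_of_zL_le hsc h.1
      have hq : P.hh s 0 = b.alphaLo κ s := by rw [e, pt2_apply_zero]
      linarith
    · have h11 := P.alphaHi_ge_of_le_zU hsc h.2
      have hq : P.hh s 0 = b.alphaHi κ s := by rw [e, pt2_apply_zero]
      linarith
    · obtain ⟨ht0, -⟩ := tgt_mem (m := P.mu s) ⟨by linarith [hμ.1], by linarith [hμ.2]⟩
      have hq : P.hh s 0 = tgt (P.mu s) 0 := by rw [e]
      linarith [ht0.1]
  rw [P.mix_apply]; exact cvx_ge hu (by linarith) hN

/-- **Fact LY1: on the lower zone `Y₁ ≤ -7/8 + 3ε₁`.** [folklore] -/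
theorem mix_one_le_of_le_zL {u : ℝ} (hu : u ∈ Icc (0 : ℝ) 1) {s : ℝ} (hs : s ∈ Icc P.sLo P.zL) :
    P.mix u s 1 ≤ -(7 / 8) + 3 * ε₁ := by
  have hε0 := hf₁.eps_nonneg
  have h256 := (epsU_small hε₁).2
  obtain ⟨hso, hα⟩ := P.zoneLo_facts hs
  have hsc := Ioo_subset_Icc_self hso
  have hsS : s ∈ Icc P.sLo P.sHi := ⟨hs.1, by linarith [hs.2, P.zone_marks.2.2.1, P.zone_marks.2.2.2.1, P.zone_marks.2.2.2.2.1, P.zone_marks.2.2.2.2.2, b.coreLo_lt_coreHi]⟩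
  obtain ⟨-, hN1, -, -⟩ := P.Npl_hh_coord hf₁ hε₁ hr₁ (P.Icc_sLo_sHi_subset hsS)
  have hN1' := (abs_le.1 hN1).2
  obtain ⟨-, hT1, -, -, -⟩ := P.trk_regime1 hf₁ hε₁ hr₁ hsc ⟨hα.1, by linarith [hα.2]⟩
  have hT : P.trk s 1 ≤ -(7 / 8) + 2 * ε₁ := hT1.trans (max_le (by linarith) (by linarith [hα.2]))
  have hq : P.hh s 1 = gLoT (b.alphaLo κ s) := by rw [P.hh_zoneLo hsc (by linarith [hα.2]), pt2_apply_one]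
  have hg := gLoT_le (b.alphaLo κ s)
  have : max (b.alphaLo κ s - 1 / 4) 0 ≤ 3 / 32 := max_le (by linarith [hα.2]) (by norm_num)
  rw [P.mix_apply]; exact cvx_le hu (by linarith) (by linarith)

/-- **Fact UY1: on the upper zone `Y₁ ≥ 7/8 - 3ε₁`.** [folklore] -/
theorem mix_one_ge_of_zU_le {u : ℝ} (hu : u ∈ Icc (0 : ℝ) 1) {s : ℝ} (hs : s ∈ Icc P.zU P.sHi) :
    7 / 8 - 3 * ε₁ ≤ P.mix u s 1 := by
  have hε0 := hf₁.eps_nonneg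
  have h256 := (epsU_small hε₁).2
  obtain ⟨hso, hα⟩ := P.zoneHi_facts hs
  have hsc := Ioo_subset_Icc_self hso
  have hsS : s ∈ Icc P.sLo P.sHi := ⟨by linarith [hs.1, P.zone_marks.1, P.zone_marks.2.1, P.zone_marks.2.2.1, P.zone_marks.2.2.2.1, b.coreLo_lt_coreHi], hs.2⟩
  obtain ⟨-, hN1, -, -⟩ := P.Npl_hh_coord hf₁ hε₁ hr₁ (P.Icc_sLo_sHi_subset hsS)
  have hN1' := (abs_le.1 hN1).1
  obtain ⟨-, hT1, -, -, -⟩ := P.trk_regime5 hf₁ hε₁ hr₁ hsc ⟨hα.1, by linarith [hα.2]⟩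
  have hT : 7 / 8 - 2 * ε₁ ≤ P.trk s 1 := le_trans (le_min (by linarith) (by linarith [hα.2])) hT1
  have hq : P.hh s 1 = gHiT (b.alphaHi κ s) := by rw [P.hh_zoneHi hsc (by linarith [hα.2]), pt2_apply_one]
  have hg := le_gHiT (b.alphaHi κ s)
  have : max (b.alphaHi κ s - 1 / 4) 0 ≤ 3 / 32 := max_le (by linarith [hα.2]) (by norm_num)
  rw [P.mix_apply]; exact cvx_ge hu (by linarith) (by linarith)

/-- **Fact S2: left of `zU`**: `Y₁ ≤ 7/8 + 3ε₁` or `Y₀ ≥ 47/128 - 3ε₁`. [folklore] -/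
theorem mix_sep_of_le_zU {u : ℝ} (hu : u ∈ Icc (0 : ℝ) 1) {s : ℝ} (hs : s ∈ Icc P.sLo P.sHi) (h : s ≤ P.zU) :
    P.mix u s 1 ≤ 7 / 8 + 3 * ε₁ ∨ 47 / 128 - 3 * ε₁ ≤ P.mix u s 0 := by
  have hε0 := hf₁.eps_nonneg
  have h256 := (epsU_small hε₁).2
  have hε := epsP_pos; have hε8 := epsP_le
  have hκ := P.HU.cone.spike.κ_pos
  obtain ⟨hN0, hN1, -, -⟩ := P.Npl_hh_coord hf₁ hε₁ hr₁ (P.Icc_sLo_sHi_subset hs)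
  have hN0' := (abs_le.1 hN0).1; have hN1' := (abs_le.1 hN1).2
  rw [P.mix_apply, P.mix_apply]
  -- bound for the band part's second coordinate in the lower and middle regimes
  have hNlow : b.alphaLo κ s ≤ 3 / 8 ∨ (3 / 8 < b.alphaLo κ s ∧ 3 / 8 < b.alphaHi κ s) → P.Npl (P.hh s) 1 ≤ 5 / 6 + 3 * ε₁ := by
    intro hc
    rcases P.hh_cases hs with ⟨hsc, hα, e⟩ | ⟨hsc, hα, e⟩ | ⟨-, -, e, hμ⟩
    · have hq : P.hh s 1 = gLoT (b.alphaLo κ s) := by rw [e, pt2_apply_one]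
      have hg := gLoT_le (b.alphaLo κ s)
      have : max (b.alphaLo κ s - 1 / 4) 0 ≤ 1 / 8 := max_le (by linarith [hα.2]) (by norm_num)
      linarith
    · exfalso
      rcases hc with hc | hc
      · have h1 := P.lt_collarLo_of_alphaLo_le hs hc
        have h2 := P.collarHi_lt_of_alphaHi_le hs hα.2
        linarith [b.collarLo_lt_collarHi P.HU P.hl P.hl2]
      · linarith [hc.2, hα.2]
    · have hq : P.hh s 1 = tgt (P.mu s) 1 := by rw [e]
      have hmono := tgt_one_le_tgt_one hμ.2
      have hv : tgt (5 / 6) 1 = 5 / 6 := by rw [tgt_of_ge (by rw [mB]; linarith), pt2_apply_one]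
      linarith
  rcases P.regime_cases hs with ⟨hsc, hα⟩ | ⟨hsc, hα, h1⟩ | hw | ⟨hsc, hα, h2⟩ | ⟨hsc, hα⟩
  · left
    obtain ⟨-, hT1, -, -, -⟩ := P.trk_regime1 hf₁ hε₁ hr₁ hsc hα
    have hT : P.trk s 1 ≤ 0 := hT1.trans (max_le (by linarith) (by linarith [hα.2]))
    have hN := hNlow (Or.inl hα.2.le)
    exact cvx_le hu (by linarith) (by linarith)
  · left
    obtain ⟨-, e1, -, hψ, -⟩ := P.trk_regime2 hsc hα h1
    have hT : P.trk s 1 ≤ 0 := by rw [e1]; linarith [hψ.1]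
    have hH : 3 / 8 < b.alphaHi κ s := by
      by_contra hc; push Not at hc
      have := P.collarHi_lt_of_alphaHi_le hs hc
      linarith [b.collarLo_lt_collarHi P.HU P.hl P.hl2]
    rcases eq_or_lt_of_le hα.1 with heq | hlt
    · have hN := hNlow (Or.inl heq.symm.le)
      exact cvx_le hu (by linarith) (by linarith)
    · have hN := hNlow (Or.inr ⟨hlt, hH⟩)
      exact cvx_le hu (by linarith) (by linarith)
  · left
    obtain ⟨-, e1, -, hc, -⟩ := P.trk_regime3 hw
    have hT : P.trk s 1 ≤ 1 / 2 := by rw [e1]; exact hc.2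
    have hL : 3 / 8 < b.alphaLo κ s := by
      by_contra hc'; push Not at hc'
      have := P.lt_collarLo_of_alphaLo_le hs hc'; linarith [hw.1]
    have hH : 3 / 8 < b.alphaHi κ s := by
      by_contra hc'; push Not at hc'
      have := P.collarHi_lt_of_alphaHi_le hs hc'; linarith [hw.2]
    have hN := hNlow (Or.inr ⟨hL, hH⟩)
    exact cvx_le hu (by linarith) (by linarith)
  · obtain ⟨e0, e1, -, hψ, hφ, hμ, hφ0⟩ := P.trk_regime4 hsc hα h2
    set ψ := b.psiHi κ lam₀ s with hψdef
    set φ := bendAng rA ψ with hφdef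
    have hs0 := Real.sin_nonneg_of_nonneg_of_le_pi hφ.1 (by linarith [hφ.2, Real.pi_pos])
    have hs1 := Real.sin_le_one φ
    have hc0 := Real.cos_nonneg_of_mem_Icc ⟨by linarith [hφ.1, Real.pi_pos], hφ.2⟩
    have hc1 := Real.cos_le_one φ
    have hψ0 : 0 < ψ := by linarith [hψ.1]
    have hL : 3 / 8 < b.alphaLo κ s := by
      by_contra hc'; push Not at hc'
      have := P.lt_collarLo_of_alphaLo_le hs hc'; linarith [b.collarLo_lt_collarHi P.HU P.hl P.hl2]
    -- the band part is `tgt (mu s)` (or the upper blend at `αHi = 3/8`)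
    by_cases h34 : 3 / 4 ≤ ψ
    · left
      have hφz := hφ0 h34
      have hT : P.trk s 1 ≤ 5 / 6 := by rw [e1, hφz, Real.sin_zero, Real.cos_zero]; linarith [hψ.2]
      have hN : P.Npl (P.hh s) 1 ≤ 7 / 8 + 3 * ε₁ := by
        rcases P.hh_cases hs with ⟨hsc', hα', e⟩ | ⟨hsc', hα', e⟩ | ⟨-, -, e, hμ'⟩
        · linarith [hα'.2]
        · have h11 := P.alphaHi_ge_of_le_zU hsc h
          have hq : P.hh s 1 = 1 - 4 / 3 * (b.alphaHi κ s - 1 / 4) := by rw [e, pt2_apply_one, gHiT_of_ge (by linarith)]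
          linarith
        · have hq : P.hh s 1 = ψ := by
            rw [e, hμ, hφz, Real.sin_zero, Real.cos_zero, tgt_of_ge (by rw [mB]; nlinarith), pt2_apply_one]; ring
          linarith [hψ.2]
      exact cvx_le hu (by linarith) hN
    · right
      push Not at h34
      have hT : 7 / 16 ≤ P.trk s 0 := by rw [e0]; nlinarith
      have hN : 47 / 128 - 3 * ε₁ ≤ P.Npl (P.hh s) 0 := by
        rcases P.hh_cases hs with ⟨hsc', hα', e⟩ | ⟨hsc', hα', e⟩ | ⟨-, -, e, hμ'⟩
        · linarith [hα'.2]
        · -- `αHi = 3/8`: then `ψ = 5/6 ≥ 3/4`, contradiction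
          exfalso
          have h38 : b.alphaHi κ s = 3 / 8 := le_antisymm hα'.2 hα.1
          have : ψ = 5 / 6 := by
            simp only [hψdef, BandData.psiHi, spikeScalar, h38, spikeWin_eq_zero (show (3 / 8 : ℝ) ≤ 7 / 16 by norm_num)]
            norm_num
          linarith
        · have hμ0 : 0 ≤ P.mu s := by rw [hμ]; positivity
          have hμ1 : P.mu s ≤ 27 / 32 := by
            rw [hμ]
            have h1 : ψ * Real.cos φ ≤ ψ := by nlinarith
            have h2 : epsP * (ψ * Real.sin φ) ≤ 1 / 8 * ψ :=
              calc epsP * (ψ * Real.sin φ) ≤ epsP * ψ := mul_le_mul_of_nonneg_left (by nlinarith) hε.le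
                _ ≤ 1 / 8 * ψ := mul_le_mul_of_nonneg_right hε8 hψ0.le
            linarith
          have hq : P.hh s 0 = 1 - 3 / 4 * P.mu s := by rw [e, tgt_of_ge (by rw [mB]; linarith), pt2_apply_zero]
          linarith
      exact cvx_ge hu (by linarith) hN
  · left
    have h11 := P.alphaHi_ge_of_le_zU hsc h
    obtain ⟨-, -, -, -, hex⟩ := P.trk_regime5 hf₁ hε₁ hr₁ hsc hα
    have hT : P.trk s 1 ≤ 7 / 8 := by rw [(hex (by linarith)).2]; linarith
    have hN : P.Npl (P.hh s) 1 ≤ 7 / 8 + 3 * ε₁ := by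
      have hq : P.hh s 1 = 1 - 4 / 3 * (b.alphaHi κ s - 1 / 4) := by
        rw [P.hh_zoneHi hsc hα.2.le, pt2_apply_one, gHiT_of_ge (by linarith)]
      linarith
    exact cvx_le hu (by linarith) hN

/-- **Fact Lmono: on the lower zone `Y₀` is at least its value at `s₀`.** [folklore] -/
theorem mix_zero_ge_sLo {u : ℝ} (hu : u ∈ Icc (0 : ℝ) 1) {s : ℝ} (hs : s ∈ Icc P.sLo P.zL) :
    P.trk P.sLo 0 ≤ P.mix u s 0 := by
  have hm := (P.strictMonoOn_mix_zero_zoneLo hf₁ hε₁ hr₁ hu).monotoneOn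
  have h0 : P.mix u P.sLo 0 = P.trk P.sLo 0 := by
    have hsl := P.sLo_spec
    rw [mix, P.Npl_hh_eq_trk_of_alphaLo_le (s := P.sLo) (P.paramLo_mem_core sixteenth_mem07) (by rw [hsl.1]; norm_num) (by rw [hsl.1]; norm_num)]
    simp only [PiLp.add_apply, PiLp.smul_apply, smul_eq_mul]; ring
  rw [← h0]
  exact hm ⟨le_rfl, hs.1.trans hs.2⟩ hs hs.1

/-- **Fact Umono: on the upper zone `Y₀` is at least its value at `s₀'`.** [folklore] -/
theorem mix_zero_ge_sHi {u : ℝ} (hu : u ∈ Icc (0 : ℝ) 1) {s : ℝ} (hs : s ∈ Icc P.zU P.sHi) :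
    P.trk P.sHi 0 ≤ P.mix u s 0 := by
  have hm := (P.strictAntiOn_mix_zero_zoneHi hf₁ hε₁ hr₁ hu).antitoneOn
  have h0 : P.mix u P.sHi 0 = P.trk P.sHi 0 := by
    have hsh := P.sHi_spec
    rw [mix, P.Npl_hh_eq_trk_of_alphaHi_le (s := P.sHi) (P.paramHi_mem_core sixteenth_mem07) (by rw [hsh.1]; norm_num) (by rw [hsh.1]; norm_num)]
    simp only [PiLp.add_apply, PiLp.smul_apply, smul_eq_mul]; ring
  rw [← h0]
  exact hm hs ⟨hs.1.trans hs.2, le_rfl⟩ hs.2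

/-- **The blow-up family is injective on the moving interval.** [folklore] -/
theorem injOn_mix {u : ℝ} (hu : u ∈ Icc (0 : ℝ) 1) : InjOn (P.mix u) (Icc P.sLo P.sHi) := by
  have hε0 := hf₁.eps_nonneg
  have h256 := (epsU_small hε₁).2
  have hzm := P.zone_marks
  -- reduce to `s < s'`
  suffices key : ∀ s ∈ Icc P.sLo P.sHi, ∀ s' ∈ Icc P.sLo P.sHi, s < s' → P.mix u s ≠ P.mix u s' by
    intro s hs s' hs' he
    by_contra hne
    rcases lt_or_gt_of_ne hne with hlt | hlt
    · exact key s hs s' hs' hlt he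
    · exact key s' hs' s hs hlt he.symm
  intro s hs s' hs' hlt he
  have he0 : P.mix u s 0 = P.mix u s' 0 := by rw [he]
  have he1 : P.mix u s 1 = P.mix u s' 1 := by rw [he]
  by_cases hA : s' ≤ P.zL
  · exact absurd he0 ((P.strictMonoOn_mix_zero_zoneLo hf₁ hε₁ hr₁ hu) ⟨hs.1, hlt.le.trans hA⟩ ⟨hs'.1, hA⟩ hlt).ne
  by_cases hB : P.zU ≤ s
  · exact absurd he0 ((P.strictAntiOn_mix_zero_zoneHi hf₁ hε₁ hr₁ hu) ⟨hB, hs.2⟩ ⟨hB.trans hlt.le, hs'.2⟩ hlt).ne'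
  by_cases hC : P.eL ≤ s ∧ s' ≤ P.eU
  · have hlev : lev (P.mix u s) = lev (P.mix u s') := by rw [he]
    exact absurd hlev ((P.strictMonoOn_lev_mix_zoneMid hf₁ hε₁ hr₁ hu) ⟨hC.1, hlt.le.trans hC.2⟩ ⟨hC.1.trans hlt.le, hC.2⟩ hlt).ne
  push Not at hA hB hC
  by_cases hD : s < P.eL
  · -- `s` far left, `s'` right of `zL`
    have h1 := P.mix_one_le_of_le_eL hf₁ hε₁ hr₁ hu hs hD.le
    have h2 := P.mix_one_ge_of_zL_le hf₁ hε₁ hr₁ hu hs' hA.le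
    linarith
  · push Not at hD
    have hE := hC hD
    -- `s'` far right, `s` left of `zU`
    obtain ⟨h1, h2⟩ := P.mix_of_eU_le hf₁ hε₁ hr₁ hu hs' hE.le
    rcases P.mix_sep_of_le_zU hf₁ hε₁ hr₁ hu hs hB.le with h3 | h3
    · linarith
    · linarith

/-- **The family is injective on the moving interval**, `u ∈ [0, 1]`. [folklore] -/
theorem injOn_fam {u : ℝ} (hu : u ∈ Icc (0 : ℝ) 1) : InjOn (P.fam u) (Icc P.sLo P.sHi) := by
  intro s hs s' hs' he
  rw [P.fam_of_mem hs, P.fam_of_mem hs'] at he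
  have h1 := coe_psiN_symm_injective he
  have hκ := P.HU.cone.spike.κ_pos
  have h2 : P.mix u s = P.mix u s' := by
    have := congrArg (b.blowUp hcross κ) h1
    rwa [b.blowUp_blowDown hcross hκ.ne', b.blowUp_blowDown hcross hκ.ne'] at this
  exact P.injOn_mix hf₁ hε₁ hr₁ hu hs hs' h2

end Facts2

/-! ### The fixed part of the host stays away from the moving part -/

/-- Left of `s₀` the host point is the instance wall frame `spikePiece 1`. [folklore] -/
theorem coe_hostPt_of_lt_sLo {t : ℝ} (htI : t ∈ Ico b.alo (b.alo + 1)) (ht : t < P.sLo) :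
    ((P.hostPt t : 𝕊 3) : 𝔼 4) = b.spikePiece hcross κ b.depthSign 1 t := by
  have hκ := P.HU.cone.spike.κ_pos
  have hsl := P.sLo_spec
  have hcl : P.sLo < b.collarLo P.HU P.hl := P.lt_collarLo_of_alphaLo_le ⟨le_rfl, P.marks.2.1.le⟩ (by rw [hsl.1]; norm_num)
  rw [P.coe_hostPt_of_le_collarLo htI (by linarith)]
  refine b.bentKnot_circlePt_of_not_mem P.HU P.hW (b.isBendClear_spikePiece P.HU.cone) P.hA P.hl P.hrA P.hB P.hAB htI ?_
  intro hc
  have hj := b.juncLo_spec hκ P.HU.cone.spike.seven_le_gapLo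
  have hjm := b.juncLo_mem_core hκ P.HU.cone.spike.seven_le_gapLo
  have hm := b.strictMonoOn_alphaLo (κ := κ) hκ
  have hlt : P.sLo < b.juncLo hκ P.HU.cone.spike.seven_le_gapLo :=
    (hm.lt_iff_lt (P.paramLo_mem_core sixteenth_mem07) hjm).1 (by
      show b.alphaLo κ P.sLo < _
      rw [hsl.1, hj.2]; norm_num)
  have := hc.1
  linarith

/-- Right of `s₀'` the host point is the instance wall frame `spikePiece 1`. [folklore] -/
theorem coe_hostPt_of_sHi_lt {t : ℝ} (htI : t ∈ Ico b.alo (b.alo + 1)) (ht : P.sHi < t) :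
    ((P.hostPt t : 𝕊 3) : 𝔼 4) = b.spikePiece hcross κ b.depthSign 1 t := by
  have hκ := P.HU.cone.spike.κ_pos
  have hsh := P.sHi_spec
  have hch : b.collarHi P.HU P.hl < P.sHi := P.collarHi_lt_of_alphaHi_le ⟨P.marks.2.1.le, le_rfl⟩ (by rw [hsh.1]; norm_num)
  rw [P.coe_hostPt_of_collarHi_le htI (by linarith)]
  refine b.bentKnot_circlePt_of_not_mem P.HU P.hW (b.isBendClear_spikePiece P.HU.cone) P.hA P.hl P.hrA P.hB P.hAB htI ?_
  intro hc
  have hj := b.juncHi_spec hκ P.HU.cone.spike.seven_le_gapHi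
  have hjm := b.juncHi_mem_core hκ P.HU.cone.spike.seven_le_gapHi
  have hm := b.strictAntiOn_alphaHi (κ := κ) hκ
  have hlt : b.juncHi hκ P.HU.cone.spike.seven_le_gapHi < P.sHi :=
    (StrictAntiOn.lt_iff_gt hm (P.paramHi_mem_core sixteenth_mem07) hjm).1 (by
      show b.alphaHi κ P.sHi < _
      rw [hsh.1, hj.2]; norm_num)
  have := hc.2
  linarith

section Disjoint

variable {ε₁ r₁ : ℝ} (hf₁ : b.IsFlat hcross ε₁ r₁) (hε₁ : ε₁ ≤ epsU) (hr₁ : 4 * κ < r₁)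
include hf₁ hε₁ hr₁

/-- **The moving points are never in the far set.** [folklore] -/
theorem psiN_symm_blowDown_mix_not_mem_farSet {u : ℝ} (hu : u ∈ Icc (0 : ℝ) 1) {s : ℝ} (hs : s ∈ Icc P.sLo P.sHi) :
    ((psiN.symm (b.blowDown hcross κ (P.mix u s)) : 𝕊 3) : 𝔼 4) ∉ b.farSet (min (r / 2) (min b.gapLo b.gapHi)) := by
  have hκ := P.HU.cone.spike.κ_pos
  refine b.psiN_symm_not_mem_farSet_half P.HU.cone ?_
  have hn := P.norm_mix_le hf₁ hε₁ hr₁ hu hs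
  have e : b.blowDown hcross κ (P.mix u s) - b.pZero = κ • (((b.frame hcross : (𝔼 3) ≃L[ℝ] 𝔼 3) : (𝔼 3) →L[ℝ] 𝔼 3) (P.mix u s)) := by
    simp [blowDown]
  rw [e, norm_smul, Real.norm_eq_abs, abs_of_pos hκ]
  have h1 := (((b.frame hcross : (𝔼 3) ≃L[ℝ] 𝔼 3) : (𝔼 3) →L[ℝ] 𝔼 3)).le_opNorm (P.mix u s)
  have h0 : 0 ≤ ‖((b.frame hcross : (𝔼 3) ≃L[ℝ] 𝔼 3) : (𝔼 3) →L[ℝ] 𝔼 3)‖ := norm_nonneg _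
  calc κ * ‖(((b.frame hcross : (𝔼 3) ≃L[ℝ] 𝔼 3) : (𝔼 3) →L[ℝ] 𝔼 3)) (P.mix u s)‖
      ≤ κ * (‖((b.frame hcross : (𝔼 3) ≃L[ℝ] 𝔼 3) : (𝔼 3) →L[ℝ] 𝔼 3)‖ * 7) := by
        refine mul_le_mul_of_nonneg_left (h1.trans ?_) hκ.le
        exact mul_le_mul_of_nonneg_left hn h0
    _ ≤ 9 * κ * ‖((b.frame hcross : (𝔼 3) ≃L[ℝ] 𝔼 3) : (𝔼 3) →L[ℝ] 𝔼 3)‖ := by nlinarith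
set_option maxHeartbeats 400000 in -- buildfix (bf3-g27): 160k/180k FAIL, 200k PASS at accept time; line-neutral budget line
/-- **Lower fixed points.** For `t < s₀` in the fundamental domain, the host point differs from
every moving point. [folklore] -/
theorem mix_ne_host_of_lt_sLo {u : ℝ} (hu : u ∈ Icc (0 : ℝ) 1) {s : ℝ} (hs : s ∈ Icc P.sLo P.sHi) {t : ℝ}
    (htI : t ∈ Ico b.alo (b.alo + 1)) (ht : t < P.sLo) :
    ((psiN.symm (b.blowDown hcross κ (P.mix u s)) : 𝕊 3) : 𝔼 4) ≠ ((P.hostPt t : 𝕊 3) : 𝔼 4) := by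
  have h := P.HU.cone.spike
  have hκ := h.κ_pos
  have hε0 := hf₁.eps_nonneg
  have h256 := (epsU_small hε₁).2
  have hsmall := (epsU_small hε₁).1
  have hB := bumpBound_spec.1; have hC := smoothTransitionDerivBound_pos; have hTL := tgtLip_pos
  have hsl := P.sLo_spec
  have hfar := P.psiN_symm_blowDown_mix_not_mem_farSet hf₁ hε₁ hr₁ hu hs
  rw [P.coe_hostPt_of_lt_sLo htI ht]
  set ρ₂ := min (r / 2) (min b.gapLo b.gapHi) with hρ₂
  have hρr : ρ₂ ≤ r / 2 := min_le_left _ _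
  have hρg : ρ₂ ≤ b.gapLo := (min_le_right _ _).trans (min_le_left _ _)
  have h8 := h.eight_lt_r
  by_cases hcore : b.tcLo - b.epsLo / 8 ≤ t
  · -- `t` in the closed lower core, with `αLo t < 1/16`
    have htc : t ∈ Icc (b.tcLo - b.epsLo / 8) (b.tcLo + b.epsLo / 8) := ⟨hcore, by linarith [hsl.2.2]⟩
    have hαt : b.alphaLo κ t < 1 / 16 := by
      rw [← hsl.1]; exact b.strictMonoOn_alphaLo (κ := κ) hκ htc (P.paramLo_mem_core sixteenth_mem07) ht
    by_cases hflat : κ * (|b.alphaLo κ t| + 1) < r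
    · -- flat regime: compare blow-up coordinates
      rw [b.spikePiece_one_coreLo h htc (norm_railLoParam_lt hκ hflat)]
      intro he
      have h1 := coe_psiN_symm_injective he
      have h2 : P.mix u s = b.blowUp hcross κ (b.pieceLo hcross κ b.depthSign 1 (b.alphaLo κ t)) := by
        have := congrArg (b.blowUp hcross κ) h1
        rwa [b.blowUp_blowDown hcross hκ.ne'] at this
      set α := b.alphaLo κ t with hαdef
      have hβ0 : spikeBump α = 0 := spikeBump_eq_zero_of_le (by linarith)
      have e0 : P.mix u s 0 = b.blowUp hcross κ (b.railLoPsi κ α) 0 := by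
        rw [h2, b.blowUp_pieceLo_zero hcross hκ.ne', hβ0]; ring
      have e1 : P.mix u s 1 = b.blowUp hcross κ (b.railLoPsi κ α) 1 := by
        rw [h2, b.blowUp_pieceLo_one hcross hκ.ne', hβ0]; ring
      have hA := P.mix_zero_ge hf₁ hε₁ hr₁ hu hs
      by_cases hneg : α ≤ -1
      · -- far north on the rail: first coordinate negative (first flatness package)
        obtain ⟨hR0, -, -⟩ := b.blowUp_railLoPsi_coord h.flat hκ hflat
        have hR0' := (abs_le.1 hR0).2
        rw [abs_of_nonpos (by linarith)] at hR0'
        have hε8 := h.eps8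
        have hεn := h.flat.eps_nonneg
        rw [e0] at hA
        have hx : (1:ℝ) ≤ -α := by linarith
        have h1e : 0 ≤ 1 - ε := by linarith
        have := mul_le_mul_of_nonneg_right hx h1e
        linarith
      · push Not at hneg
        have hq1 : κ * (|α| + 1) < r₁ := by
          have : |α| < 1 := by rw [abs_lt]; constructor <;> linarith
          have := mul_lt_mul_of_pos_left (show |α| + 1 < 2 by linarith) hκ
          linarith
        obtain ⟨hR0, hR1, -⟩ := b.blowUp_railLoPsi_coord hf₁ hκ hq1
        have hR0' := (abs_le.1 hR0).2; have hR1' := (abs_le.1 hR1).2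
        have habs : |α| ≤ 1 := by rw [abs_le]; constructor <;> linarith
        by_cases hz1 : s ≤ P.zL
        · -- lower zone: monotone first coordinate of the spiked piece
          have hge := P.mix_zero_ge_sLo hf₁ hε₁ hr₁ hu ⟨hs.1, hz1⟩
          have h16 : b.alphaLo κ P.sLo = 1 / 16 := hsl.1
          have hT0 : P.trk P.sLo 0 = b.blowUp hcross κ (b.pieceLo hcross κ b.depthSign 1 (1 / 16)) 0 := by
            rw [P.trk_zoneLo (s := P.sLo) (P.paramLo_mem_core sixteenth_mem07) (by rw [h16]; norm_num)
              (by rw [h16]; norm_num; linarith), h16]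
          have hεB : ε₁ * bumpBound ≤ 1 / 64 := by nlinarith
          have hmono := b.strictMonoOn_blowUp_pieceLo_zero hf₁ hκ (u := 1) ⟨zero_le_one, le_rfl⟩ b.depthSign (A' := 1) (by linarith)
            (by have : ε₁ * (1 + bumpBound * (1 + 1)) = ε₁ + 2 * (ε₁ * bumpBound) := by ring
                linarith)
          have hlt : b.blowUp hcross κ (b.pieceLo hcross κ b.depthSign 1 α) 0 < b.blowUp hcross κ (b.pieceLo hcross κ b.depthSign 1 (1 / 16)) 0 :=
            hmono ⟨by linarith, by linarith⟩ ⟨by norm_num, by norm_num⟩ (by linarith)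
          have e0' : P.mix u s 0 = b.blowUp hcross κ (b.pieceLo hcross κ b.depthSign 1 α) 0 := by rw [h2]
          linarith
        by_cases hz2 : s ≤ P.zU
        · push Not at hz1
          have hq := P.mix_zero_ge_quarter hf₁ hε₁ hr₁ hu hs ⟨hz1.le, hz2⟩
          rw [e0] at hq
          have : ε₁ * (|α| + 1) ≤ 2 * ε₁ := by nlinarith [abs_nonneg α]
          linarith
        · push Not at hz2
          have hq := P.mix_one_ge_of_zU_le hf₁ hε₁ hr₁ hu ⟨hz2.le, hs.2⟩
          rw [e1] at hq
          have : ε₁ * (|α| + 1) ≤ 2 * ε₁ := by nlinarith [abs_nonneg α]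
          linarith
    · -- far regime on the rail
      push Not at hflat
      have hα7 : b.alphaLo κ t ∉ Icc (-1 : ℝ) 6 := by
        intro hm
        have : |b.alphaLo κ t| ≤ 6 := by rw [abs_le]; constructor <;> linarith [hm.1, hm.2]
        have := mul_le_mul_of_nonneg_left this hκ.le
        linarith
      rw [b.spikePiece_eq_neckPiece' h 1 (b.not_mem_spikeSet_of_coreLo htc hα7)]
      intro he
      refine hfar ?_
      rw [he]
      refine b.neckPiece_mem_farSet_coreLo h.κ_le_quarter hκ htc (hρr.trans ?_)
      have h1 : |(pt2 (κ * b.alphaLo κ t) (-κ) : 𝔼 2) 0| ≤ ‖(pt2 (κ * b.alphaLo κ t) (-κ) : 𝔼 2)‖ := by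
        simpa [Real.norm_eq_abs] using PiLp.norm_apply_le (pt2 (κ * b.alphaLo κ t) (-κ) : 𝔼 2) 0
      rw [pt2_apply_zero, abs_mul, abs_of_pos hκ] at h1
      linarith
  · -- before the lower core: the necked loop, in the far set
    push Not at hcore
    have hco := b.coreLo_lt_coreHi; have hwo := window_order (b := b)
    have hεL := b.epsLo_bounds.1; have hεH := b.epsHi_bounds.1
    have hns : t ∉ b.spikeSet κ := by
      rintro (⟨hc, -⟩ | ⟨hc, -⟩)
      · linarith [hc.1]
      · linarith [hc.1]
    rw [b.spikePiece_eq_neckPiece' h 1 hns]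
    intro he
    refine hfar ?_
    rw [he]
    by_cases hw : b.tcLo - b.epsLo / 2 ≤ t
    · exact b.neckPiece_mem_farSet_lowerWindow h.κ_le_quarter hκ hρg ⟨hw, by linarith [b.epsLo_bounds.1]⟩
        (fun hm ↦ by linarith [hm.1])
    · push Not at hw
      refine b.neckPiece_mem_farSet_of_not_mem ρ₂ (Ico_subset_Icc_self htI) ?_
      rintro (hm | hm)
      · linarith [hm.1]
      · have := b.epsHi_bounds.1; have := b.epsLo_bounds.1; linarith [hm.1]
set_option maxHeartbeats 400000 in -- buildfix (bf3-g27): 160k/180k FAIL, 200k PASS at accept time; line-neutral budget line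
/-- **Upper fixed points.** For `t > s₀'` in the fundamental domain, the host point differs from
every moving point. [folklore] -/
theorem mix_ne_host_of_sHi_lt {u : ℝ} (hu : u ∈ Icc (0 : ℝ) 1) {s : ℝ} (hs : s ∈ Icc P.sLo P.sHi) {t : ℝ}
    (htI : t ∈ Ico b.alo (b.alo + 1)) (ht : P.sHi < t) :
    ((psiN.symm (b.blowDown hcross κ (P.mix u s)) : 𝕊 3) : 𝔼 4) ≠ ((P.hostPt t : 𝕊 3) : 𝔼 4) := by
  have h := P.HU.cone.spike
  have hκ := h.κ_pos
  have hε0 := hf₁.eps_nonneg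
  have h256 := (epsU_small hε₁).2
  have hsmall := (epsU_small hε₁).1
  have hB := bumpBound_spec.1; have hC := smoothTransitionDerivBound_pos; have hTL := tgtLip_pos
  have hsh := P.sHi_spec
  have hfar := P.psiN_symm_blowDown_mix_not_mem_farSet hf₁ hε₁ hr₁ hu hs
  rw [P.coe_hostPt_of_sHi_lt htI ht]
  set ρ₂ := min (r / 2) (min b.gapLo b.gapHi) with hρ₂
  have hρr : ρ₂ ≤ r / 2 := min_le_left _ _
  have hρg : ρ₂ ≤ b.gapHi := (min_le_right _ _).trans (min_le_right _ _)
  have h8 := h.eight_lt_r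
  by_cases hcore : t ≤ b.tcHi + b.epsHi / 8
  · have htc : t ∈ Icc (b.tcHi - b.epsHi / 8) (b.tcHi + b.epsHi / 8) := ⟨by linarith [hsh.2.1], hcore⟩
    have hαt : b.alphaHi κ t < 1 / 16 := by
      rw [← hsh.1]; exact b.strictAntiOn_alphaHi (κ := κ) hκ (P.paramHi_mem_core sixteenth_mem07) htc ht
    by_cases hflat : κ * (|b.alphaHi κ t| + 1) < r
    · rw [b.spikePiece_one_coreHi h htc (norm_railHiParam_lt hκ hflat)]
      intro he
      have h1 := coe_psiN_symm_injective he
      have h2 : P.mix u s = b.blowUp hcross κ (b.pieceHi hcross κ b.depthSign 1 (b.alphaHi κ t)) := by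
        have := congrArg (b.blowUp hcross κ) h1
        rwa [b.blowUp_blowDown hcross hκ.ne'] at this
      set α := b.alphaHi κ t with hαdef
      have hβ0 : spikeBump α = 0 := spikeBump_eq_zero_of_le (by linarith)
      have e0 : P.mix u s 0 = b.blowUp hcross κ (b.railHiPsi κ α) 0 := by
        rw [h2, b.blowUp_pieceHi_zero hcross hκ.ne', hβ0]; ring
      have e1 : P.mix u s 1 = b.blowUp hcross κ (b.railHiPsi κ α) 1 := by
        rw [h2, b.blowUp_pieceHi hcross hκ.ne', hβ0]; simp
      have hA := P.mix_zero_ge hf₁ hε₁ hr₁ hu hs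
      by_cases hneg : α ≤ -1
      · obtain ⟨hR0, -, -⟩ := b.blowUp_railHiPsi_coord h.flat hκ hflat
        have hR0' := (abs_le.1 hR0).2
        rw [abs_of_nonpos (by linarith)] at hR0'
        have hε8 := h.eps8
        have hεn := h.flat.eps_nonneg
        rw [e0] at hA
        have hx : (1:ℝ) ≤ -α := by linarith
        have h1e : 0 ≤ 1 - ε := by linarith
        have := mul_le_mul_of_nonneg_right hx h1e
        linarith
      · push Not at hneg
        have hq1 : κ * (|α| + 1) < r₁ := by
          have : |α| < 1 := by rw [abs_lt]; constructor <;> linarith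
          have := mul_lt_mul_of_pos_left (show |α| + 1 < 2 by linarith) hκ
          linarith
        obtain ⟨hR0, hR1, -⟩ := b.blowUp_railHiPsi_coord hf₁ hκ hq1
        have hR0' := (abs_le.1 hR0).2; have hR1' := (abs_le.1 hR1).1
        have habs : |α| ≤ 1 := by rw [abs_le]; constructor <;> linarith
        by_cases hz1 : P.zU ≤ s
        · have hge := P.mix_zero_ge_sHi hf₁ hε₁ hr₁ hu ⟨hz1, hs.2⟩
          have h16 : b.alphaHi κ P.sHi = 1 / 16 := hsh.1
          have hT0 : P.trk P.sHi 0 = b.blowUp hcross κ (b.pieceHi hcross κ b.depthSign 1 (1 / 16)) 0 := by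
            rw [P.trk_zoneHi (s := P.sHi) (P.paramHi_mem_core sixteenth_mem07) (by rw [h16]; norm_num)
              (by rw [h16]; norm_num; linarith), h16]
          have hεB : ε₁ * bumpBound ≤ 1 / 64 := by nlinarith
          have hmono := b.strictMonoOn_blowUp_pieceHi_zero hf₁ hκ (u := 1) ⟨zero_le_one, le_rfl⟩ b.depthSign (A' := 1) (by linarith)
            (by have : ε₁ * (1 + bumpBound * (1 + 1)) = ε₁ + 2 * (ε₁ * bumpBound) := by ring
                linarith)
          have hlt : b.blowUp hcross κ (b.pieceHi hcross κ b.depthSign 1 α) 0 < b.blowUp hcross κ (b.pieceHi hcross κ b.depthSign 1 (1 / 16)) 0 :=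
            hmono ⟨by linarith, by linarith⟩ ⟨by norm_num, by norm_num⟩ (by linarith)
          have e0' : P.mix u s 0 = b.blowUp hcross κ (b.pieceHi hcross κ b.depthSign 1 α) 0 := by rw [h2]
          linarith
        by_cases hz2 : P.zL ≤ s
        · push Not at hz1
          have hq := P.mix_zero_ge_quarter hf₁ hε₁ hr₁ hu hs ⟨hz2, hz1.le⟩
          rw [e0] at hq
          have : ε₁ * (|α| + 1) ≤ 2 * ε₁ := by nlinarith [abs_nonneg α]
          linarith
        · push Not at hz2
          have hq := P.mix_one_le_of_le_zL hf₁ hε₁ hr₁ hu ⟨hs.1, hz2.le⟩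
          rw [e1] at hq
          have : ε₁ * (|α| + 1) ≤ 2 * ε₁ := by nlinarith [abs_nonneg α]
          linarith
    · push Not at hflat
      have hα7 : b.alphaHi κ t ∉ Icc (-1 : ℝ) 6 := by
        intro hm
        have : |b.alphaHi κ t| ≤ 6 := by rw [abs_le]; constructor <;> linarith [hm.1, hm.2]
        have := mul_le_mul_of_nonneg_left this hκ.le
        linarith
      rw [b.spikePiece_eq_neckPiece' h 1 (b.not_mem_spikeSet_of_coreHi htc hα7)]
      intro he
      refine hfar ?_
      rw [he]
      refine b.neckPiece_mem_farSet_coreHi h.κ_le_quarter hκ htc (hρr.trans ?_)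
      have h1 : |(pt2 (κ * b.alphaHi κ t) κ : 𝔼 2) 0| ≤ ‖(pt2 (κ * b.alphaHi κ t) κ : 𝔼 2)‖ := by
        simpa [Real.norm_eq_abs] using PiLp.norm_apply_le (pt2 (κ * b.alphaHi κ t) κ : 𝔼 2) 0
      rw [pt2_apply_zero, abs_mul, abs_of_pos hκ] at h1
      linarith
  · push Not at hcore
    have hco := b.coreLo_lt_coreHi; have hwo := window_order (b := b)
    have hεL := b.epsLo_bounds.1; have hεH := b.epsHi_bounds.1
    have hns : t ∉ b.spikeSet κ := by
      rintro (⟨hc, -⟩ | ⟨hc, -⟩)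
      · linarith [hc.2]
      · linarith [hc.2]
    rw [b.spikePiece_eq_neckPiece' h 1 hns]
    intro he
    refine hfar ?_
    rw [he]
    by_cases hw : t ≤ b.tcHi + b.epsHi / 2
    · exact b.neckPiece_mem_farSet_upperWindow h.κ_le_quarter hκ hρg ⟨by linarith [b.epsHi_bounds.1], hw⟩
        (fun hm ↦ by linarith [hm.2])
    · push Not at hw
      refine b.neckPiece_mem_farSet_of_not_mem ρ₂ (Ico_subset_Icc_self htI) ?_
      rintro (hm | hm)
      · have := b.epsHi_bounds.1; have := b.epsLo_bounds.1; linarith [hm.2]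
      · linarith [hm.2]

/-- **The moving points avoid the fixed part of the host.** [folklore] -/
theorem fam_ne_curve_host {u : ℝ} (hu : u ∈ Icc (0 : ℝ) 1) {s : ℝ} (hs : s ∈ Icc P.sLo P.sHi) {t : ℝ}
    (htI : t ∈ Ico b.alo (b.alo + 1)) (hts : t ∉ Icc P.sLo P.sHi) : P.fam u s ≠ Knot.curve P.host t := by
  rw [P.fam_of_mem hs, P.curve_host]
  rcases lt_or_ge t P.sLo with hlt | hge
  · exact P.mix_ne_host_of_lt_sLo hf₁ hε₁ hr₁ hu hs htI hlt
  · have hgt' : P.sHi < t := by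
      by_contra hc; push Not at hc
      exact hts ⟨hge, hc⟩
    exact P.mix_ne_host_of_sHi_lt hf₁ hε₁ hr₁ hu hs htI hgt'

end Disjoint

/-! ### The modification and the crossing retraction -/

/-- The moving interval lies in `[alo + seamEps, alo + 1 - seamEps]`. [folklore] -/
theorem Icc_sLo_sHi_subset_seam : Icc P.sLo P.sHi ⊆ Icc (b.alo + b.seamEps) (b.alo + 1 - b.seamEps) := by
  intro s hs
  obtain ⟨h1, -, -, h4⟩ := b.neckSet_bounds
  have hsl := P.sLo_spec; have hsh := P.sHi_spec
  have := b.epsLo_bounds.1; have := b.epsHi_bounds.1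
  exact ⟨by linarith [hs.1, hsl.2.1], by linarith [hs.2, hsh.2.2]⟩

/-- The moving interval lies in the fundamental domain `[alo, alo + 1)`. [folklore] -/
theorem Icc_sLo_sHi_subset_Ico : Icc P.sLo P.sHi ⊆ Ico b.alo (b.alo + 1) := fun s hs ↦ by
  have h := P.Icc_sLo_sHi_subset_seam hs
  have := b.seamEps_bounds.1
  exact ⟨by linarith [h.1], by linarith [h.2]⟩

section Assembly

variable {ε₁ r₁ : ℝ} (hf₁ : b.IsFlat hcross ε₁ r₁) (hε₁ : ε₁ ≤ epsU) (hr₁ : 4 * κ < r₁)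
include hf₁ hε₁ hr₁

/-- **The crossing retraction is a family of modifications of the host.** [folklore] -/
theorem isModification : P.host.IsModification b.alo b.seamEps P.fam (Icc P.sLo P.sHi) where
  ε_pos := b.seamEps_bounds.1
  contDiff := P.contDiff_fam
  subset := P.Icc_sLo_sHi_subset_seam
  isClosed := isClosed_Icc
  eq_curve u _ ht := P.fam_of_not_mem u (fun hh ↦ ht (Ioo_subset_Icc_self hh))
  zero_eq := P.fam_zero
  norm_eq_one u _ s hs := by rw [P.fam_of_mem hs]; exact norm_eq_of_mem_sphere _
  deriv_ne_zero _ hu _ hs := P.deriv_fam_ne_zero hf₁ hε₁ hr₁ hu hs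
  injOn _ hu := P.injOn_fam hf₁ hε₁ hr₁ hu
  disjoint _ hu _ hs _ ht hts := P.fam_ne_curve_host hf₁ hε₁ hr₁ hu hs ht hts

/-- **The retracted host**: the end knot of the crossing retraction. [folklore] -/
def outKnot : Knot := (P.isModification hf₁ hε₁ hr₁).knotAt 1

/-- **The host is isotopic to the retracted host.** Isotopy extension (Hirsch, Ch. 8 §1, Thm. 1.3)
applied to the family of modifications `fam`. [cite: HirschDT1976, Ch. 8 §1, Thm. 1.3] -/
theorem isIsotopic_host_outKnot : P.host.IsIsotopic (P.outKnot hf₁ hε₁ hr₁) := by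
  obtain ⟨Θ, -, hΘ, -⟩ := (P.isModification hf₁ hε₁ hr₁).exists_ambientIsotopy isOpen_univ (fun y hy ↦ absurd (mem_univ y) hy)
  exact ⟨Θ, hΘ 1 ⟨zero_le_one, le_rfl⟩⟩

/-- **The retracted host on the moving interval, in the chart**: `ψ⁻¹ (Fband (κ hh s))`, a point
of the TRUE band. [folklore] -/
theorem coe_outKnot_circlePt_of_mem {s : ℝ} (hs : s ∈ Icc P.sLo P.sHi) :
    ((P.outKnot hf₁ hε₁ hr₁ (circlePt s) : 𝕊 3) : 𝔼 4) = ((psiN.symm (b.Fband (κ • P.hh s)) : 𝕊 3) : 𝔼 4) := by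
  rw [outKnot, (P.isModification hf₁ hε₁ hr₁).coe_knotAt_circlePt_of_mem 1 hs, Real.smoothTransition.one, P.fam_of_mem hs,
    mix_one, P.blowDown_Npl]

/-- **The retracted host on the moving interval is the band point `band ((1/2, 1/2) + κ hh s)`.**
[folklore] -/
theorem outKnot_circlePt_of_mem {s : ℝ} (hs : s ∈ Icc P.sLo P.sHi) :
    P.outKnot hf₁ hε₁ hr₁ (circlePt s) = b.band (pt2 2⁻¹ 2⁻¹ + κ • P.hh s) := by
  apply Subtype.ext
  rw [P.coe_outKnot_circlePt_of_mem hf₁ hε₁ hr₁ hs, psiN_symm_Fband (P.norm_smul_hh_lt (P.Icc_sLo_sHi_subset hs)).1]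

/-- **The retracted host off the moving interval is the host.** [folklore] -/
theorem outKnot_circlePt_of_not_mem {t : ℝ} (ht : t ∈ Ico b.alo (b.alo + 1)) (hts : t ∉ Icc P.sLo P.sHi) :
    P.outKnot hf₁ hε₁ hr₁ (circlePt t) = P.host (circlePt t) := by
  rw [outKnot, (P.isModification hf₁ hε₁ hr₁).knotAt_apply_of_forall_not_mem 1 (fun s hs he ↦ ?_)]
  obtain ⟨m, hm⟩ := circlePt_eq_circlePt_iff.1 he
  have hsI : s ∈ Ico b.alo (b.alo + 1) := P.Icc_sLo_sHi_subset_Ico hs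
  have h1 : (m : ℝ) < 1 := by linarith [hsI.2, ht.1]
  have h2 : (-1 : ℝ) < m := by linarith [hsI.1, ht.2]
  have h1' : m < 1 := by exact_mod_cast h1
  have h2' : -1 < m := by exact_mod_cast h2
  obtain rfl : m = 0 := by omega
  simp only [Int.cast_zero, add_zero] at hm
  exact hts (hm ▸ hs)

/-- **The retracted host agrees with the host off the moving interval**, for all parameters
(periodic version). [folklore] -/
theorem outKnot_circlePt_of_forall_not_mem {t : ℝ} (hts : ∀ n : ℤ, t + n ∉ Icc P.sLo P.sHi) :
    P.outKnot hf₁ hε₁ hr₁ (circlePt t) = P.host (circlePt t) := by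
  obtain ⟨n, hn⟩ := exists_toIcoMod_one_eq b.alo t
  have hmem : toIcoMod zero_lt_one b.alo t ∈ Ico b.alo (b.alo + 1) := toIcoMod_mem_Ico _ _ _
  have e : circlePt t = circlePt (toIcoMod zero_lt_one b.alo t) := by
    rw [hn, show t - (n : ℝ) = t + ((-n : ℤ) : ℝ) by push_cast; ring, circlePt_add_int]
  rw [e, P.outKnot_circlePt_of_not_mem hf₁ hε₁ hr₁ hmem]
  rw [hn, show t - (n : ℝ) = t + ((-n : ℤ) : ℝ) by push_cast; ring]
  exact hts (-n)

end Assembly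

end HostHyp

end BandData

end Literature.Topology.FourManifolds
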